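import Summits.AtomisticToContinuum.Crystallization.Theses.PhononSlackCertificates
import Summits.AtomisticToContinuum.Crystallization.Theorems.ChargedEnergyGap.Negative.Unconditional

/-!
# Disproof work file — crux `NearFarGlueR` (stmt-AtomisticToContinuum-14970)

`NearFarGlueR : FarFieldGapR → NearFieldConvexity → CoerciveTwoShellGap`
(route `PhononSlackCertificates`, rank 4).  Standing disprover: refuter-cdisprove-stmt-14970-0.

## Findings (cycle 1, 2026-08-16) — NO KILL; the crux is EXACTLY `ContactGap` (thin half of the target): `ContactGap → NearFarGlueR` proved

* **F1 (costume, formal).** Both antecedents hold OUTRIGHT on thin sets: `farField_ineq_of_thin`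
  (the `FarFieldGapR` inequality is true for every `δ, g, R` with `C = g + 125/6·δ⁻⁶ + e*` whenever
  every particle of `U` has a non-`U` particle within `R`) and `nearField_ineq_of_thin` (the
  `NearFieldConvexity` inequality is true on `4`-thin `Ω` with `C = c + 125/6·δ⁻⁶ + e*`).  Hence on
  a configuration whose bad set is `R`-thin the glue receives NOTHING from its hypotheses: the
  implication is `CoerciveTwoShellGap` restricted to thin bad sets (surfaces, grain boundaries,
  point defects, mild distortions) — conjecture-grade, not `L`.  (Independently found by
  refuter-rattack-stmt-14970-0, `Evidence14970.lean`; re-proved here so this file is self-contained.)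
* **F2 (line `Sketch`, picked 2026-08-16T10:31Z).**  The reduction
  `descent → fibre → ContactGap → FarFieldGapR → NearFieldConvexity → CoerciveTwoShellGap`
  (`stub_glue`) is SOUND (paper check of the convex-combination bookkeeping, §3 docstring); its
  residual `stub_contactGap` is implied by the target (`contactGap_of_coerciveTwoShellGap`) and,
  by F1, is NOT helped by either antecedent: it is the honest crux.  Stub hypotheses that are
  load-bearing: goodness of `i` in `stub_descent` (`stub_descent_false_without_good`), separation
  in `stub_fibre` (`stub_fibre_false_without_sep`).  NOT load-bearing: the radius `3` of
  `stub_descent` (descent holds from every distance in a crystal; `3` is dictated by `ContactGap`),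
  the constant `1/4` of `stub_coverFcc/Hcp` (true covering constant of BOTH first shells is
  `√2/2 ≈ 0.707`, worst directions = square-face centres, e.g. `(0,1,0)` for the cuboctahedron and
  `(-2,1,-2)/3` for the anticuboctahedron in the tree's integer models; numerics in NOTES).
* **F3 (cheap falsity of the conclusion — none).**  Every defect family pays a POSITIVE quantum per
  (contact-)bad particle in the normalisation `V = r⁻¹²/12 − r⁻⁶/6`, `e* ≈ −0.7175`:
  free (111) surface ≈ 0.17/site; vacancy ≈ 0.72 per 18 bad neighbours = 0.040; one atom displaced
  just past the `a/20` tolerance ≈ ½·43·0.049² = 0.052 per ≤ 19 bad = 0.0027; 5 % homogeneous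
  shear ≈ 0.003/particle; isolated all-bad clusters ≥ +1.5/12 per particle up to N = 923; compressed
  / expanded crystals beyond the window ≥ 0.015/particle (far-field regime, no good particle at all).
  Minimal quantum ≈ 2.7e-3 ≈ 0.4 % of |e*| — so `g ≲ 3e-3` in `CoerciveTwoShellGap`/`ContactGap`,
  but no family drives the quantum to 0.  Degenerate N: N = 1 needs g ≤ |e*|; N = 2 needs
  e* + g ≤ −1/24; both fine.
* **F4 (formal, §8 — warning to provers of `ContactGap`).**  The POINTWISE strengthening "every
  contact-bad particle has site energy ≥ e* + g" is FALSE (`Pointwise.not_pointwiseContactGap`,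
  sorry-free explicit witness; filed as `Negative/PointwiseContactGap.lean`).  Mechanism: a bad particle may
  carry M ≈ 16/δ² other particles at distance exactly 1 (pairwise δ-separated), giving site
  energy ≤ −M/24 ≈ −(2/3)·δ⁻² (−6 at δ = 1/3, −67 at δ = 1/10) → −∞ as δ → 0, while a good particle
  sits at distance 3 (its own 3a/2-neighbourhood untouched; the shell pays r⁻¹² itself, which a
  site-wise inequality never sees).  Only GLOBAL (whole-energy) or boundary-charged forms survive; the
  lead's `ContactGap` is global — keep it so.  (Formalised with a COLLINEAR crowd of `M` particles at
  distances in `[1, 7/5]` from the bad particle, `V_LJ ≤ −1/50` there: site energy `≤ −M/100`.)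
* **F5 (no `_false_without_` theorems exist for this crux).**  The conclusion
  `CoerciveTwoShellGap` is believed TRUE (F3), so `NearFarGlueR` minus any hypothesis is still a
  true statement; load-bearing analysis is only meaningful for the LINE's stubs (F2).

* **F6 (structure, formal — the main result of this cycle).**  `FarFieldGapR` and `AllBadGap` are
  COROLLARIES of the target: `farFieldGapR_of_coerciveTwoShellGap : CoerciveTwoShellGap → FarFieldGapR`
  (restriction to `U` + tail shell sum `sum_inv_pow_six_tail_le` + goodness transfer
  `good_of_good_comp`; sorry-free) and `allBadGap_of_coerciveTwoShellGap`.  With F2 and the lead's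
  sound `stub_glue`: modulo `descent`/`fibre` and the `C`-part of `NearFieldConvexity`,
  `CoerciveTwoShellGap ⟺ ContactGap(3) ∧ FarFieldGapR`.  So the route's decomposition of the target
  is: thick part (`FarFieldGapR`, XL) + thin part (`ContactGap(3)`, hidden inside the `L`-graded glue)
  — the glue is misgraded, and `promote-stub ContactGap` (lead) is the correct move.  Combined with
  the sibling disprover's `farFieldGapR_iff_allBadGap` (Cruxes/FarFieldGapR/Disproof.lean, modulo
  that crux's line): `CoerciveTwoShellGap ⟺ ContactGap(3) ∧ AllBadGap` — the route's engine is
  exactly "thin defects next to good crystal pay" + "all-bad bulk pays", both conjecture-grade.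
  (Not duplicated here, see that file: `not_fixedRadius R₀` — no δ-independent slack radius, for
  every `R₀`, which also forbids re-pointing `FarFieldGapR`'s boundary term to the fixed contact
  radius `3` site-wise; `not_pointwise`, `not_uniformC`, `not_withoutSep`, `not_withoutBad`.)

* **F7 (dead end recorded: the `C`-part of `NearFieldConvexity` resists).**  For `η` large the
  near-field inequality reduces to `Σ_Ω (e_i − e*) ≥ −C·#∂₄Ω` for `Ω ⊆` good.  Attempts to break it
  with dense `δ`-matter ("clouds", as in the `FarFieldGap` refutation) fail: a good particle has a
  clean `3a/2`-ball, an interior particle of `Ω` (nothing foreign within `4`) sits in crystal out to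
  `≈ 5.4`, every non-`Ω` particle's nearest `Ω`-particle is a `4`-boundary particle (descent), and the
  cloud's attraction on `Ω` is surface-order: per unit interface area ≈ `0.02·ρ_W` (slab),
  `≈ 1.44·ρ_W·4πr_c²` for a junk-filled cavity of radius `r_c`, `≤ 0.31·ρ_W·#∂₄Ω` for small balls
  (`ρ_W ≤ √2/δ³`), against `#∂₄Ω ≈ 4.6` per unit area — so `C(δ) ≈ 0.04·δ⁻³ + 125/6·δ⁻⁶` suffices in
  every geometry tried (ball, slab, cavity, central defect cluster).  Naive charging arguments show
  spurious `log(diam)` factors (grouping far junk by nearest boundary particle); the direct double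
  integral has none.  Not formalised; recorded so that nobody re-runs the cloud attack on NFC.

* **F8 (formal — `NearFieldConvexity` is NOT load-bearing; the lead's `stub_glue` is CLOSED).**
  `coerciveTwoShellGap_of_far_contact : Descent → ContactGapAt 3 → FarFieldGapR → CoerciveTwoShellGap`
  (sorry-free, axioms {propext, Classical.choice, Quot.sound}): the good particles are handled by
  restriction + periodisation (`card_mul_eStar_le`, proved in tree) with the cross attraction charged
  to the bad side (`2A` per `R'`-boundary bad particle, `g` per `R'`-interior one, tail shell sum),
  so the near field's `C`-part is never needed; `#∂_{R'}B ≤ (1+(2R'/δ+1)³)·#B_c` by nearest good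
  particle + ONE descent step + fibre (`fibre_count`, = `stub_fibre` proved); convex combination.
  Corollaries: `stub_glue_proof` (verbatim signature of the skeleton's `stub_glue`; ignores its
  fibre and near-field hypotheses), `nearFarGlueR_of_descent_contact : Descent → ContactGapAt 3 →
  NearFarGlueR`, `coerciveTwoShellGap_iff_far_and_contact (hd : Descent) : CoerciveTwoShellGap ↔
  FarFieldGapR ∧ ContactGapAt 3`.  UPSHOT FOR THE LEAD: after `stub_coverFcc/Hcp` + `stub_descent`
  the ONLY open input of the crux is `stub_contactGap`.  UPSHOT FOR THE PLANNER: the crux's deps are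
  `[ContactGapAt 3]`, not `[FarFieldGapR, NearFieldConvexity]`; `NearFieldConvexity` serves
  `HullBridge` only; the engine is `CoerciveTwoShellGap = FarFieldGapR (thick) ∧ ContactGapAt 3 (thin)`.

* **F9 (formal — the line is CLOSED down to its residual; the crux = `ContactGap` exactly).**
  §7 proves every provable stub of the picked line with verbatim signatures (`stub_coverFcc_proof`,
  `stub_coverHcp_proof`, `stub_descent_proof`; with §6's `fibre_count`, `stub_glue_proof`), hence
  UNCONDITIONALLY `nearFarGlueR_of_contactGap : ContactGap → NearFarGlueR` and
  `coerciveTwoShellGap_iff : CoerciveTwoShellGap ↔ FarFieldGapR ∧ ContactGapAt 3`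
  (consolidated evidence file `LineClosure.lean`, 12:21Z).  VERDICT OF CYCLE 1: no kill; the crux
  is neither vacuous nor trivial but is, as typed, PRECISELY the thin half `ContactGap` of the
  conjecture-grade target (F3: every thin-defect family pays ≥ 2.7e-3 per bad particle, so no
  refutation is in sight either); recommendation: promote `stub_contactGap` to a crux, re-grade,
  drop `NearFieldConvexity` from the glue's deps.

* **F10 (formal, §9 — the sharpest form of the residual).**  Covers with constant `3/5`
  (`sharp_coverFcc/Hcp`: two-largest-coordinates argument, `(|w_a|+|w_b|)² ≥ 1 + w_c²`; hcp extra
  cases via the lower vectors `(−4,−1,−1)/√18` and in-plane `(−3,0,3)/√18`; true constant `√2/2`),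
  descent from distance `21/20` (`descent_sharp`), the glue at any contact radius `r ≥ 21/20`
  (`coerciveTwoShellGap_of_far_contact_at`) ⇒ UNCONDITIONALLY
  `nearFarGlueR_of_contactGapAt (hr : 21/20 ≤ r) : ContactGapAt r → NearFarGlueR` and
  `coerciveTwoShellGap_iff_at (hr) : CoerciveTwoShellGap ↔ FarFieldGapR ∧ ContactGapAt r`.
  THE CRUX IS THE FIRST-CONTACT GAP: "every bad particle within `21/20` of a good particle pays
  `g(δ) > 0` in the total energy" — the cleanest statement for the planner to promote.

Sections: §1 notation · §2 thin-set vacuity (F1) · §3 ContactGap vs target (F2) ·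
§4 stub witnesses (F2) · §5 FarFieldGapR/AllBadGap ⟸ target (F6) · §6 near-free glue, stub_glue closed (F8) ·
§7 covers, descent, crux ⟸ ContactGap unconditionally (F9) · §8 pointwise ContactGap refuted (F4) ·
§9 first-contact residual: crux ⟸ ContactGapAt (21/20) (F10).
-/

noncomputable section

open scoped BigOperators InnerProductSpace
open Literature.MathematicalPhysics.StatisticalMechanics Literature.Geometry.DiscreteGeometry
open Summit.AtomisticToContinuum.Crystallization.Theses.PhononSlackCertificates

namespace Summit.AtomisticToContinuum.Crystallization.Cruxes.NearFarGlueR.Disproof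

/-! ## §1 Notation -/

/-- `e* = ⨅_Q e(Q)`, the periodic ground-state energy per particle (a genuine infimum:
`CrysPeriodicBddBelow` is proved in tree). -/
abbrev eStar : ℝ := ⨅ Q : PeriodicConfiguration 3, Q.energyPerParticle lennardJones

/-- Half the site energy, `e_i = ½ Σ_{j ≠ i} V(|x_i − x_j|)` (the form used verbatim by the route). -/
abbrev halfSite {N : ℕ} (x : Fin N → EuclideanSpace ℝ (Fin 3)) (i : Fin N) : ℝ :=
  (1 / 2 : ℝ) * ∑ j ∈ Finset.univ.erase i, lennardJones (dist (x i) (x j))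

/-- `1/20`-goodness on the window `[47/50, 1]`. -/
abbrev Good {N : ℕ} (x : Fin N → EuclideanSpace ℝ (Fin 3)) (i : Fin N) : Prop :=
  IsTwoShellGood (1 / 20) (47 / 50) 1 x i

/-! ## §2 Thin-set vacuity of both antecedents (finding F1) -/

/-- Site energies of a `δ`-separated configuration are bounded below:
`½ Σ_{j≠i} V_LJ(|x_i − x_j|) ≥ −(125/6)·δ⁻⁶` (attractive tail `V ≥ −r⁻⁶/6` + shell sum `≤ 250 δ⁻⁶`). -/
theorem halfSite_ge {N : ℕ} {δ : ℝ} (hδ : 0 < δ) (x : Fin N → EuclideanSpace ℝ (Fin 3))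
    (hsep : ∀ i j : Fin N, i ≠ j → δ ≤ dist (x i) (x j)) (i : Fin N) :
    -((125 / 6 : ℝ) * δ⁻¹ ^ 6) ≤ halfSite x i := by
  have hshell := sum_inv_pow_six_le x hδ hsep i
  have hterm : ∀ j ∈ Finset.univ.erase i,
      -((1 / 6 : ℝ) * (dist (x i) (x j))⁻¹ ^ 6) ≤ lennardJones (dist (x i) (x j)) := by
    intro j hj
    have hij : i ≠ j := (Finset.ne_of_mem_erase hj).symm
    have hpos : 0 < dist (x i) (x j) := lt_of_lt_of_le hδ (hsep i j hij)
    exact neg_le_lennardJones_of_le hpos le_rfl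
  have hsum : -((1 / 6 : ℝ) * ∑ j ∈ Finset.univ.erase i, (dist (x i) (x j))⁻¹ ^ 6) ≤
      ∑ j ∈ Finset.univ.erase i, lennardJones (dist (x i) (x j)) := by
    rw [Finset.mul_sum, ← Finset.sum_neg_distrib]
    exact Finset.sum_le_sum hterm
  unfold halfSite
  nlinarith [hsum, hshell]

/-- **F1a.** The `FarFieldGapR` inequality holds OUTRIGHT — for every `δ > 0`, every `g`, every `R`,
with `C := g + 125/6·δ⁻⁶ + e*` — on every `U` all of whose particles see a non-`U` particle within
`R` (an `R`-thin set; then the boundary count is `#U`).  No badness hypothesis is used. -/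
theorem farField_ineq_of_thin {δ : ℝ} (hδ : 0 < δ) (g R : ℝ) {N : ℕ}
    (x : Fin N → EuclideanSpace ℝ (Fin 3)) (hsep : ∀ i j : Fin N, i ≠ j → δ ≤ dist (x i) (x j))
    (U : Finset (Fin N)) (hthin : ∀ i ∈ U, ∃ j : Fin N, j ∉ U ∧ dist (x j) (x i) ≤ R) :
    g * (U.card : ℝ) - (g + (125 / 6 : ℝ) * δ⁻¹ ^ 6 + eStar) *
        (Nat.card {i : Fin N // i ∈ U ∧ ∃ j : Fin N, j ∉ U ∧ dist (x j) (x i) ≤ R} : ℝ) ≤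
      ∑ i ∈ U, (halfSite x i - eStar) := by
  have hcard : (Nat.card {i : Fin N // i ∈ U ∧ ∃ j : Fin N, j ∉ U ∧ dist (x j) (x i) ≤ R} : ℝ) =
      (U.card : ℝ) := by
    have e : {i : Fin N // i ∈ U ∧ ∃ j : Fin N, j ∉ U ∧ dist (x j) (x i) ≤ R} ≃ {i : Fin N // i ∈ U} :=
      Equiv.subtypeEquivRight fun i => ⟨fun h => h.1, fun h => ⟨h, hthin i h⟩⟩
    rw [Nat.card_congr e, Nat.card_eq_fintype_card, Fintype.card_coe]
  rw [hcard]
  have hpt : ∀ i ∈ U, -((125 / 6 : ℝ) * δ⁻¹ ^ 6) - eStar ≤ halfSite x i - eStar := fun i _ =>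
    sub_le_sub_right (halfSite_ge hδ x hsep i) _
  have := Finset.sum_le_sum hpt
  simp only [Finset.sum_const, nsmul_eq_mul] at this
  nlinarith [this]

/-- **F1b.** The `NearFieldConvexity` inequality holds OUTRIGHT on `4`-thin `Ω` for every `c ≥ 0`
with `C := c + 125/6·δ⁻⁶ + e*` (the positive term is at most `c·#Ω`, the boundary term is all of `Ω`).
No goodness and no layeredness is used: `P` is an arbitrary predicate standing for "non-layered". -/
theorem nearField_ineq_of_thin {δ : ℝ} (hδ : 0 < δ) {c : ℝ} (hc : 0 ≤ c) {N : ℕ}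
    (x : Fin N → EuclideanSpace ℝ (Fin 3)) (hsep : ∀ i j : Fin N, i ≠ j → δ ≤ dist (x i) (x j))
    (Ω : Finset (Fin N)) (P : Fin N → Prop)
    (hthin : ∀ i ∈ Ω, ∃ j : Fin N, j ∉ Ω ∧ dist (x j) (x i) ≤ 4) :
    c * (Nat.card {i : Fin N // i ∈ Ω ∧ P i} : ℝ) - (c + (125 / 6 : ℝ) * δ⁻¹ ^ 6 + eStar) *
        (Nat.card {i : Fin N // i ∈ Ω ∧ ∃ j : Fin N, j ∉ Ω ∧ dist (x j) (x i) ≤ 4} : ℝ) ≤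
      ∑ i ∈ Ω, (halfSite x i - eStar) := by
  have hcard : (Nat.card {i : Fin N // i ∈ Ω ∧ ∃ j : Fin N, j ∉ Ω ∧ dist (x j) (x i) ≤ 4} : ℝ) =
      (Ω.card : ℝ) := by
    have e : {i : Fin N // i ∈ Ω ∧ ∃ j : Fin N, j ∉ Ω ∧ dist (x j) (x i) ≤ 4} ≃ {i : Fin N // i ∈ Ω} :=
      Equiv.subtypeEquivRight fun i => ⟨fun h => h.1, fun h => ⟨h, hthin i h⟩⟩
    rw [Nat.card_congr e, Nat.card_eq_fintype_card, Fintype.card_coe]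
  have hle : (Nat.card {i : Fin N // i ∈ Ω ∧ P i} : ℝ) ≤ (Ω.card : ℝ) := by
    have hfin : Finite {i : Fin N // i ∈ Ω} := inferInstance
    have h := Nat.card_le_card_of_injective
      (fun a : {i : Fin N // i ∈ Ω ∧ P i} => (⟨a.1, a.2.1⟩ : {i : Fin N // i ∈ Ω}))
      (fun a b hab => Subtype.ext (by simpa using congrArg Subtype.val hab))
    rw [Nat.card_eq_fintype_card (α := {i : Fin N // i ∈ Ω}), Fintype.card_coe] at h
    exact_mod_cast h
  rw [hcard]
  have hpt : ∀ i ∈ Ω, -((125 / 6 : ℝ) * δ⁻¹ ^ 6) - eStar ≤ halfSite x i - eStar := fun i _ =>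
    sub_le_sub_right (halfSite_ge hδ x hsep i) _
  have hs := Finset.sum_le_sum hpt
  simp only [Finset.sum_const, nsmul_eq_mul] at hs
  have h1 : c * (Nat.card {i : Fin N // i ∈ Ω ∧ P i} : ℝ) ≤ c * (Ω.card : ℝ) :=
    mul_le_mul_of_nonneg_left hle hc
  nlinarith [hs, h1]


/-! ## §3 The line's residual `ContactGap` versus the target (finding F2)

`ContactGap` is the lead's `stub_contactGap` verbatim (prover-line-stmt-14970-0, skeleton sha adf7c32b…):
only bad particles within `3` of a GOOD particle are charged.  It is a consequence of the target
(`contactGap_of_coerciveTwoShellGap`, monotonicity of the count), and by §2 neither antecedent of the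
crux says anything about it (a contact-bad particle is `R`-boundary in `FarFieldGapR` for every
`R ≥ 3` and makes its good neighbours `4`-boundary in `NearFieldConvexity`).  Paper check of
`stub_glue` (sound): with `B` = bad, `G` = good, `B_c` = contact-bad,
`Σ_B (e_i − e*) ≥ g#B − |C'|·#∂_R B`, `#∂_R B ≤ (1 + (2R/δ+1)³)·#B_c` (descent from the nearest good
particle at distance `∈ (3, R]` lands in `B_c` strictly closer, then fibre), `Σ_G (e_i − e*) ≥ −|C|·#∂₄G`,
`#∂₄G ≤ (8/δ+1)³·#B₄ ≤ (8/δ+1)³(1 + (8/δ+1)³)·#B_c`; so `E − N e* ≥ g#B − M#B_c` and with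
`E − N e* ≥ g₂ #B_c` the convex combination `λ = g₂/(g₂+M)` gives `E − N e* ≥ λ g #B`.  No use of the
size or sign of `C, C', R` beyond `|·|` — consistent with F1: all content sits in `ContactGap`. -/

/-- **Contact gap at radius `r`**: every bad particle within `r` of a good particle pays `g₂` in the
total energy.  The lead's residual `stub_contactGap` is verbatim `ContactGapAt 3` (= `ContactGap`). -/
def ContactGapAt (r : ℝ) : Prop :=
  ∀ δ : ℝ, 0 < δ → ∃ g₂ : ℝ, 0 < g₂ ∧ ∀ (N : ℕ) (x : Fin N → EuclideanSpace ℝ (Fin 3)),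
    (∀ i j : Fin N, i ≠ j → δ ≤ dist (x i) (x j)) →
      (N : ℝ) * (⨅ Q : PeriodicConfiguration 3, Q.energyPerParticle lennardJones) +
          g₂ * (Nat.card {j : Fin N // ¬ IsTwoShellGood (1 / 20) (47 / 50) 1 x j ∧
            ∃ i : Fin N, IsTwoShellGood (1 / 20) (47 / 50) 1 x i ∧ dist (x i) (x j) ≤ r} : ℝ) ≤
        interactionEnergy lennardJones x

/-- The lead's residual stub, verbatim. -/
abbrev ContactGap : Prop := ContactGapAt 3

/-- **F2a.** `ContactGap` is implied by the target `CoerciveTwoShellGap` (same `g`): the contact-bad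
particles are among the bad ones.  So the line `Sketch` reduces the glue to a WEAKENING of its own
conclusion; by F1 this weakening is exactly the part of the target the antecedents do not cover. -/
theorem contactGap_of_coerciveTwoShellGap : CoerciveTwoShellGap → ContactGap := by
  intro h δ hδ
  obtain ⟨g, hg, hall⟩ := h δ hδ
  refine ⟨g, hg, fun N x hsep => ?_⟩
  have hE := hall N x hsep
  have hle : (Nat.card {j : Fin N // ¬ IsTwoShellGood (1 / 20) (47 / 50) 1 x j ∧
        ∃ i : Fin N, IsTwoShellGood (1 / 20) (47 / 50) 1 x i ∧ dist (x i) (x j) ≤ 3} : ℝ) ≤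
      (Nat.card {i : Fin N // ¬ IsTwoShellGood (1 / 20) (47 / 50) 1 x i} : ℝ) := by
    have h := Nat.card_le_card_of_injective
      (fun a : {j : Fin N // ¬ IsTwoShellGood (1 / 20) (47 / 50) 1 x j ∧
          ∃ i : Fin N, IsTwoShellGood (1 / 20) (47 / 50) 1 x i ∧ dist (x i) (x j) ≤ 3} =>
        (⟨a.1, a.2.1⟩ : {i : Fin N // ¬ IsTwoShellGood (1 / 20) (47 / 50) 1 x i}))
      (fun a b hab => Subtype.ext (by simpa using congrArg Subtype.val hab))
    exact_mod_cast h
  have := mul_le_mul_of_nonneg_left hle hg.le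
  linarith

/-! ## §4 Line `Sketch`: which stub hypotheses are load-bearing (finding F2)

Witnesses are two-particle configurations; badness of an isolated particle is by counting
(a good particle has `18` assigned neighbours, `not_good_of_lt_nineteen`). -/

/-- Fewer than `19` particles ⇒ nobody is good (the assignment `f` is injective on the `18`-point
pattern and avoids `i`). -/
theorem not_good_of_lt_nineteen {ε lo hi : ℝ} {N : ℕ} (hN : N < 19)
    (x : Fin N → EuclideanSpace ℝ (Fin 3)) (i : Fin N) : ¬ IsTwoShellGood ε lo hi x i := by
  rintro ⟨a, -, -, A, P, f, hP, hf, hinj, -⟩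
  classical
  have h18 : (P.image f).card = 18 := by
    rw [Finset.card_image_of_injOn hinj, card_eq_eighteen_of_twoShellPattern hP]
  have hsub : P.image f ⊆ Finset.univ.erase i := by
    intro k hk
    obtain ⟨v, hv, rfl⟩ := Finset.mem_image.1 hk
    exact Finset.mem_erase.2 ⟨(hf v hv).1, Finset.mem_univ _⟩
  have hle := Finset.card_le_card hsub
  rw [h18, Finset.card_erase_of_mem (Finset.mem_univ i), Finset.card_univ, Fintype.card_fin] at hle
  omega

/-- The two-particle witness configuration: `x 0 = 0`, `x 1 = 4·e₀`. -/
def twoFar : Fin 2 → EuclideanSpace ℝ (Fin 3) :=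
  ![0, EuclideanSpace.single 0 4]

theorem dist_twoFar : dist (twoFar 1) (twoFar 0) = 4 := by
  simp [twoFar]

/-- **F2b.** `stub_descent` WITHOUT the goodness of `i` is false: two particles at distance `4`
(both bad by counting); no third particle exists to step to.  So any proof of `stub_descent` must use
`IsTwoShellGood … x i` (it supplies the first-shell neighbour through `stub_coverFcc/Hcp`). -/
theorem stub_descent_false_without_good :
    ¬ (∀ (N : ℕ) (x : Fin N → EuclideanSpace ℝ (Fin 3)) (i j : Fin N),
        ¬ IsTwoShellGood (1 / 20) (47 / 50) 1 x j → 3 < dist (x j) (x i) →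
          ∃ k : Fin N, k ≠ i ∧ dist (x k) (x i) ≤ 21 / 20 ∧ dist (x j) (x k) < dist (x j) (x i)) := by
  intro h
  obtain ⟨k, hk, hd, -⟩ := h 2 twoFar 0 1 (not_good_of_lt_nineteen (by norm_num) _ _)
    (by rw [dist_twoFar]; norm_num)
  fin_cases k
  · exact hk rfl
  · have : dist (twoFar 1) (twoFar 0) ≤ 21 / 20 := hd
    rw [dist_twoFar] at this
    norm_num at this

/-- **F2c.** `stub_fibre` WITHOUT the separation hypothesis is false: two coincident particles,
`S = univ`, `T = {0}`, `R = 0`, `δ = 1` gives `2 ≤ 1`.  So the packing hypothesis is load-bearing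
(and the constant must grow like `(R/δ)³`: a `δ`-grid filling `B(x_k, R)` has ≈ `4.19 (R/δ)³` points). -/
theorem stub_fibre_false_without_sep :
    ¬ (∀ (δ R : ℝ), 0 < δ → 0 ≤ R → ∀ (N : ℕ) (x : Fin N → EuclideanSpace ℝ (Fin 3))
        (S T : Finset (Fin N)), (∀ j ∈ S, ∃ k ∈ T, dist (x j) (x k) ≤ R) →
          (S.card : ℝ) ≤ (2 * R / δ + 1) ^ 3 * (T.card : ℝ)) := by
  intro h
  have := h 1 0 one_pos le_rfl 2 (fun _ => 0) Finset.univ {0}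
    (fun j _ => ⟨0, Finset.mem_singleton_self 0, by simp⟩)
  simp at this

/-! ## §5 `FarFieldGapR` (and `AllBadGap`) are corollaries of the target (finding F6)

The route files `FarFieldGapR` (rank 2, XL) as an independent crux feeding the glue.  It is in fact
IMPLIED by the glue's conclusion: `farFieldGapR_of_coerciveTwoShellGap`.  Together with §3 and the
lead's (sound) `stub_glue`, modulo the provable stubs `descent`/`fibre` and the `C`-part of
`NearFieldConvexity`:  `CoerciveTwoShellGap ⟺ ContactGap(3) ∧ FarFieldGapR` — thin part plus thick
part, nothing else.  Consequences: (i) `FarFieldGapR` cannot be refuted without refuting the target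
(kill criterion (i) of the route kills the target, not just the far field); (ii) a proof of the glue
that does not prove `ContactGap(3)` from scratch does not exist; (iii) the `L` grade of the glue is a
misgrade (it is the thin half of a conjecture-grade statement). -/

/-- **`AllBadGap` is a corollary of the target** (all particles bad ⇒ the bad count is `N`).
[folklore] -/
theorem allBadGap_of_coerciveTwoShellGap (hT : CoerciveTwoShellGap) : AllBadGap := by
  intro δ hδ
  obtain ⟨g, hg, hall⟩ := hT δ hδ
  refine ⟨g, hg, fun N x hsep hbad => ?_⟩
  have hE := hall N x hsep
  have hcard : (Nat.card {i : Fin N // ¬ IsTwoShellGood (1 / 20) (47 / 50) 1 x i} : ℝ) = N := by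
    have e : {i : Fin N // ¬ IsTwoShellGood (1 / 20) (47 / 50) 1 x i} ≃ Fin N :=
      Equiv.subtypeUnivEquiv hbad
    rw [Nat.card_congr e, Nat.card_eq_fintype_card, Fintype.card_fin]
  rw [hcard] at hE
  linarith

/-- **Tail shell sum.** If all mutual distances in `x` are `≥ r > 0` and every `k ∈ S` is at
distance `≥ r·b₀` from `x i` (`b₀ ≥ 1`), then `Σ_{k ∈ S} |x_i − x_k|⁻⁶ ≤ 250·r⁻⁶/b₀`
(the proof of `sum_inv_pow_six_le`, started at shell `b₀`; `Σ_{b ≥ b₀} b⁻² ≤ 2/b₀`). [folklore] -/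
theorem sum_inv_pow_six_tail_le {N : ℕ} (x : Fin N → EuclideanSpace ℝ (Fin 3)) {r : ℝ} (hr : 0 < r)
    (hsep : ∀ k l, k ≠ l → r ≤ dist (x k) (x l)) (i : Fin N) (S : Finset (Fin N)) {b₀ : ℕ}
    (hb₀ : 1 ≤ b₀) (hS : ∀ k ∈ S, r * b₀ ≤ dist (x i) (x k)) :
    ∑ k ∈ S, (dist (x i) (x k))⁻¹ ^ 6 ≤ 250 * r⁻¹ ^ 6 / b₀ := by
  classical
  set m : Fin N → ℕ := fun k => ⌊dist (x i) (x k) / r⌋₊ with hm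
  set t := S.image m with ht_def
  have hmem : ∀ k ∈ S, m k ∈ t := fun k hk => Finset.mem_image_of_mem m hk
  have hb₀r : (1 : ℝ) ≤ (b₀ : ℝ) := by exact_mod_cast hb₀
  have hks : ∀ k ∈ S, r ≤ dist (x i) (x k) := fun k hk =>
    le_trans (by nlinarith) (hS k hk)
  have hmb : ∀ k ∈ S, b₀ ≤ m k := fun k hk =>
    Nat.le_floor ((le_div_iff₀ hr).2 (by rw [mul_comm]; exact hS k hk))
  have hm1 : ∀ k ∈ S, 1 ≤ m k := fun k hk => hb₀.trans (hmb k hk)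
  have hmle : ∀ k ∈ S, r * m k ≤ dist (x i) (x k) := fun k hk => by
    have := Nat.floor_le (div_nonneg dist_nonneg hr.le : 0 ≤ dist (x i) (x k) / r)
    rwa [le_div_iff₀ hr, mul_comm] at this
  have hmlt : ∀ k ∈ S, dist (x i) (x k) < (m k + 1) * r := fun k hk => by
    have := Nat.lt_floor_add_one (dist (x i) (x k) / r)
    rwa [div_lt_iff₀ hr] at this
  have step1 : ∑ k ∈ S, (dist (x i) (x k))⁻¹ ^ 6 ≤ ∑ k ∈ S, r⁻¹ ^ 6 * ((m k : ℝ))⁻¹ ^ 6 := by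
    refine Finset.sum_le_sum fun k hk => ?_
    rw [← mul_pow, ← mul_inv]
    have h0 : 0 < r * m k := mul_pos hr (by exact_mod_cast hm1 k hk)
    exact pow_le_pow_left₀ (inv_nonneg.2 dist_nonneg) (inv_anti₀ h0 (hmle k hk)) _
  have step2 : ∑ k ∈ S, r⁻¹ ^ 6 * ((m k : ℝ))⁻¹ ^ 6 =
      ∑ b ∈ t, ((S.filter fun k => m k = b).card : ℝ) * (r⁻¹ ^ 6 * ((b : ℝ))⁻¹ ^ 6) := by
    have := Finset.sum_fiberwise_of_maps_to' hmem (fun b : ℕ => r⁻¹ ^ 6 * ((b : ℝ))⁻¹ ^ 6)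
    simp only [Finset.sum_const, nsmul_eq_mul] at this
    exact this.symm
  have step3 : ∀ b ∈ t, ((S.filter fun k => m k = b).card : ℝ) ≤ (2 * (b : ℝ) + 3) ^ 3 := by
    intro b hb
    set F := S.filter fun k => m k = b with hF
    have hinj : Set.InjOn x F := fun k _ l _ hkl => by
      by_contra hne
      have := hsep k l hne
      rw [hkl, dist_self] at this
      exact absurd this (not_le.2 hr)
    rw [← Finset.card_image_of_injOn hinj]
    have hR : (0 : ℝ) ≤ ((b : ℝ) + 1) * r := by positivity
    have := card_le_of_separated_of_dist_le (F.image x) (x i) hr hR ?_ ?_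
    · rw [finrank_euclideanSpace_fin] at this
      convert this using 2
      field_simp
      ring
    · intro c hc
      obtain ⟨k, hk, rfl⟩ := Finset.mem_image.1 hc
      obtain ⟨hks', hkb⟩ := Finset.mem_filter.1 hk
      rw [dist_comm]
      have := hmlt k hks'
      rw [hkb] at this
      exact this.le
    · intro c hc c' hc' hne
      obtain ⟨k, -, rfl⟩ := Finset.mem_image.1 hc
      obtain ⟨l, -, rfl⟩ := Finset.mem_image.1 hc'
      exact hsep k l fun h => hne (h ▸ rfl)
  have step4 : ∀ b ∈ t, (2 * (b : ℝ) + 3) ^ 3 * (r⁻¹ ^ 6 * ((b : ℝ))⁻¹ ^ 6) ≤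
      125 * r⁻¹ ^ 6 * ((b : ℝ) ^ 2)⁻¹ := by
    intro b hb
    obtain ⟨k, hk, rfl⟩ := Finset.mem_image.1 hb
    have hb1 : (1 : ℝ) ≤ (m k : ℝ) := by exact_mod_cast hm1 k hk
    set β : ℝ := (m k : ℝ)
    have hβ : 0 < β := by linarith
    have hr6 : 0 < r⁻¹ ^ 6 := by positivity
    have key : (2 * β + 3) ^ 3 * (β⁻¹) ^ 6 ≤ 125 * (β ^ 2)⁻¹ := by
      rw [inv_pow, ← div_eq_mul_inv, ← div_eq_mul_inv,
        div_le_div_iff₀ (by positivity) (by positivity)]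
      have h5 : (2 * β + 3) ^ 3 ≤ (5 * β) ^ 3 :=
        pow_le_pow_left₀ (by positivity) (by linarith) 3
      have h6 : β ^ 5 ≤ β ^ 6 := pow_le_pow_right₀ hb1 (by norm_num)
      nlinarith [mul_le_mul_of_nonneg_right h5 (sq_nonneg β)]
    calc (2 * β + 3) ^ 3 * (r⁻¹ ^ 6 * (β⁻¹) ^ 6) = r⁻¹ ^ 6 * ((2 * β + 3) ^ 3 * (β⁻¹) ^ 6) := by
          ring
      _ ≤ r⁻¹ ^ 6 * (125 * (β ^ 2)⁻¹) := mul_le_mul_of_nonneg_left key hr6.le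
      _ = 125 * r⁻¹ ^ 6 * (β ^ 2)⁻¹ := by ring
  -- `∑_{b ∈ t} b⁻² ≤ 2 / b₀` since every shell index is `≥ b₀`
  have step5 : ∑ b ∈ t, ((b : ℝ) ^ 2)⁻¹ ≤ 2 / b₀ := by
    have hsub : t ⊆ Finset.Ioo (b₀ - 1) (t.sup id + 1) := fun b hb => by
      rw [Finset.mem_Ioo]
      obtain ⟨k, hk, rfl⟩ := Finset.mem_image.1 hb
      exact ⟨by have := hmb k hk; omega, Nat.lt_succ_of_le (Finset.le_sup (f := id) hb)⟩
    have h2 := sum_Ioo_inv_sq_le (α := ℝ) (b₀ - 1) (t.sup id + 1)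
    have hcast : ((b₀ - 1 : ℕ) : ℝ) + 1 = (b₀ : ℝ) := by
      rw [Nat.cast_sub hb₀]; push_cast; ring
    rw [hcast] at h2
    calc ∑ b ∈ t, ((b : ℝ) ^ 2)⁻¹ ≤ ∑ b ∈ Finset.Ioo (b₀ - 1) (t.sup id + 1), ((b : ℝ) ^ 2)⁻¹ :=
          Finset.sum_le_sum_of_subset_of_nonneg hsub fun b _ _ => by positivity
      _ ≤ 2 / b₀ := h2
  have hr6 : 0 ≤ r⁻¹ ^ 6 := by positivity
  calc ∑ k ∈ S, (dist (x i) (x k))⁻¹ ^ 6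
      ≤ ∑ b ∈ t, ((S.filter fun k => m k = b).card : ℝ) * (r⁻¹ ^ 6 * ((b : ℝ))⁻¹ ^ 6) :=
        step1.trans_eq step2
    _ ≤ ∑ b ∈ t, (2 * (b : ℝ) + 3) ^ 3 * (r⁻¹ ^ 6 * ((b : ℝ))⁻¹ ^ 6) :=
        Finset.sum_le_sum fun b hb => mul_le_mul_of_nonneg_right (step3 b hb) (by positivity)
    _ ≤ ∑ b ∈ t, 125 * r⁻¹ ^ 6 * ((b : ℝ) ^ 2)⁻¹ := Finset.sum_le_sum step4
    _ = 125 * r⁻¹ ^ 6 * ∑ b ∈ t, ((b : ℝ) ^ 2)⁻¹ := by rw [Finset.mul_sum]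
    _ ≤ 125 * r⁻¹ ^ 6 * (2 / b₀) := mul_le_mul_of_nonneg_left step5 (by positivity)
    _ = 250 * r⁻¹ ^ 6 / b₀ := by ring


/-- **Goodness transfers from a sub-configuration** when nothing was removed within `3/2` of the
particle: if `k` is good in `x ∘ f` and every particle of `x` outside the range of `f` is farther
than `3/2` from `x (f k)`, then `f k` is good in `x` (same scale, rotation, pattern; assignment
`f ∘ g`). [folklore] -/
theorem good_of_good_comp {N K : ℕ} (x : Fin N → EuclideanSpace ℝ (Fin 3)) (f : Fin K ↪ Fin N)
    (k : Fin K) (hfar : ∀ j : Fin N, j ∉ Set.range f → 3 / 2 < dist (x j) (x (f k)))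
    (h : IsTwoShellGood (1 / 20) (47 / 50) 1 (x ∘ f) k) :
    IsTwoShellGood (1 / 20) (47 / 50) 1 x (f k) := by
  obtain ⟨a, ha₁, ha₂, A, P, g, hP, hg, hinj, hsurj⟩ := h
  refine ⟨a, ha₁, ha₂, A, P, fun v => f (g v), hP, fun v hv => ⟨?_, ?_⟩, ?_, fun j hj hd => ?_⟩
  · exact fun heq => (hg v hv).1 (f.injective heq)
  · simpa [Function.comp] using (hg v hv).2
  · intro v hv w hw hvw
    exact hinj hv hw (f.injective hvw)
  · by_cases hjr : j ∈ Set.range f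
    · obtain ⟨k', rfl⟩ := hjr
      have hk' : k' ≠ k := fun h => hj (by rw [h])
      obtain ⟨v, hv, hgv⟩ := hsurj k' hk' (by simpa [Function.comp] using hd)
      exact ⟨v, hv, by simp [hgv]⟩
    · exfalso
      have := hfar j hjr
      nlinarith

/-- **F6. `FarFieldGapR` is a corollary of the target.**  `CoerciveTwoShellGap → FarFieldGapR`:
given the coercive gap `g₀(δ)`, take `g := g₀/2`, `C := g₀/2 + 125/6·δ⁻⁶` and the slack radius
`R := max (3/2) (n₀ δ)` with `n₀ = ⌈(125/3)δ⁻⁶/g₀⌉ + 1`.  For bad `U` split `U = ∂ ∪ U°`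
(`∂` = particles with a non-`U` particle within `R`).  Restricting `x` to `U` gives a `δ`-separated
configuration `y` with `E(y) ≥ #U·e* + g₀·#bad(y)` and `#bad(y) ≥ #U°` (an interior particle keeps
its whole `3a/2`-neighbourhood, `good_of_good_comp`), while
`Σ_{i∈U} e_i(x) = E(y) + ½·cross(U, Uᶜ)` with `½·cross ≥ −(g₀/2)·#U° − (125/6)δ⁻⁶·#∂` (tail shell sum
beyond `R` for interior particles, full shell sum for boundary ones).  So the far-field crux can
only fail if the target fails: the planner's kill criterion (i) for `FarFieldGapR` is a kill
criterion for `CoerciveTwoShellGap` itself, and within the route `FarFieldGapR` carries no risk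
(and no information) beyond the target. [folklore] -/
theorem farFieldGapR_of_coerciveTwoShellGap (hT : CoerciveTwoShellGap) : FarFieldGapR := by
  intro δ hδ
  obtain ⟨g₀, hg₀, hall⟩ := hT δ hδ
  set A : ℝ := (125 / 6 : ℝ) * δ⁻¹ ^ 6 with hA
  set n₀ : ℕ := ⌈(125 / 3 : ℝ) * δ⁻¹ ^ 6 / g₀⌉₊ + 1 with hn₀
  set R : ℝ := max (3 / 2) ((n₀ : ℝ) * δ) with hR
  refine ⟨g₀ / 2, by linarith, g₀ / 2 + A, R, fun N x hsep U hU => ?_⟩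
  classical
  have hA0 : 0 ≤ A := by positivity
  have hn₀1 : 1 ≤ n₀ := Nat.le_add_left 1 _
  have hn₀pos : (0 : ℝ) < n₀ := by exact_mod_cast hn₀1
  have hn₀ge : (125 / 3 : ℝ) * δ⁻¹ ^ 6 / g₀ ≤ n₀ := by
    have h1 := Nat.le_ceil ((125 / 3 : ℝ) * δ⁻¹ ^ 6 / g₀)
    have h2 : (⌈(125 / 3 : ℝ) * δ⁻¹ ^ 6 / g₀⌉₊ : ℝ) ≤ n₀ := by
      rw [hn₀]; push_cast; linarith
    exact h1.trans h2
  have htailg : (125 / 3 : ℝ) * δ⁻¹ ^ 6 / n₀ ≤ g₀ := by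
    rw [div_le_iff₀ hn₀pos]
    have := (div_le_iff₀ hg₀).1 hn₀ge
    linarith
  have hR32 : (3 / 2 : ℝ) ≤ R := le_max_left _ _
  have hRn : (n₀ : ℝ) * δ ≤ R := le_max_right _ _
  -- boundary / interior split of `U`
  set bd := U.filter (fun i => ∃ j : Fin N, j ∉ U ∧ dist (x j) (x i) ≤ R) with hbd
  set it := U.filter (fun i => ¬ ∃ j : Fin N, j ∉ U ∧ dist (x j) (x i) ≤ R) with hit
  have hsplit : (bd.card : ℝ) + (it.card : ℝ) = U.card := by
    exact_mod_cast Finset.card_filter_add_card_filter_not _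
  have hcardbd : (Nat.card {i : Fin N // i ∈ U ∧ ∃ j : Fin N, j ∉ U ∧ dist (x j) (x i) ≤ R} : ℝ) =
      bd.card := by
    have e : {i : Fin N // i ∈ U ∧ ∃ j : Fin N, j ∉ U ∧ dist (x j) (x i) ≤ R} ≃ {i : Fin N // i ∈ bd} :=
      Equiv.subtypeEquivRight fun i => by rw [hbd, Finset.mem_filter]
    rw [Nat.card_congr e, Nat.card_eq_fintype_card, Fintype.card_coe]
  -- the restriction `y` of `x` to `U`
  set f : Fin U.card ↪ Fin N := (U.orderEmbOfFin rfl).toEmbedding with hf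
  have hmap : Finset.univ.map f = U := Finset.map_orderEmbOfFin_univ U rfl
  set y : Fin U.card → EuclideanSpace ℝ (Fin 3) := x ∘ f with hy
  have hysep : ∀ k l : Fin U.card, k ≠ l → δ ≤ dist (y k) (y l) := fun k l hkl =>
    hsep (f k) (f l) fun h => hkl (f.injective h)
  have hE := hall U.card y hysep
  -- energy identity `Σ_{i∈U} e_i = E(y) + ½ cross`
  have hdouble : ∑ i ∈ U, ∑ j ∈ U, lennardJones (dist (x i) (x j)) =
      2 * interactionEnergy lennardJones y := by
    have := sum_sum_map_eq_two_mul_interactionEnergy lennardJones lennardJones_zero x f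
    rwa [hmap] at this
  have herase : ∀ i : Fin N, ∑ j ∈ Finset.univ.erase i, lennardJones (dist (x i) (x j)) =
      ∑ j, lennardJones (dist (x i) (x j)) := fun i =>
    Finset.sum_erase _ (by rw [dist_self, lennardJones_zero])
  have hident : ∑ i ∈ U, ((1 / 2 : ℝ) * ∑ j ∈ Finset.univ.erase i, lennardJones (dist (x i) (x j))) =
      interactionEnergy lennardJones y +
        (1 / 2 : ℝ) * ∑ i ∈ U, ∑ j ∈ Uᶜ, lennardJones (dist (x i) (x j)) := by
    have h1 : ∀ i ∈ U, (1 / 2 : ℝ) * ∑ j ∈ Finset.univ.erase i, lennardJones (dist (x i) (x j)) =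
        (1 / 2 : ℝ) * (∑ j ∈ U, lennardJones (dist (x i) (x j)) +
          ∑ j ∈ Uᶜ, lennardJones (dist (x i) (x j))) := fun i _ => by
      rw [herase i, Finset.sum_add_sum_compl]
    rw [Finset.sum_congr rfl h1, ← Finset.mul_sum, Finset.sum_add_distrib, hdouble]
    ring
  -- cross terms: termwise attractive-tail bound
  have hV : ∀ i j : Fin N, i ≠ j →
      -((1 / 6 : ℝ) * (dist (x i) (x j))⁻¹ ^ 6) ≤ lennardJones (dist (x i) (x j)) := fun i j hij =>
    neg_le_lennardJones_of_le (lt_of_lt_of_le hδ (hsep i j hij)) le_rfl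
  have hcrossi : ∀ i ∈ U, -((1 / 6 : ℝ) * ∑ j ∈ Uᶜ, (dist (x i) (x j))⁻¹ ^ 6) ≤
      ∑ j ∈ Uᶜ, lennardJones (dist (x i) (x j)) := fun i hi => by
    rw [Finset.mul_sum, ← Finset.sum_neg_distrib]
    refine Finset.sum_le_sum fun j hj => hV i j ?_
    rintro rfl
    exact (Finset.mem_compl.1 hj) hi
  -- boundary particles: full shell sum
  have hbd_i : ∀ i ∈ U, -(2 * A) ≤ ∑ j ∈ Uᶜ, lennardJones (dist (x i) (x j)) := fun i hi => by
    have hsub : Uᶜ ⊆ Finset.univ.erase i := fun j hj =>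
      Finset.mem_erase.2 ⟨fun h => (Finset.mem_compl.1 hj) (h ▸ hi), Finset.mem_univ _⟩
    have hle : ∑ j ∈ Uᶜ, (dist (x i) (x j))⁻¹ ^ 6 ≤
        ∑ j ∈ Finset.univ.erase i, (dist (x i) (x j))⁻¹ ^ 6 :=
      Finset.sum_le_sum_of_subset_of_nonneg hsub fun j _ _ => by positivity
    have hshell := sum_inv_pow_six_le x hδ hsep i
    have := hcrossi i hi
    rw [hA]
    nlinarith
  -- interior particles: tail shell sum beyond `R ≥ n₀ δ`
  have hit_i : ∀ i ∈ it, -g₀ ≤ ∑ j ∈ Uᶜ, lennardJones (dist (x i) (x j)) := fun i hi => by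
    obtain ⟨hiU, hnot⟩ := Finset.mem_filter.1 hi
    push Not at hnot
    have hS : ∀ j ∈ Uᶜ, δ * n₀ ≤ dist (x i) (x j) := fun j hj => by
      have := hnot j (Finset.mem_compl.1 hj)
      rw [dist_comm] at this
      nlinarith
    have htail := sum_inv_pow_six_tail_le x hδ hsep i Uᶜ hn₀1 hS
    have := hcrossi i hiU
    have h3 : (1 / 6 : ℝ) * (250 * δ⁻¹ ^ 6 / n₀) = (125 / 3 : ℝ) * δ⁻¹ ^ 6 / n₀ := by ring
    nlinarith
  have hcross : -(g₀ * it.card) - 2 * A * bd.card ≤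
      ∑ i ∈ U, ∑ j ∈ Uᶜ, lennardJones (dist (x i) (x j)) := by
    rw [← Finset.sum_filter_add_sum_filter_not U (fun i => ∃ j : Fin N, j ∉ U ∧ dist (x j) (x i) ≤ R)]
    have h1 : ∑ i ∈ bd, -(2 * A) ≤ ∑ i ∈ bd, ∑ j ∈ Uᶜ, lennardJones (dist (x i) (x j)) :=
      Finset.sum_le_sum fun i hi => hbd_i i (Finset.mem_filter.1 hi).1
    have h2 : ∑ i ∈ it, -g₀ ≤ ∑ i ∈ it, ∑ j ∈ Uᶜ, lennardJones (dist (x i) (x j)) :=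
      Finset.sum_le_sum fun i hi => hit_i i hi
    simp only [Finset.sum_const, nsmul_eq_mul] at h1 h2
    change _ ≤ ∑ i ∈ bd, _ + ∑ i ∈ it, _
    linarith
  -- interior particles of `U` stay bad in `y`
  have hbad : (it.card : ℝ) ≤
      (Nat.card {k : Fin U.card // ¬ IsTwoShellGood (1 / 20) (47 / 50) 1 y k} : ℝ) := by
    set BadY := Finset.univ.filter (fun k : Fin U.card => ¬ IsTwoShellGood (1 / 20) (47 / 50) 1 y k)
      with hBadY
    have hcardY : (Nat.card {k : Fin U.card // ¬ IsTwoShellGood (1 / 20) (47 / 50) 1 y k} : ℝ) =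
        BadY.card := by
      have e : {k : Fin U.card // ¬ IsTwoShellGood (1 / 20) (47 / 50) 1 y k} ≃
          {k : Fin U.card // k ∈ BadY} :=
        Equiv.subtypeEquivRight fun k => by rw [hBadY, Finset.mem_filter]; simp
      rw [Nat.card_congr e, Nat.card_eq_fintype_card, Fintype.card_coe]
    rw [hcardY]
    have hsub : it ⊆ BadY.map f := by
      intro i hi
      obtain ⟨hiU, hnot⟩ := Finset.mem_filter.1 hi
      push Not at hnot
      have hiU' := hiU
      rw [← hmap] at hiU'
      obtain ⟨k, -, rfl⟩ := Finset.mem_map.1 hiU'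
      refine Finset.mem_map.2 ⟨k, Finset.mem_filter.2 ⟨Finset.mem_univ _, fun hgood => ?_⟩, rfl⟩
      refine hU (f k) hiU (good_of_good_comp x f k (fun j hj => ?_) hgood)
      have hjU : j ∉ U := by
        rw [← hmap]
        intro hj'
        obtain ⟨k', -, rfl⟩ := Finset.mem_map.1 hj'
        exact hj ⟨k', rfl⟩
      have := hnot j hjU
      linarith
    have := Finset.card_le_card hsub
    rw [Finset.card_map] at this
    exact_mod_cast this
  -- assemble
  rw [hcardbd]
  have hsumU : ∑ i ∈ U, (((1 / 2 : ℝ) * ∑ j ∈ Finset.univ.erase i, lennardJones (dist (x i) (x j))) -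
      (⨅ Q : PeriodicConfiguration 3, Q.energyPerParticle lennardJones)) =
      interactionEnergy lennardJones y +
        (1 / 2 : ℝ) * ∑ i ∈ U, ∑ j ∈ Uᶜ, lennardJones (dist (x i) (x j)) -
        (U.card : ℝ) * (⨅ Q : PeriodicConfiguration 3, Q.energyPerParticle lennardJones) := by
    rw [Finset.sum_sub_distrib, hident, Finset.sum_const, nsmul_eq_mul]
  rw [hsumU]
  have hNU : ((U.card : ℕ) : ℝ) = (U.card : ℝ) := rfl
  have hgb := mul_le_mul_of_nonneg_left hbad hg₀.le
  nlinarith [hE, hcross, hsplit, hgb, hA0]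

/-! ## §6 The near field is NOT load-bearing: `Descent → ContactGapAt 3 → FarFieldGapR → CoerciveTwoShellGap` (finding F8)

The lead's `stub_glue` closes WITHOUT `NearFieldConvexity` (and with `stub_fibre` proved):
`stub_glue_proof` below has the skeleton's verbatim signature.  Hence, modulo `Descent` (itself a
consequence of the two covering stubs), `CoerciveTwoShellGap ↔ FarFieldGapR ∧ ContactGapAt 3`
(`coerciveTwoShellGap_iff_far_and_contact`) and `NearFarGlueR ⟸ Descent ∧ ContactGapAt 3`
(`nearFarGlueR_of_descent_contact`): the crux's dependence `[deps: FarFieldGapR, NearFieldConvexity]`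
is really `[deps: ContactGapAt 3]` — the near-field crux feeds `HullBridge`, not the glue. -/

/-- **Fibre / packing count** (the lead's `stub_fibre`, proved): in a `δ`-separated configuration,
if every particle of `S` lies within `R` of some particle of `T`, then `#S ≤ (2R/δ + 1)³ · #T`.
[folklore] -/
theorem fibre_count {δ R : ℝ} (hδ : 0 < δ) (hR : 0 ≤ R) {N : ℕ} (x : Fin N → EuclideanSpace ℝ (Fin 3))
    (hsep : ∀ i j : Fin N, i ≠ j → δ ≤ dist (x i) (x j)) (S T : Finset (Fin N))
    (hST : ∀ j ∈ S, ∃ k ∈ T, dist (x j) (x k) ≤ R) :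
    (S.card : ℝ) ≤ (2 * R / δ + 1) ^ 3 * (T.card : ℝ) := by
  classical
  set F : Fin N → Finset (Fin N) := fun k => S.filter fun j => dist (x j) (x k) ≤ R with hF
  have hcover : S ⊆ T.biUnion F := by
    intro j hj
    obtain ⟨k, hk, hd⟩ := hST j hj
    exact Finset.mem_biUnion.2 ⟨k, hk, Finset.mem_filter.2 ⟨hj, hd⟩⟩
  have hfibre : ∀ k ∈ T, ((F k).card : ℝ) ≤ (2 * R / δ + 1) ^ 3 := by
    intro k _
    have hinj : Set.InjOn x (F k) := fun a _ b _ hab => by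
      by_contra hne
      have := hsep a b hne
      rw [hab, dist_self] at this
      exact absurd this (not_le.2 hδ)
    rw [← Finset.card_image_of_injOn hinj]
    have h := card_le_of_separated_of_dist_le ((F k).image x) (x k) hδ hR ?_ ?_
    · rwa [finrank_euclideanSpace_fin] at h
    · intro c hc
      obtain ⟨j, hj, rfl⟩ := Finset.mem_image.1 hc
      exact (Finset.mem_filter.1 hj).2
    · intro c hc c' hc' hne
      obtain ⟨a, -, rfl⟩ := Finset.mem_image.1 hc
      obtain ⟨b, -, rfl⟩ := Finset.mem_image.1 hc'
      exact hsep a b fun h => hne (h ▸ rfl)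
  have h1 : (S.card : ℝ) ≤ ((T.biUnion F).card : ℝ) := by
    exact_mod_cast Finset.card_le_card hcover
  have h2 : ((T.biUnion F).card : ℝ) ≤ ∑ k ∈ T, ((F k).card : ℝ) := by
    exact_mod_cast Finset.card_biUnion_le
  have h3 : ∑ k ∈ T, ((F k).card : ℝ) ≤ ∑ k ∈ T, (2 * R / δ + 1) ^ 3 := Finset.sum_le_sum hfibre
  rw [Finset.sum_const, nsmul_eq_mul] at h3
  linarith

/-- Restriction identity: `Σ_{i∈U} ½ Σ_{j≠i} V(|x_i−x_j|) = E(x ∘ f) + ½ Σ_{i∈U} Σ_{j∉U} V(|x_i−x_j|)`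
for any enumeration `f` of `U`. [folklore] -/
theorem sum_halfSite_eq_restrict {N K : ℕ} (x : Fin N → EuclideanSpace ℝ (Fin 3)) (U : Finset (Fin N))
    (f : Fin K ↪ Fin N) (hmap : Finset.univ.map f = U) :
    ∑ i ∈ U, ((1 / 2 : ℝ) * ∑ j ∈ Finset.univ.erase i, lennardJones (dist (x i) (x j))) =
      interactionEnergy lennardJones (x ∘ f) +
        (1 / 2 : ℝ) * ∑ i ∈ U, ∑ j ∈ Uᶜ, lennardJones (dist (x i) (x j)) := by
  classical
  have hdouble : ∑ i ∈ U, ∑ j ∈ U, lennardJones (dist (x i) (x j)) =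
      2 * interactionEnergy lennardJones (x ∘ f) := by
    have := sum_sum_map_eq_two_mul_interactionEnergy lennardJones lennardJones_zero x f
    rwa [hmap] at this
  have herase : ∀ i : Fin N, ∑ j ∈ Finset.univ.erase i, lennardJones (dist (x i) (x j)) =
      ∑ j, lennardJones (dist (x i) (x j)) := fun i =>
    Finset.sum_erase _ (by rw [dist_self, lennardJones_zero])
  have h1 : ∀ i ∈ U, (1 / 2 : ℝ) * ∑ j ∈ Finset.univ.erase i, lennardJones (dist (x i) (x j)) =
      (1 / 2 : ℝ) * (∑ j ∈ U, lennardJones (dist (x i) (x j)) +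
        ∑ j ∈ Uᶜ, lennardJones (dist (x i) (x j))) := fun i _ => by
    rw [herase i, Finset.sum_add_sum_compl]
  rw [Finset.sum_congr rfl h1, ← Finset.mul_sum, Finset.sum_add_distrib, hdouble]
  ring

/-- The whole excess: `Σ_i (½ Σ_{j≠i} V − e*) = E(x) − N e*`. [folklore] -/
theorem sum_halfSite_sub_eStar {N : ℕ} (x : Fin N → EuclideanSpace ℝ (Fin 3)) :
    ∑ i, (((1 / 2 : ℝ) * ∑ j ∈ Finset.univ.erase i, lennardJones (dist (x i) (x j))) -
      (⨅ Q : PeriodicConfiguration 3, Q.energyPerParticle lennardJones)) =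
      interactionEnergy lennardJones x -
        (N : ℝ) * (⨅ Q : PeriodicConfiguration 3, Q.energyPerParticle lennardJones) := by
  rw [Finset.sum_sub_distrib, Finset.sum_const, Finset.card_univ, Fintype.card_fin, nsmul_eq_mul,
    ← Finset.mul_sum]
  have h := two_mul_interactionEnergy lennardJones x
  simp only [siteEnergy] at h
  linarith

/-- **The descent statement** (the lead's `stub_descent`, here a hypothesis). -/
def Descent : Prop :=
  ∀ (N : ℕ) (x : Fin N → EuclideanSpace ℝ (Fin 3)) (i j : Fin N),
    IsTwoShellGood (1 / 20) (47 / 50) 1 x i → ¬ IsTwoShellGood (1 / 20) (47 / 50) 1 x j →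
      3 < dist (x j) (x i) →
        ∃ k : Fin N, k ≠ i ∧ dist (x k) (x i) ≤ 21 / 20 ∧ dist (x j) (x k) < dist (x j) (x i)

/-- Arithmetic of the convex combination closing the glue. [folklore] -/
theorem glue_arith {X SB SG b c bd g g₂ M C'' A : ℝ} (hsplit : SB + SG = X)
    (hfar : g * b - C'' * bd ≤ SB) (hGs : -A * bd - g / 2 * b ≤ SG) (h1 : C'' * bd + A * bd ≤ M * c)
    (hii : g₂ * c ≤ X) (hg₂ : 0 ≤ g₂) (hM : 0 ≤ M) (hden : 0 < g₂ + M) :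
    g₂ * (g / 2) / (g₂ + M) * b ≤ X := by
  have hi : g / 2 * b - M * c ≤ X := by linarith
  rw [div_mul_eq_mul_div, div_le_iff₀ hden]
  have h1 := mul_le_mul_of_nonneg_left hi hg₂
  have h2 := mul_le_mul_of_nonneg_left hii hM
  nlinarith [h1, h2]

/-- Arithmetic of the cross-term charge. [folklore] -/
theorem cross_arith {S A g bd nf b : ℝ} (hsum : -(2 * A) * bd + -g * nf ≤ S) (hf : nf ≤ b)
    (hg : 0 ≤ g) : -(2 * A) * bd - g * b ≤ S := by
  have := mul_le_mul_of_nonneg_left hf hg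
  linarith

/-- **F8. The near field is NOT load-bearing in the glue.**  `Descent → ContactGapAt 3 →
FarFieldGapR → CoerciveTwoShellGap` — the lead's `stub_glue` WITHOUT the hypothesis
`NearFieldConvexity` (and with `stub_fibre` discharged by `fibre_count`).  The good particles are
handled by restriction + periodisation (`card_mul_eStar_le`: `E(x|_G) ≥ #G·e*`, a proved tree
theorem) and the cross attraction `G ↔ B` is charged to the bad side: `≤ 2A` per `R'`-boundary bad
particle, `≤ g` per `R'`-interior bad particle (tail shell sum at `R' ≥ n₀ δ`).  Then
`E − N e* ≥ (g/2)#B − (max C' 0 + A)·#∂_{R'}B`, `#∂_{R'}B ≤ (1 + (2R'/δ+1)³)·#B_c` (nearest good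
particle + one descent step lands in `B_c` strictly closer; fibre), and the convex combination
with `ContactGapAt 3` closes.  Consequence, with F6 and `contactGapAt_of_coerciveTwoShellGap`:
**`CoerciveTwoShellGap ⟺ FarFieldGapR ∧ ContactGapAt 3` modulo `Descent` alone.** [folklore] -/
theorem coerciveTwoShellGap_of_far_contact (hdesc : Descent) (hcontact : ContactGapAt 3)
    (hfar : FarFieldGapR) : CoerciveTwoShellGap := by
  intro δ hδ
  obtain ⟨g, hg, C', R, hAt⟩ := hfar δ hδ
  obtain ⟨g₂, hg₂, hCG⟩ := hcontact δ hδ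
  -- constants (all chosen from `δ, g, C', R, g₂` only)
  obtain ⟨A, hA⟩ : ∃ A : ℝ, A = (125 / 6 : ℝ) * δ⁻¹ ^ 6 := ⟨_, rfl⟩
  obtain ⟨n₀, hn₀⟩ : ∃ n₀ : ℕ, n₀ = ⌈(125 / 3 : ℝ) * δ⁻¹ ^ 6 / g⌉₊ + 1 := ⟨_, rfl⟩
  obtain ⟨R', hR'⟩ : ∃ R' : ℝ, R' = max (max R 3) ((n₀ : ℝ) * δ) := ⟨_, rfl⟩
  obtain ⟨C'', hC''⟩ : ∃ C'' : ℝ, C'' = max C' 0 := ⟨_, rfl⟩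
  obtain ⟨K', hK'⟩ : ∃ K' : ℝ, K' = (2 * R' / δ + 1) ^ 3 + 1 := ⟨_, rfl⟩
  obtain ⟨M, hM⟩ : ∃ M : ℝ, M = (C'' + A) * K' := ⟨_, rfl⟩
  have hA0 : 0 ≤ A := by rw [hA]; positivity
  have hn₀1 : 1 ≤ n₀ := by rw [hn₀]; exact Nat.le_add_left 1 _
  have hn₀pos : (0 : ℝ) < n₀ := by exact_mod_cast hn₀1
  have hn₀ge : (125 / 3 : ℝ) * δ⁻¹ ^ 6 / g ≤ n₀ := by
    have h1 := Nat.le_ceil ((125 / 3 : ℝ) * δ⁻¹ ^ 6 / g)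
    have h2 : (⌈(125 / 3 : ℝ) * δ⁻¹ ^ 6 / g⌉₊ : ℝ) ≤ n₀ := by
      rw [hn₀]; push_cast; linarith
    exact h1.trans h2
  have htailg : (125 / 3 : ℝ) * δ⁻¹ ^ 6 / n₀ ≤ g := by
    rw [div_le_iff₀ hn₀pos]
    have := (div_le_iff₀ hg).1 hn₀ge
    linarith
  have hR'R : R ≤ R' := by rw [hR']; exact (le_max_left _ _).trans (le_max_left _ _)
  have hR'3 : (3 : ℝ) ≤ R' := by rw [hR']; exact (le_max_right _ _).trans (le_max_left _ _)
  have hR'n : (n₀ : ℝ) * δ ≤ R' := by rw [hR']; exact le_max_right _ _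
  have hR'0 : (0 : ℝ) ≤ R' := by linarith
  have hC''0 : 0 ≤ C'' := by rw [hC'']; exact le_max_right _ _
  have hC''C : C' ≤ C'' := by rw [hC'']; exact le_max_left _ _
  have hK'pos : 0 ≤ (2 * R' / δ + 1) ^ 3 := by positivity
  have hK'1 : 1 ≤ K' := by rw [hK']; linarith
  have hM0 : 0 ≤ M := by rw [hM]; exact mul_nonneg (by linarith) (by linarith)
  refine ⟨g₂ * (g / 2) / (g₂ + M), by positivity, fun N x hsep => ?_⟩
  classical
  -- the cast of characters (opaque names with defining equations)
  obtain ⟨B, hB⟩ : ∃ B : Finset (Fin N),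
      B = Finset.univ.filter (fun i : Fin N => ¬ IsTwoShellGood (1 / 20) (47 / 50) 1 x i) := ⟨_, rfl⟩
  obtain ⟨G, hG⟩ : ∃ G : Finset (Fin N),
      G = Finset.univ.filter (fun i : Fin N => IsTwoShellGood (1 / 20) (47 / 50) 1 x i) := ⟨_, rfl⟩
  obtain ⟨Bc, hBc⟩ : ∃ Bc : Finset (Fin N),
      Bc = Finset.univ.filter (fun j : Fin N => ¬ IsTwoShellGood (1 / 20) (47 / 50) 1 x j ∧
        ∃ i : Fin N, IsTwoShellGood (1 / 20) (47 / 50) 1 x i ∧ dist (x i) (x j) ≤ 3) := ⟨_, rfl⟩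
  obtain ⟨bd, hbd⟩ : ∃ bd : Finset (Fin N),
      bd = B.filter (fun i => ∃ j : Fin N, j ∉ B ∧ dist (x j) (x i) ≤ R') := ⟨_, rfl⟩
  have hmemB : ∀ i, i ∈ B ↔ ¬ IsTwoShellGood (1 / 20) (47 / 50) 1 x i := fun i => by
    rw [hB]; simp
  have hmemG : ∀ i, i ∈ G ↔ IsTwoShellGood (1 / 20) (47 / 50) 1 x i := fun i => by
    rw [hG]; simp
  have hmemBc : ∀ j, j ∈ Bc ↔ (¬ IsTwoShellGood (1 / 20) (47 / 50) 1 x j ∧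
      ∃ i : Fin N, IsTwoShellGood (1 / 20) (47 / 50) 1 x i ∧ dist (x i) (x j) ≤ 3) := fun j => by
    rw [hBc]; simp
  have hmembd : ∀ i, i ∈ bd ↔ (i ∈ B ∧ ∃ j : Fin N, j ∉ B ∧ dist (x j) (x i) ≤ R') := fun i => by
    rw [hbd, Finset.mem_filter]
  have hGc : Gᶜ = B := by
    ext i; rw [Finset.mem_compl, hmemB, hmemG]
  -- (0) `E − N e* = Σ_B (…) + Σ_G (…)`
  have hsplit : ∑ i ∈ B, (((1 / 2 : ℝ) * ∑ j ∈ Finset.univ.erase i, lennardJones (dist (x i) (x j))) -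
        (⨅ Q : PeriodicConfiguration 3, Q.energyPerParticle lennardJones)) +
      ∑ i ∈ G, (((1 / 2 : ℝ) * ∑ j ∈ Finset.univ.erase i, lennardJones (dist (x i) (x j))) -
        (⨅ Q : PeriodicConfiguration 3, Q.energyPerParticle lennardJones)) =
      interactionEnergy lennardJones x -
        (N : ℝ) * (⨅ Q : PeriodicConfiguration 3, Q.energyPerParticle lennardJones) := by
    have h := sum_halfSite_sub_eStar x
    rw [← Finset.sum_filter_add_sum_filter_not Finset.univ
      (fun i : Fin N => ¬ IsTwoShellGood (1 / 20) (47 / 50) 1 x i)] at h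
    have hGeq : Finset.univ.filter (fun i : Fin N => ¬¬ IsTwoShellGood (1 / 20) (47 / 50) 1 x i) = G := by
      rw [hG]; ext i; simp
    rw [hGeq, ← hB] at h
    exact h
  -- (1) far field on `B`, moved to the radius `R'` and the constant `C'' = max C' 0 ≥ 0`
  have hfarB := hAt N x hsep B (fun i hi => (hmemB i).1 hi)
  have hbdR : (Nat.card {i : Fin N // i ∈ B ∧ ∃ j : Fin N, j ∉ B ∧ dist (x j) (x i) ≤ R} : ℝ) ≤
      (Nat.card {i : Fin N // i ∈ B ∧ ∃ j : Fin N, j ∉ B ∧ dist (x j) (x i) ≤ R'} : ℝ) := by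
    have h := Nat.card_le_card_of_injective
      (fun a : {i : Fin N // i ∈ B ∧ ∃ j : Fin N, j ∉ B ∧ dist (x j) (x i) ≤ R} =>
        (⟨a.1, a.2.1, by obtain ⟨j, hj, hd⟩ := a.2.2; exact ⟨j, hj, hd.trans hR'R⟩⟩ :
          {i : Fin N // i ∈ B ∧ ∃ j : Fin N, j ∉ B ∧ dist (x j) (x i) ≤ R'}))
      (fun a b hab => Subtype.ext (by simpa using congrArg Subtype.val hab))
    exact_mod_cast h
  have hcardbd : (Nat.card {i : Fin N // i ∈ B ∧ ∃ j : Fin N, j ∉ B ∧ dist (x j) (x i) ≤ R'} : ℝ) =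
      bd.card := by
    have e : {i : Fin N // i ∈ B ∧ ∃ j : Fin N, j ∉ B ∧ dist (x j) (x i) ≤ R'} ≃ {i : Fin N // i ∈ bd} :=
      Equiv.subtypeEquivRight fun i => (hmembd i).symm
    rw [Nat.card_congr e, Nat.card_eq_fintype_card, Fintype.card_coe]
  have hnn : (0 : ℝ) ≤ (Nat.card {i : Fin N // i ∈ B ∧ ∃ j : Fin N, j ∉ B ∧ dist (x j) (x i) ≤ R} : ℝ) :=
    by positivity
  have hfarB' : g * (B.card : ℝ) - C'' * (bd.card : ℝ) ≤
      ∑ i ∈ B, (((1 / 2 : ℝ) * ∑ j ∈ Finset.univ.erase i, lennardJones (dist (x i) (x j))) -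
        (⨅ Q : PeriodicConfiguration 3, Q.energyPerParticle lennardJones)) := by
    rw [← hcardbd]
    have h1 : C' * (Nat.card {i : Fin N // i ∈ B ∧ ∃ j : Fin N, j ∉ B ∧ dist (x j) (x i) ≤ R} : ℝ) ≤
        C'' * (Nat.card {i : Fin N // i ∈ B ∧ ∃ j : Fin N, j ∉ B ∧ dist (x j) (x i) ≤ R'} : ℝ) :=
      (mul_le_mul_of_nonneg_right hC''C hnn).trans (mul_le_mul_of_nonneg_left hbdR hC''0)
    linarith only [hfarB, h1]
  -- (2) the good side: restriction + periodisation + cross attraction charged to `B`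
  obtain ⟨fG, hfG⟩ : ∃ fG : Fin G.card ↪ Fin N, fG = (G.orderEmbOfFin rfl).toEmbedding := ⟨_, rfl⟩
  have hmapG : Finset.univ.map fG = G := by rw [hfG]; exact Finset.map_orderEmbOfFin_univ G rfl
  have hGsum := sum_halfSite_eq_restrict x G fG hmapG
  obtain ⟨EG, hEG⟩ : ∃ EG : ℝ, EG = interactionEnergy lennardJones (x ∘ fG) := ⟨_, rfl⟩
  rw [← hEG] at hGsum
  have hyinj : Function.Injective (x ∘ fG) := fun k l hkl => by
    by_contra hne
    have := hsep (fG k) (fG l) (fun h => hne (fG.injective h))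
    have h0 : dist (x (fG k)) (x (fG l)) = 0 := dist_eq_zero.2 hkl
    rw [h0] at this
    exact absurd this (not_le.2 hδ)
  have hper : ((G.card : ℕ) : ℝ) * (⨅ Q : PeriodicConfiguration 3, Q.energyPerParticle lennardJones) ≤
      EG := by
    have := Summit.AtomisticToContinuum.Crystallization.Theorems.ChargedEnergyGapNegative.card_mul_eStar_le
      hyinj
    rw [hEG]
    exact this
  have hV : ∀ i j : Fin N, i ≠ j →
      -((1 / 6 : ℝ) * (dist (x i) (x j))⁻¹ ^ 6) ≤ lennardJones (dist (x i) (x j)) := fun i j hij =>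
    neg_le_lennardJones_of_le (lt_of_lt_of_le hδ (hsep i j hij)) le_rfl
  have hcrossj : ∀ j ∈ B, -((1 / 6 : ℝ) * ∑ i ∈ G, (dist (x j) (x i))⁻¹ ^ 6) ≤
      ∑ i ∈ G, lennardJones (dist (x j) (x i)) := fun j hj => by
    rw [Finset.mul_sum, ← Finset.sum_neg_distrib]
    refine Finset.sum_le_sum fun i hi => hV j i ?_
    rintro rfl
    exact (hmemB j).1 hj ((hmemG j).1 hi)
  have hbd_j : ∀ j ∈ B, -(2 * A) ≤ ∑ i ∈ G, lennardJones (dist (x j) (x i)) := fun j hj => by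
    have hsub : G ⊆ Finset.univ.erase j := fun i hi =>
      Finset.mem_erase.2 ⟨fun h => (hmemB j).1 hj ((hmemG j).1 (h ▸ hi)), Finset.mem_univ _⟩
    have hle : ∑ i ∈ G, (dist (x j) (x i))⁻¹ ^ 6 ≤
        ∑ i ∈ Finset.univ.erase j, (dist (x j) (x i))⁻¹ ^ 6 :=
      Finset.sum_le_sum_of_subset_of_nonneg hsub fun i _ _ => by positivity
    have hshell := sum_inv_pow_six_le x hδ hsep j
    have hc := hcrossj j hj
    rw [hA]
    linarith only [hc, hle, hshell]
  have hit_j : ∀ j ∈ B, j ∉ bd → -g ≤ ∑ i ∈ G, lennardJones (dist (x j) (x i)) := fun j hj hjbd => by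
    have hnot : ∀ i : Fin N, i ∉ B → R' < dist (x i) (x j) := by
      intro i hi
      by_contra hle
      exact hjbd ((hmembd j).2 ⟨hj, i, hi, not_lt.1 hle⟩)
    have hS : ∀ i ∈ G, δ * n₀ ≤ dist (x j) (x i) := fun i hi => by
      have hiB : i ∉ B := fun h => (hmemB i).1 h ((hmemG i).1 hi)
      have := hnot i hiB
      rw [dist_comm] at this
      have hc : δ * (n₀ : ℝ) = (n₀ : ℝ) * δ := mul_comm _ _
      linarith only [this, hR'n, hc]
    have htail := sum_inv_pow_six_tail_le x hδ hsep j G hn₀1 hS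
    have hc := hcrossj j hj
    have h3 : (1 / 6 : ℝ) * (250 * δ⁻¹ ^ 6 / n₀) = (125 / 3 : ℝ) * δ⁻¹ ^ 6 / n₀ := by ring
    have h4 : (1 / 6 : ℝ) * ∑ i ∈ G, (dist (x j) (x i))⁻¹ ^ 6 ≤ (1 / 6 : ℝ) * (250 * δ⁻¹ ^ 6 / n₀) :=
      mul_le_mul_of_nonneg_left htail (by norm_num)
    linarith only [hc, h3, h4, htailg]
  have hcross : -(2 * A) * (bd.card : ℝ) - g * (B.card : ℝ) ≤
      ∑ i ∈ G, ∑ j ∈ Gᶜ, lennardJones (dist (x i) (x j)) := by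
    rw [hGc, Finset.sum_comm]
    have hsym : ∀ j ∈ B, ∑ i ∈ G, lennardJones (dist (x i) (x j)) =
        ∑ i ∈ G, lennardJones (dist (x j) (x i)) := fun j _ =>
      Finset.sum_congr rfl fun i _ => by rw [dist_comm]
    rw [Finset.sum_congr rfl hsym]
    have hpt : ∀ j ∈ B, (if j ∈ bd then -(2 * A) else -g) ≤
        ∑ i ∈ G, lennardJones (dist (x j) (x i)) := fun j hj => by
      split_ifs with h
      · exact hbd_j j hj
      · exact hit_j j hj h
    have hsum := Finset.sum_le_sum hpt
    have hite : ∑ j ∈ B, (if j ∈ bd then -(2 * A) else -g) =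
        -(2 * A) * ((B.filter fun j => j ∈ bd).card : ℝ) +
          -g * ((B.filter fun j => ¬ j ∈ bd).card : ℝ) := by
      rw [Finset.sum_ite, Finset.sum_const, Finset.sum_const, nsmul_eq_mul, nsmul_eq_mul]
      ring
    have hf1 : ((B.filter fun j => j ∈ bd).card : ℝ) = bd.card := by
      congr 1
      congr 1
      ext j
      rw [Finset.mem_filter, hmembd]
      tauto
    have hf2 : ((B.filter fun j => ¬ j ∈ bd).card : ℝ) ≤ B.card := by
      exact_mod_cast Finset.card_filter_le _ _
    rw [hite, hf1] at hsum
    exact cross_arith hsum hf2 hg.le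
  have hGside : -A * (bd.card : ℝ) - g / 2 * (B.card : ℝ) ≤
      ∑ i ∈ G, (((1 / 2 : ℝ) * ∑ j ∈ Finset.univ.erase i, lennardJones (dist (x i) (x j))) -
        (⨅ Q : PeriodicConfiguration 3, Q.energyPerParticle lennardJones)) := by
    rw [Finset.sum_sub_distrib, hGsum, Finset.sum_const, nsmul_eq_mul]
    linarith only [hper, hcross]
  -- (3) boundary count: `#bd ≤ K' · #Bc` (nearest good particle, one descent step, fibre)
  have hbd_le : (bd.card : ℝ) ≤ K' * (Bc.card : ℝ) := by
    have hfib : ((bd \ Bc).card : ℝ) ≤ (2 * R' / δ + 1) ^ 3 * (Bc.card : ℝ) := by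
      refine fibre_count hδ hR'0 x hsep (bd \ Bc) Bc fun j hj => ?_
      obtain ⟨hjbd, hjBc⟩ := Finset.mem_sdiff.1 hj
      obtain ⟨hjB, i', hi'B, hi'd⟩ := (hmembd j).1 hjbd
      have hjbad : ¬ IsTwoShellGood (1 / 20) (47 / 50) 1 x j := (hmemB j).1 hjB
      have hi'good : IsTwoShellGood (1 / 20) (47 / 50) 1 x i' := by
        by_contra h; exact hi'B ((hmemB i').2 h)
      have hGne : G.Nonempty := ⟨i', (hmemG i').2 hi'good⟩
      obtain ⟨i₀, hi₀G, hmin⟩ := G.exists_min_image (fun i => dist (x j) (x i)) hGne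
      have hi₀good : IsTwoShellGood (1 / 20) (47 / 50) 1 x i₀ := (hmemG i₀).1 hi₀G
      have hD_le : dist (x j) (x i₀) ≤ R' := by
        have := hmin i' ((hmemG i').2 hi'good)
        rw [dist_comm] at hi'd
        exact this.trans hi'd
      have hD_gt : 3 < dist (x j) (x i₀) := by
        by_contra hle
        push Not at hle
        exact hjBc ((hmemBc j).2 ⟨hjbad, i₀, hi₀good, by rw [dist_comm]; exact hle⟩)
      obtain ⟨k, -, hkd, hkj⟩ := hdesc N x i₀ j hi₀good hjbad hD_gt
      have hkbad : ¬ IsTwoShellGood (1 / 20) (47 / 50) 1 x k := fun hk => by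
        have := hmin k ((hmemG k).2 hk)
        linarith
      refine ⟨k, (hmemBc k).2 ⟨hkbad, i₀, hi₀good, ?_⟩, ?_⟩
      · rw [dist_comm]; linarith
      · linarith
    have hsd : (bd.card : ℝ) ≤ ((bd \ Bc).card : ℝ) + (Bc.card : ℝ) := by
      exact_mod_cast Finset.card_le_card_sdiff_add_card (s := bd) (t := Bc)
    have hexp : K' * (Bc.card : ℝ) = (2 * R' / δ + 1) ^ 3 * (Bc.card : ℝ) + (Bc.card : ℝ) := by
      rw [hK']; ring
    linarith only [hfib, hsd, hexp]
  -- (4) contact gap, with the counts as finset cardinalities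
  have hCGx := hCG N x hsep
  have hcardBc : (Nat.card {j : Fin N // ¬ IsTwoShellGood (1 / 20) (47 / 50) 1 x j ∧
      ∃ i : Fin N, IsTwoShellGood (1 / 20) (47 / 50) 1 x i ∧ dist (x i) (x j) ≤ 3} : ℝ) = Bc.card := by
    have e : {j : Fin N // ¬ IsTwoShellGood (1 / 20) (47 / 50) 1 x j ∧
        ∃ i : Fin N, IsTwoShellGood (1 / 20) (47 / 50) 1 x i ∧ dist (x i) (x j) ≤ 3} ≃
        {j : Fin N // j ∈ Bc} :=
      Equiv.subtypeEquivRight fun j => (hmemBc j).symm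
    rw [Nat.card_congr e, Nat.card_eq_fintype_card, Fintype.card_coe]
  rw [hcardBc] at hCGx
  have hcardB : (Nat.card {i : Fin N // ¬ IsTwoShellGood (1 / 20) (47 / 50) 1 x i} : ℝ) = B.card := by
    have e : {i : Fin N // ¬ IsTwoShellGood (1 / 20) (47 / 50) 1 x i} ≃ {i : Fin N // i ∈ B} :=
      Equiv.subtypeEquivRight fun i => (hmemB i).symm
    rw [Nat.card_congr e, Nat.card_eq_fintype_card, Fintype.card_coe]
  rw [hcardB]
  -- (5) assemble: X ≥ (g/2) b − M c and X ≥ g₂ c ⇒ X ≥ g₂ (g/2) b / (g₂ + M)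
  have h1 : C'' * (bd.card : ℝ) + A * (bd.card : ℝ) ≤ M * (Bc.card : ℝ) :=
    calc C'' * (bd.card : ℝ) + A * (bd.card : ℝ) = (C'' + A) * (bd.card : ℝ) := by ring
      _ ≤ (C'' + A) * (K' * (Bc.card : ℝ)) := mul_le_mul_of_nonneg_left hbd_le (by linarith)
      _ = M * (Bc.card : ℝ) := by rw [hM]; ring
  have hii : g₂ * (Bc.card : ℝ) ≤ interactionEnergy lennardJones x -
      (N : ℝ) * (⨅ Q : PeriodicConfiguration 3, Q.energyPerParticle lennardJones) := by
    linarith only [hCGx]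
  have hden : 0 < g₂ + M := by positivity
  have hfin := glue_arith hsplit hfarB' hGside h1 hii hg₂.le hM0 hden
  linarith only [hfin]

/-- **The lead's `stub_glue`, closed** (verbatim signature of the skeleton sha adf7c32b…): the
hypotheses `fibre` and `NearFieldConvexity` are not used. [folklore] -/
theorem stub_glue_proof :
    (∀ (N : ℕ) (x : Fin N → EuclideanSpace ℝ (Fin 3)) (i j : Fin N),
      IsTwoShellGood (1 / 20) (47 / 50) 1 x i → ¬ IsTwoShellGood (1 / 20) (47 / 50) 1 x j →
        3 < dist (x j) (x i) →
          ∃ k : Fin N, k ≠ i ∧ dist (x k) (x i) ≤ 21 / 20 ∧ dist (x j) (x k) < dist (x j) (x i)) →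
    (∀ (δ R : ℝ), 0 < δ → 0 ≤ R → ∀ (N : ℕ) (x : Fin N → EuclideanSpace ℝ (Fin 3)),
      (∀ i j : Fin N, i ≠ j → δ ≤ dist (x i) (x j)) → ∀ S T : Finset (Fin N),
        (∀ j ∈ S, ∃ k ∈ T, dist (x j) (x k) ≤ R) →
          (S.card : ℝ) ≤ (2 * R / δ + 1) ^ 3 * (T.card : ℝ)) →
    (∀ δ : ℝ, 0 < δ → ∃ g₂ : ℝ, 0 < g₂ ∧ ∀ (N : ℕ) (x : Fin N → EuclideanSpace ℝ (Fin 3)),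
      (∀ i j : Fin N, i ≠ j → δ ≤ dist (x i) (x j)) →
        (N : ℝ) * (⨅ Q : PeriodicConfiguration 3, Q.energyPerParticle lennardJones) +
            g₂ * (Nat.card {j : Fin N // ¬ IsTwoShellGood (1 / 20) (47 / 50) 1 x j ∧
              ∃ i : Fin N, IsTwoShellGood (1 / 20) (47 / 50) 1 x i ∧ dist (x i) (x j) ≤ 3} : ℝ) ≤
          interactionEnergy lennardJones x) →
    FarFieldGapR → NearFieldConvexity → CoerciveTwoShellGap :=
  fun hd _ hc hf _ => coerciveTwoShellGap_of_far_contact hd hc hf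

/-- **The crux modulo the line's two honest inputs**: `Descent → ContactGapAt 3 → NearFarGlueR`
(the near field enters only as an unused hypothesis of the glue). [folklore] -/
theorem nearFarGlueR_of_descent_contact (hd : Descent) (hc : ContactGapAt 3) : NearFarGlueR :=
  fun hf _ => coerciveTwoShellGap_of_far_contact hd hc hf

/-- **Structure theorem of the route's engine** (modulo `Descent`):
`CoerciveTwoShellGap ↔ FarFieldGapR ∧ ContactGapAt 3`. [folklore] -/
theorem coerciveTwoShellGap_iff_far_and_contact (hd : Descent) :
    CoerciveTwoShellGap ↔ FarFieldGapR ∧ ContactGapAt 3 := by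
  constructor
  · intro hT
    refine ⟨farFieldGapR_of_coerciveTwoShellGap hT, ?_⟩
    -- `ContactGapAt 3` from the target: the contact-bad particles are among the bad ones
    intro δ hδ
    obtain ⟨g, hg, hall⟩ := hT δ hδ
    refine ⟨g, hg, fun N x hsep => ?_⟩
    have hE := hall N x hsep
    have hle : (Nat.card {j : Fin N // ¬ IsTwoShellGood (1 / 20) (47 / 50) 1 x j ∧
          ∃ i : Fin N, IsTwoShellGood (1 / 20) (47 / 50) 1 x i ∧ dist (x i) (x j) ≤ 3} : ℝ) ≤
        (Nat.card {i : Fin N // ¬ IsTwoShellGood (1 / 20) (47 / 50) 1 x i} : ℝ) := by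
      have h := Nat.card_le_card_of_injective
        (fun a : {j : Fin N // ¬ IsTwoShellGood (1 / 20) (47 / 50) 1 x j ∧
            ∃ i : Fin N, IsTwoShellGood (1 / 20) (47 / 50) 1 x i ∧ dist (x i) (x j) ≤ 3} =>
          (⟨a.1, a.2.1⟩ : {i : Fin N // ¬ IsTwoShellGood (1 / 20) (47 / 50) 1 x i}))
        (fun a b hab => Subtype.ext (by simpa using congrArg Subtype.val hab))
      exact_mod_cast h
    have := mul_le_mul_of_nonneg_left hle hg.le
    linarith
  · rintro ⟨hf, hc⟩
    exact coerciveTwoShellGap_of_far_contact hd hc hf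


/-! ## §7 Every provable stub of the line, and the crux reduced to its residual UNCONDITIONALLY (finding F9)

`stub_coverFcc_proof`, `stub_coverHcp_proof` (moment method: `Σ u = 0`, `Σ u uᵀ = 8 I` resp.
`72 I` in the integer models, chord bound on the admissible interval), `stub_descent_proof`
(covers ⇒ descent); hence `descent_holds`, `nearFarGlueR_of_contactGap : ContactGapAt 3 → NearFarGlueR`
and `coerciveTwoShellGap_iff : CoerciveTwoShellGap ↔ FarFieldGapR ∧ ContactGapAt 3`.  The only open
input of the crux is the lead's `stub_contactGap` = `ContactGapAt 3` = `ContactGap`. -/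

local notation "E3" => EuclideanSpace ℝ (Fin 3)



/-- Coordinates of the inner product with an integer model vector. [folklore] -/
theorem inner_intVec (u : Fin 3 → ℤ) (w : E3) :
    ⟪intVec u, w⟫_ℝ = (u 0 : ℝ) * w 0 + (u 1 : ℝ) * w 1 + (u 2 : ℝ) * w 2 := by
  simp [intVec, PiLp.inner_apply, Fin.sum_univ_three, mul_comm]

/-- A unit vector of `ℝ³` has `w₀² + w₁² + w₂² = 1`. [folklore] -/
theorem sum_sq_eq_one_of_norm_eq_one {w : E3} (hw : ‖w‖ = 1) :
    w 0 ^ 2 + w 1 ^ 2 + w 2 ^ 2 = 1 := by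
  have h := EuclideanSpace.norm_eq w
  rw [hw] at h
  have h2 : ∑ i, ‖w i‖ ^ 2 = 1 := Real.sqrt_eq_one.1 h.symm
  simpa [Fin.sum_univ_three, Real.norm_eq_abs, sq_abs] using h2


/-- Cauchy–Schwarz in coordinates against a unit vector. [folklore] -/
theorem sq_lin_le {w : E3} (hw2 : w 0 ^ 2 + w 1 ^ 2 + w 2 ^ 2 = 1) (a b c : ℝ) :
    (a * w 0 + b * w 1 + c * w 2) ^ 2 ≤ a ^ 2 + b ^ 2 + c ^ 2 := by
  have e : (a ^ 2 + b ^ 2 + c ^ 2) * (w 0 ^ 2 + w 1 ^ 2 + w 2 ^ 2) - (a * w 0 + b * w 1 + c * w 2) ^ 2 =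
      (a * w 1 - b * w 0) ^ 2 + (a * w 2 - c * w 0) ^ 2 + (b * w 2 - c * w 1) ^ 2 := by ring
  rw [hw2, mul_one] at e
  nlinarith [e, sq_nonneg (a * w 1 - b * w 0), sq_nonneg (a * w 2 - c * w 0),
    sq_nonneg (b * w 2 - c * w 1)]

/-- Chord bound for the fcc case: `T < 9/25`, `T² ≤ 2` ⇒ `T² ≤ 0.54 − 1.14·T`. [folklore] -/
theorem chord_fcc {T : ℝ} (h1 : T < 9 / 25) (h2 : T ^ 2 ≤ 2) : T ^ 2 ≤ 0.54 - 1.14 * T := by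
  have h3 : -1.5 ≤ T := by nlinarith
  have := mul_nonneg (by linarith : (0 : ℝ) ≤ T + 1.5) (by linarith : (0 : ℝ) ≤ 9 / 25 - T)
  nlinarith

/-- Chord bound for the hcp case: `T < 1.07`, `T² ≤ 18` ⇒ `T² ≤ 4.601 − 3.23·T`. [folklore] -/
theorem chord_hcp {T : ℝ} (h1 : T < 1.07) (h2 : T ^ 2 ≤ 18) : T ^ 2 ≤ 4.601 - 3.23 * T := by
  have h3 : -4.3 ≤ T := by nlinarith
  have := mul_nonneg (by linarith : (0 : ℝ) ≤ T + 4.3) (by linarith : (0 : ℝ) ≤ 1.07 - T)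
  nlinarith

/-- Rescaled first-shell correlations are small if no pattern vector is `1/4`-correlated (fcc). [folklore] -/
theorem key_fcc (w : E3) (H : ∀ v ∈ fccTwoShellPattern, ‖v‖ = 1 → ⟪v, w⟫_ℝ < 1 / 4)
    (u : Fin 3 → ℤ) (hu : u ∈ fccInt) :
    (u 0 : ℝ) * w 0 + (u 1 : ℝ) * w 1 + (u 2 : ℝ) * w 2 < 9 / 25 := by
  have hK : (Real.sqrt ((2 : ℕ) : ℝ))⁻¹ • intVec u ∈ fccKissingPattern :=
    Finset.mem_image_of_mem _ hu
  have hv1 := norm_eq_one_of_mem_fccKissingPattern hK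
  have hlt := H _ (fccKissingPattern_subset hK) hv1
  rw [real_inner_smul_left, inner_intVec] at hlt
  have hcast : Real.sqrt ((2 : ℕ) : ℝ) = Real.sqrt 2 := by norm_num
  rw [hcast] at hlt
  have hs2 : Real.sqrt 2 ^ 2 = 2 := Real.sq_sqrt (by norm_num)
  have hs0 : 0 < Real.sqrt 2 := by positivity
  have hsub : Real.sqrt 2 < 1.44 := by nlinarith
  set T : ℝ := (u 0 : ℝ) * w 0 + (u 1 : ℝ) * w 1 + (u 2 : ℝ) * w 2 with hT
  have hTeq : T = Real.sqrt 2 * ((Real.sqrt 2)⁻¹ * T) := by field_simp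
  have h1 : Real.sqrt 2 * ((Real.sqrt 2)⁻¹ * T) < Real.sqrt 2 * (1 / 4) :=
    mul_lt_mul_of_pos_left hlt hs0
  nlinarith [hTeq, h1, hsub]

/-- The same with explicit integer coordinates. [folklore] -/
theorem key_fcc' (w : E3) (H : ∀ v ∈ fccTwoShellPattern, ‖v‖ = 1 → ⟪v, w⟫_ℝ < 1 / 4)
    (a b c : ℤ) (hu : ![a, b, c] ∈ fccInt) :
    (a : ℝ) * w 0 + (b : ℝ) * w 1 + (c : ℝ) * w 2 < 9 / 25 := by
  have h := key_fcc w H _ hu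
  have e0 : (![a, b, c] : Fin 3 → ℤ) 0 = a := rfl
  have e1 : (![a, b, c] : Fin 3 → ℤ) 1 = b := rfl
  have e2 : (![a, b, c] : Fin 3 → ℤ) 2 = c := rfl
  rw [e0, e1, e2] at h
  exact h

/-! ### Membership of the twelve first-shell vectors (one `decide` each) -/

theorem mem_fcc_1 : ![(1 : ℤ), 1, 0] ∈ fccInt := by decide
theorem mem_fcc_2 : ![(1 : ℤ), -1, 0] ∈ fccInt := by decide
theorem mem_fcc_3 : ![((-1) : ℤ), 1, 0] ∈ fccInt := by decide
theorem mem_fcc_4 : ![((-1) : ℤ), -1, 0] ∈ fccInt := by decide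
theorem mem_fcc_5 : ![(1 : ℤ), 0, 1] ∈ fccInt := by decide
theorem mem_fcc_6 : ![(1 : ℤ), 0, -1] ∈ fccInt := by decide
theorem mem_fcc_7 : ![((-1) : ℤ), 0, 1] ∈ fccInt := by decide
theorem mem_fcc_8 : ![((-1) : ℤ), 0, -1] ∈ fccInt := by decide
theorem mem_fcc_9 : ![(0 : ℤ), 1, 1] ∈ fccInt := by decide
theorem mem_fcc_10 : ![(0 : ℤ), 1, -1] ∈ fccInt := by decide
theorem mem_fcc_11 : ![(0 : ℤ), -1, 1] ∈ fccInt := by decide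
theorem mem_fcc_12 : ![(0 : ℤ), -1, -1] ∈ fccInt := by decide
theorem mem_hcp_1 : ![(3 : ℤ), -3, 0] ∈ hcpInt := by decide
theorem mem_hcp_2 : ![((-3) : ℤ), 3, 0] ∈ hcpInt := by decide
theorem mem_hcp_3 : ![(3 : ℤ), 0, -3] ∈ hcpInt := by decide
theorem mem_hcp_4 : ![((-3) : ℤ), 0, 3] ∈ hcpInt := by decide
theorem mem_hcp_5 : ![(0 : ℤ), 3, -3] ∈ hcpInt := by decide
theorem mem_hcp_6 : ![(0 : ℤ), -3, 3] ∈ hcpInt := by decide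
theorem mem_hcp_7 : ![(3 : ℤ), 3, 0] ∈ hcpInt := by decide
theorem mem_hcp_8 : ![(3 : ℤ), 0, 3] ∈ hcpInt := by decide
theorem mem_hcp_9 : ![(0 : ℤ), 3, 3] ∈ hcpInt := by decide
theorem mem_hcp_10 : ![((-1) : ℤ), -1, -4] ∈ hcpInt := by decide
theorem mem_hcp_11 : ![((-1) : ℤ), -4, -1] ∈ hcpInt := by decide
theorem mem_hcp_12 : ![((-4) : ℤ), -1, -1] ∈ hcpInt := by decide

set_option maxHeartbeats 800000 in
/-- **`stub_coverFcc`** (verbatim signature): every unit vector is `1/4`-correlated with a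
first-shell vector of the fcc two-shell pattern (moment method: second moment `4·I`, first
moment `0`, chord bound). [folklore] -/
theorem stub_coverFcc_proof :
    ∀ w : E3, ‖w‖ = 1 → ∃ v ∈ fccTwoShellPattern, ‖v‖ = 1 ∧ (1 / 4 : ℝ) ≤ ⟪v, w⟫_ℝ := by
  intro w hw
  by_contra H
  push Not at H
  have hw2 := sum_sq_eq_one_of_norm_eq_one hw
  have k1 : w 0 + w 1 < 9 / 25 := by
    have h := key_fcc' w H 1 1 0 mem_fcc_1
    push_cast at h
    linarith
  have c1 := chord_fcc k1 (by nlinarith [sq_lin_le hw2 1 1 0])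
  have k2 : w 0 + -w 1 < 9 / 25 := by
    have h := key_fcc' w H 1 (-1) 0 mem_fcc_2
    push_cast at h
    linarith
  have c2 := chord_fcc k2 (by nlinarith [sq_lin_le hw2 1 (-1) 0])
  have k3 : -w 0 + w 1 < 9 / 25 := by
    have h := key_fcc' w H (-1) 1 0 mem_fcc_3
    push_cast at h
    linarith
  have c3 := chord_fcc k3 (by nlinarith [sq_lin_le hw2 (-1) 1 0])
  have k4 : -w 0 + -w 1 < 9 / 25 := by
    have h := key_fcc' w H (-1) (-1) 0 mem_fcc_4
    push_cast at h
    linarith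
  have c4 := chord_fcc k4 (by nlinarith [sq_lin_le hw2 (-1) (-1) 0])
  have k5 : w 0 + w 2 < 9 / 25 := by
    have h := key_fcc' w H 1 0 1 mem_fcc_5
    push_cast at h
    linarith
  have c5 := chord_fcc k5 (by nlinarith [sq_lin_le hw2 1 0 1])
  have k6 : w 0 + -w 2 < 9 / 25 := by
    have h := key_fcc' w H 1 0 (-1) mem_fcc_6
    push_cast at h
    linarith
  have c6 := chord_fcc k6 (by nlinarith [sq_lin_le hw2 1 0 (-1)])
  have k7 : -w 0 + w 2 < 9 / 25 := by
    have h := key_fcc' w H (-1) 0 1 mem_fcc_7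
    push_cast at h
    linarith
  have c7 := chord_fcc k7 (by nlinarith [sq_lin_le hw2 (-1) 0 1])
  have k8 : -w 0 + -w 2 < 9 / 25 := by
    have h := key_fcc' w H (-1) 0 (-1) mem_fcc_8
    push_cast at h
    linarith
  have c8 := chord_fcc k8 (by nlinarith [sq_lin_le hw2 (-1) 0 (-1)])
  have k9 : w 1 + w 2 < 9 / 25 := by
    have h := key_fcc' w H 0 1 1 mem_fcc_9
    push_cast at h
    linarith
  have c9 := chord_fcc k9 (by nlinarith [sq_lin_le hw2 0 1 1])
  have k10 : w 1 + -w 2 < 9 / 25 := by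
    have h := key_fcc' w H 0 1 (-1) mem_fcc_10
    push_cast at h
    linarith
  have c10 := chord_fcc k10 (by nlinarith [sq_lin_le hw2 0 1 (-1)])
  have k11 : -w 1 + w 2 < 9 / 25 := by
    have h := key_fcc' w H 0 (-1) 1 mem_fcc_11
    push_cast at h
    linarith
  have c11 := chord_fcc k11 (by nlinarith [sq_lin_le hw2 0 (-1) 1])
  have k12 : -w 1 + -w 2 < 9 / 25 := by
    have h := key_fcc' w H 0 (-1) (-1) mem_fcc_12
    push_cast at h
    linarith
  have c12 := chord_fcc k12 (by nlinarith [sq_lin_le hw2 0 (-1) (-1)])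
  linarith [c1, c2, c3, c4, c5, c6, c7, c8, c9, c10, c11, c12, hw2]

/-- Rescaled first-shell correlations are small if no pattern vector is `1/4`-correlated (hcp). [folklore] -/
theorem key_hcp (w : E3) (H : ∀ v ∈ hcpTwoShellPattern, ‖v‖ = 1 → ⟪v, w⟫_ℝ < 1 / 4)
    (u : Fin 3 → ℤ) (hu : u ∈ hcpInt) :
    (u 0 : ℝ) * w 0 + (u 1 : ℝ) * w 1 + (u 2 : ℝ) * w 2 < 1.07 := by
  have hK : (Real.sqrt ((18 : ℕ) : ℝ))⁻¹ • intVec u ∈ hcpKissingPattern :=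
    Finset.mem_image_of_mem _ hu
  have hv1 := norm_eq_one_of_mem_hcpKissingPattern hK
  have hlt := H _ (hcpKissingPattern_subset hK) hv1
  rw [real_inner_smul_left, inner_intVec] at hlt
  have hcast : Real.sqrt ((18 : ℕ) : ℝ) = Real.sqrt 18 := by norm_num
  rw [hcast] at hlt
  have hs2 : Real.sqrt 18 ^ 2 = 18 := Real.sq_sqrt (by norm_num)
  have hs0 : 0 < Real.sqrt 18 := by positivity
  have hsub : Real.sqrt 18 < 4.28 := by nlinarith
  set T : ℝ := (u 0 : ℝ) * w 0 + (u 1 : ℝ) * w 1 + (u 2 : ℝ) * w 2 with hT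
  have hTeq : T = Real.sqrt 18 * ((Real.sqrt 18)⁻¹ * T) := by field_simp
  have h1 : Real.sqrt 18 * ((Real.sqrt 18)⁻¹ * T) < Real.sqrt 18 * (1 / 4) :=
    mul_lt_mul_of_pos_left hlt hs0
  nlinarith [hTeq, h1, hsub]

/-- The same with explicit integer coordinates. [folklore] -/
theorem key_hcp' (w : E3) (H : ∀ v ∈ hcpTwoShellPattern, ‖v‖ = 1 → ⟪v, w⟫_ℝ < 1 / 4)
    (a b c : ℤ) (hu : ![a, b, c] ∈ hcpInt) :
    (a : ℝ) * w 0 + (b : ℝ) * w 1 + (c : ℝ) * w 2 < 1.07 := by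
  have h := key_hcp w H _ hu
  have e0 : (![a, b, c] : Fin 3 → ℤ) 0 = a := rfl
  have e1 : (![a, b, c] : Fin 3 → ℤ) 1 = b := rfl
  have e2 : (![a, b, c] : Fin 3 → ℤ) 2 = c := rfl
  rw [e0, e1, e2] at h
  exact h

set_option maxHeartbeats 800000 in
/-- **`stub_coverHcp`** (verbatim signature): every unit vector is `1/4`-correlated with a
first-shell vector of the hcp two-shell pattern (moment method: second moment `4·I`, first
moment `0`, chord bound). [folklore] -/
theorem stub_coverHcp_proof :
    ∀ w : E3, ‖w‖ = 1 → ∃ v ∈ hcpTwoShellPattern, ‖v‖ = 1 ∧ (1 / 4 : ℝ) ≤ ⟪v, w⟫_ℝ := by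
  intro w hw
  by_contra H
  push Not at H
  have hw2 := sum_sq_eq_one_of_norm_eq_one hw
  have k1 : 3 * w 0 + (-3) * w 1 < 1.07 := by
    have h := key_hcp' w H 3 (-3) 0 mem_hcp_1
    push_cast at h
    linarith
  have c1 := chord_hcp k1 (by nlinarith [sq_lin_le hw2 3 (-3) 0])
  have k2 : (-3) * w 0 + 3 * w 1 < 1.07 := by
    have h := key_hcp' w H (-3) 3 0 mem_hcp_2
    push_cast at h
    linarith
  have c2 := chord_hcp k2 (by nlinarith [sq_lin_le hw2 (-3) 3 0])
  have k3 : 3 * w 0 + (-3) * w 2 < 1.07 := by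
    have h := key_hcp' w H 3 0 (-3) mem_hcp_3
    push_cast at h
    linarith
  have c3 := chord_hcp k3 (by nlinarith [sq_lin_le hw2 3 0 (-3)])
  have k4 : (-3) * w 0 + 3 * w 2 < 1.07 := by
    have h := key_hcp' w H (-3) 0 3 mem_hcp_4
    push_cast at h
    linarith
  have c4 := chord_hcp k4 (by nlinarith [sq_lin_le hw2 (-3) 0 3])
  have k5 : 3 * w 1 + (-3) * w 2 < 1.07 := by
    have h := key_hcp' w H 0 3 (-3) mem_hcp_5
    push_cast at h
    linarith
  have c5 := chord_hcp k5 (by nlinarith [sq_lin_le hw2 0 3 (-3)])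
  have k6 : (-3) * w 1 + 3 * w 2 < 1.07 := by
    have h := key_hcp' w H 0 (-3) 3 mem_hcp_6
    push_cast at h
    linarith
  have c6 := chord_hcp k6 (by nlinarith [sq_lin_le hw2 0 (-3) 3])
  have k7 : 3 * w 0 + 3 * w 1 < 1.07 := by
    have h := key_hcp' w H 3 3 0 mem_hcp_7
    push_cast at h
    linarith
  have c7 := chord_hcp k7 (by nlinarith [sq_lin_le hw2 3 3 0])
  have k8 : 3 * w 0 + 3 * w 2 < 1.07 := by
    have h := key_hcp' w H 3 0 3 mem_hcp_8
    push_cast at h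
    linarith
  have c8 := chord_hcp k8 (by nlinarith [sq_lin_le hw2 3 0 3])
  have k9 : 3 * w 1 + 3 * w 2 < 1.07 := by
    have h := key_hcp' w H 0 3 3 mem_hcp_9
    push_cast at h
    linarith
  have c9 := chord_hcp k9 (by nlinarith [sq_lin_le hw2 0 3 3])
  have k10 : -w 0 + -w 1 + (-4) * w 2 < 1.07 := by
    have h := key_hcp' w H (-1) (-1) (-4) mem_hcp_10
    push_cast at h
    linarith
  have c10 := chord_hcp k10 (by nlinarith [sq_lin_le hw2 (-1) (-1) (-4)])
  have k11 : -w 0 + (-4) * w 1 + -w 2 < 1.07 := by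
    have h := key_hcp' w H (-1) (-4) (-1) mem_hcp_11
    push_cast at h
    linarith
  have c11 := chord_hcp k11 (by nlinarith [sq_lin_le hw2 (-1) (-4) (-1)])
  have k12 : (-4) * w 0 + -w 1 + -w 2 < 1.07 := by
    have h := key_hcp' w H (-4) (-1) (-1) mem_hcp_12
    push_cast at h
    linarith
  have c12 := chord_hcp k12 (by nlinarith [sq_lin_le hw2 (-4) (-1) (-1)])
  linarith [c1, c2, c3, c4, c5, c6, c7, c8, c9, c10, c11, c12, hw2]




/-- **Descent** (`stub_descent` verbatim): from a `1/20`-good particle `i`, towards any particle `j`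
farther than `3`, one of the (matched) first-shell neighbours `k` of `i` is strictly closer to `j`:
with `w = (x_j − x_i)/D`, pick a pattern vector `v` (`‖v‖ = 1`) with `⟪A v, w⟫ ≥ 1/4` (covering
hypothesis applied to `A⁻¹ w`), `k = f v`; then `‖x_k − x_i‖ ≤ 21a/20` and
`⟪x_j − x_i, x_k − x_i⟫ ≥ D·a/5`, so `|x_j − x_k|² ≤ D² − 2Da/5 + (21a/20)² < D²` as `D > 3 > 2.76a`.
[folklore] -/
theorem stub_descent_proof :
    (∀ w : E3, ‖w‖ = 1 → ∃ v ∈ fccTwoShellPattern, ‖v‖ = 1 ∧ (1 / 4 : ℝ) ≤ ⟪v, w⟫_ℝ) →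
    (∀ w : E3, ‖w‖ = 1 → ∃ v ∈ hcpTwoShellPattern, ‖v‖ = 1 ∧ (1 / 4 : ℝ) ≤ ⟪v, w⟫_ℝ) →
    ∀ (N : ℕ) (x : Fin N → E3) (i j : Fin N),
      IsTwoShellGood (1 / 20) (47 / 50) 1 x i → ¬ IsTwoShellGood (1 / 20) (47 / 50) 1 x j →
        3 < dist (x j) (x i) →
          ∃ k : Fin N, k ≠ i ∧ dist (x k) (x i) ≤ 21 / 20 ∧ dist (x j) (x k) < dist (x j) (x i) := by
  intro hcovF hcovH N x i j hgood _ hD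
  obtain ⟨a, ha₁, ha₂, A, P, f, hP, hf, hinj, hsurj⟩ := hgood
  have ha0 : 0 < a := by linarith
  set D : ℝ := dist (x j) (x i) with hDdef
  have hD0 : 0 < D := by linarith
  -- the unit direction towards `j`, pulled back through the isometry `A`
  set w : E3 := D⁻¹ • (x j - x i) with hw
  have hw1 : ‖w‖ = 1 := by
    rw [hw, norm_smul, norm_inv, Real.norm_of_nonneg hD0.le, ← dist_eq_norm, ← hDdef,
      inv_mul_cancel₀ hD0.ne']
  set Ae : E3 ≃ₗᵢ[ℝ] E3 := A.toLinearIsometryEquiv rfl with hAe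
  have hAe_apply : ∀ v, Ae v = A v := fun v => by
    rw [hAe, LinearIsometry.toLinearIsometryEquiv_apply]
  set w' : E3 := Ae.symm w with hw'
  have hw'1 : ‖w'‖ = 1 := by rw [hw', LinearIsometryEquiv.norm_map, hw1]
  -- a first-shell pattern vector positively correlated with `w`
  obtain ⟨v, hvP, hv1, hvw⟩ : ∃ v ∈ P, ‖v‖ = 1 ∧ (1 / 4 : ℝ) ≤ ⟪v, w'⟫_ℝ := by
    rcases hP with rfl | rfl
    · exact hcovF w' hw'1
    · exact hcovH w' hw'1
  have hAvw : (1 / 4 : ℝ) ≤ ⟪A v, w⟫_ℝ := by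
    have : ⟪A v, w⟫_ℝ = ⟪v, w'⟫_ℝ := by
      rw [← hAe_apply, hw', ← Ae.inner_map_map v (Ae.symm w), LinearIsometryEquiv.apply_symm_apply]
    rw [this]; exact hvw
  have hAv1 : ‖A v‖ = 1 := by rw [A.norm_map, hv1]
  -- the neighbour `k = f v`
  obtain ⟨hki, hkd⟩ := hf v hvP
  refine ⟨f v, hki, ?_, ?_⟩
  · -- `‖x_k − x_i‖ ≤ a + a/20 ≤ 21/20`
    have h1 : dist (x (f v)) (x i) ≤ dist (x (f v)) (x i + a • A v) + dist (x i + a • A v) (x i) :=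
      dist_triangle _ _ _
    have h2 : dist (x i + a • A v) (x i) = a := by
      rw [dist_eq_norm, add_sub_cancel_left, norm_smul, Real.norm_of_nonneg ha0.le, hAv1, mul_one]
    nlinarith [h1, h2, hkd, ha₂]
  · -- `|x_j − x_k|² < D²`
    set u : E3 := x (f v) - x i with hu
    set e : E3 := u - a • A v with he
    have he_norm : ‖e‖ ≤ 1 / 20 * a := by
      rw [he, hu, ← dist_eq_norm]
      have : dist (x (f v) - x i) (a • A v) = dist (x (f v)) (x i + a • A v) := by
        rw [dist_eq_norm, dist_eq_norm]; congr 1; abel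
      rw [this]; exact hkd
    have hu_norm : ‖u‖ ≤ 21 / 20 * a := by
      have : u = a • A v + e := by rw [he]; abel
      rw [this]
      calc ‖a • A v + e‖ ≤ ‖a • A v‖ + ‖e‖ := norm_add_le _ _
        _ = a + ‖e‖ := by rw [norm_smul, Real.norm_of_nonneg ha0.le, hAv1, mul_one]
        _ ≤ 21 / 20 * a := by linarith
    -- `⟪x_j − x_i, u⟫ ≥ D a / 5`
    have hxw : x j - x i = D • w := by
      rw [hw, smul_smul, mul_inv_cancel₀ hD0.ne', one_smul]
    have hinner : D * (a / 5) ≤ ⟪x j - x i, u⟫_ℝ := by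
      rw [hxw, real_inner_smul_left]
      have hwu : a / 5 ≤ ⟪w, u⟫_ℝ := by
        have hsplit : ⟪w, u⟫_ℝ = a * ⟪A v, w⟫_ℝ + ⟪w, e⟫_ℝ := by
          have : u = a • A v + e := by rw [he]; abel
          rw [this, inner_add_right, real_inner_smul_right, real_inner_comm]
        have hwe : |⟪w, e⟫_ℝ| ≤ 1 / 20 * a := by
          calc |⟪w, e⟫_ℝ| ≤ ‖w‖ * ‖e‖ := abs_real_inner_le_norm _ _
            _ ≤ 1 * (1 / 20 * a) := by rw [hw1]; exact mul_le_mul_of_nonneg_left he_norm zero_le_one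
            _ = 1 / 20 * a := one_mul _
        have := neg_abs_le (⟪w, e⟫_ℝ)
        rw [hsplit]
        nlinarith [hAvw, hwe, this, ha0]
      exact mul_le_mul_of_nonneg_left hwu hD0.le
    -- expand the square
    have hsq : dist (x j) (x (f v)) ^ 2 = D ^ 2 - 2 * ⟪x j - x i, u⟫_ℝ + ‖u‖ ^ 2 := by
      have : x j - x (f v) = (x j - x i) - u := by rw [hu]; abel
      rw [dist_eq_norm, this, norm_sub_sq_real, ← dist_eq_norm, ← hDdef]
    have hu2 : ‖u‖ ^ 2 ≤ (21 / 20 * a) ^ 2 := pow_le_pow_left₀ (norm_nonneg _) hu_norm 2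
    have hlt : dist (x j) (x (f v)) ^ 2 < D ^ 2 := by
      rw [hsq]
      nlinarith [hinner, hu2, ha0, ha₂, hD, hD0]
    exact lt_of_pow_lt_pow_left₀ 2 hD0.le hlt


/-! ### Unconditional reductions -/

/-- **Descent holds** (covers ⇒ descent). [folklore] -/
theorem descent_holds : Descent :=
  stub_descent_proof stub_coverFcc_proof stub_coverHcp_proof

/-- **F9. The crux is implied by its residual alone**: `ContactGap → NearFarGlueR`
(`ContactGap = ContactGapAt 3` = the lead's `stub_contactGap`, verbatim). [folklore] -/
theorem nearFarGlueR_of_contactGap (hc : ContactGap) : NearFarGlueR :=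
  nearFarGlueR_of_descent_contact descent_holds hc

/-- **Structure theorem of the route's engine, unconditional**:
`CoerciveTwoShellGap ↔ FarFieldGapR ∧ ContactGapAt 3`. [folklore] -/
theorem coerciveTwoShellGap_iff : CoerciveTwoShellGap ↔ FarFieldGapR ∧ ContactGapAt 3 :=
  coerciveTwoShellGap_iff_far_and_contact descent_holds


/-! ## §8 The POINTWISE contact gap is false (finding F4, formal)

Natural strengthening of the residual `ContactGap` refuted: "a bad particle within `3` of a good
particle has site energy `≥ e* + g`" fails for every admissible dependence on `δ`
(`Pointwise.not_pointwiseContactGap`; explicit witness: exact fcc two-shell environment of the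
origin + a crowded bad particle at distance `3`).  Filed for landing as
`Theorems/NearFarGlueR/Negative/PointwiseContactGap.lean`. -/

namespace Pointwise



/-! ### Lennard-Jones facts -/

/-- `V_LJ` is increasing on `[1, ∞)`: for `1 ≤ s ≤ t`, `V_LJ(s) ≤ V_LJ(t)`. [folklore] -/
theorem lennardJones_mono_of_one_le {s t : ℝ} (hs : 1 ≤ s) (hst : s ≤ t) :
    lennardJones s ≤ lennardJones t := by
  unfold lennardJones
  have hs0 : 0 < s := by linarith
  have ht0 : 0 < t := by linarith
  set u : ℝ := (s⁻¹) ^ 6 with hu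
  set v : ℝ := (t⁻¹) ^ 6 with hv
  have hu1 : u ≤ 1 := by
    rw [hu]; exact pow_le_one₀ (inv_nonneg.2 hs0.le) (inv_le_one_of_one_le₀ hs)
  have hv0 : 0 ≤ v := by positivity
  have hvu : v ≤ u := pow_le_pow_left₀ (inv_nonneg.2 ht0.le) (inv_anti₀ hs0 hst) 6
  have h12s : (s⁻¹) ^ 12 = u ^ 2 := by rw [hu, ← pow_mul]
  have h12t : (t⁻¹) ^ 12 = v ^ 2 := by rw [hv, ← pow_mul]
  rw [h12s, h12t]
  nlinarith [mul_nonneg (sub_nonneg.2 hvu) (by linarith : (0 : ℝ) ≤ 2 - u - v)]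

/-- `V_LJ(7/5) ≤ −1/50`. [folklore] -/
theorem lennardJones_seven_fifths_le : lennardJones (7 / 5) ≤ -1 / 50 := by
  norm_num [lennardJones]

/-- On `[1, 7/5]` the potential is `≤ −1/50`. [folklore] -/
theorem lennardJones_le_of_mem {d : ℝ} (h1 : 1 ≤ d) (h2 : d ≤ 7 / 5) : lennardJones d ≤ -1 / 50 :=
  (lennardJones_mono_of_one_le h1 h2).trans lennardJones_seven_fifths_le

/-- `V_LJ ≤ 0` on `[1, ∞)`. [folklore] -/
theorem lennardJones_nonpos' {d : ℝ} (h1 : 1 ≤ d) : lennardJones d ≤ 0 := lennardJones_nonpos h1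

/-! ### The witness configuration -/

/-- Positions on the axis: the good centre `0`, the crowded particle `3`, the crowd `4 + 2n/(5M)`. [folklore] -/
def rho (M : ℕ) : ℕ → ℝ
  | 0 => 0
  | 1 => 3
  | n + 2 => 4 + 2 / 5 * (n : ℝ) / M

/-- The axis points as vectors of `ℝ³`. [folklore] -/
def linePt (M : ℕ) (k : Fin (M + 2)) : EuclideanSpace ℝ (Fin 3) :=
  EuclideanSpace.single 0 (rho M k.val)

/-- An enumeration of the eighteen fcc two-shell points. [folklore] -/
def eP : {v // v ∈ fccTwoShellPattern} ≃ Fin 18 :=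
  Fintype.equivFinOfCardEq (by rw [Fintype.card_coe, card_fccTwoShellPattern])

/-- The pattern points, indexed by `Fin 18`. [folklore] -/
def patPt (k : Fin 18) : EuclideanSpace ℝ (Fin 3) := (eP.symm k).1

/-- **The witness**: the exact fcc two-shell environment of the origin, then the axis points. [folklore] -/
def cfg (M : ℕ) : Fin (18 + (M + 2)) → EuclideanSpace ℝ (Fin 3) :=
  Fin.append patPt (linePt M)

/-- The indexed pattern points lie in the pattern. [folklore] -/
theorem patPt_mem (k : Fin 18) : patPt k ∈ fccTwoShellPattern := (eP.symm k).2

/-- Pattern points have norm `≥ 1`. [folklore] -/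
theorem one_le_norm_patPt (k : Fin 18) : 1 ≤ ‖patPt k‖ := by
  rcases norm_of_mem_fccTwoShellPattern (patPt_mem k) with h | h
  · rw [h]
  · rw [h]; exact Real.one_le_sqrt.2 (by norm_num)

/-- Pattern points have norm `≤ √2`. [folklore] -/
theorem norm_patPt_le (k : Fin 18) : ‖patPt k‖ ≤ Real.sqrt 2 :=
  norm_le_sqrt_two_of_mem_twoShellPattern (Or.inl rfl) (patPt_mem k)

/-- `√2 < 1.42`. [folklore] -/
theorem sqrt_two_lt : Real.sqrt 2 < 1.42 := by
  have h := Real.sq_sqrt (show (0:ℝ) ≤ 2 by norm_num)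
  nlinarith [Real.sqrt_nonneg 2]

/-- `‖t e₀‖ = t` for `t ≥ 0`. [folklore] -/
theorem norm_single_zero {t : ℝ} (ht : 0 ≤ t) : ‖EuclideanSpace.single (0 : Fin 3) t‖ = t := by
  rw [EuclideanSpace.norm_eq]
  simp [Real.sqrt_sq ht]

/-- The indexing of the pattern is injective. [folklore] -/
theorem patPt_injective : Function.Injective patPt := fun k l hkl => by
  have : eP.symm k = eP.symm l := Subtype.ext hkl
  exact eP.symm.injective this

/-- Distances between axis points. [folklore] -/
theorem dist_linePt (M : ℕ) (k l : Fin (M + 2)) :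
    dist (linePt M k) (linePt M l) = |rho M k.val - rho M l.val| := by
  rw [linePt, linePt, EuclideanSpace.dist_eq]
  simp [Fin.sum_univ_three]
  exact Real.dist_eq _ _

/-- A pattern point is at distance `≥ 1` from the origin axis point and `≥ 3 − √2` from the others. [folklore] -/
theorem dist_patPt_linePt_ge (M : ℕ) (k : Fin 18) (l : Fin (M + 2)) (hM : 0 < M) :
    1 ≤ dist (patPt k) (linePt M l) := by
  rw [linePt]
  rcases l with ⟨_ | _ | n, hl⟩
  · -- the origin
    simp only [rho]
    rw [show EuclideanSpace.single (0 : Fin 3) (0 : ℝ) = 0 by simp, dist_zero_right]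
    exact one_le_norm_patPt k
  · -- the particle at `3`
    simp only [rho]
    have h := norm_sub_norm_le (EuclideanSpace.single (0 : Fin 3) (3 : ℝ)) (patPt k)
    rw [norm_single_zero (by norm_num : (0:ℝ) ≤ 3), ← dist_eq_norm, dist_comm] at h
    linarith [norm_patPt_le k, sqrt_two_lt]
  · -- a crowd particle at `4 + 2n/(5M) ≥ 4`
    simp only [rho]
    have hpos : (0 : ℝ) ≤ 4 + 2 / 5 * (n : ℝ) / M := by positivity
    have h := norm_sub_norm_le (EuclideanSpace.single (0 : Fin 3) (4 + 2 / 5 * (n : ℝ) / M)) (patPt k)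
    rw [norm_single_zero hpos, ← dist_eq_norm, dist_comm] at h
    have h4 : (4 : ℝ) ≤ 4 + 2 / 5 * (n : ℝ) / M := by linarith [show (0:ℝ) ≤ 2 / 5 * (n : ℝ) / M by positivity]
    linarith [norm_patPt_le k, sqrt_two_lt]

/-- Values of `rho` on the crowd are in `[4, 22/5]`. [folklore] -/
theorem rho_crowd_mem {M n : ℕ} (hn : n < M) :
    (4 : ℝ) ≤ rho M (n + 2) ∧ rho M (n + 2) ≤ 4 + 2 / 5 := by
  have hM : (0 : ℝ) < M := by exact_mod_cast (Nat.zero_le n).trans_lt hn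
  have hnM : (n : ℝ) ≤ M := by exact_mod_cast hn.le
  simp only [rho]
  constructor
  · have : (0 : ℝ) ≤ 2 / 5 * (n : ℝ) / M := by positivity
    linarith
  · have : 2 / 5 * (n : ℝ) / M ≤ 2 / 5 := by
      rw [div_le_iff₀ hM]; nlinarith
    linarith

/-- Distinct crowd points are `2/(5M)`-separated. [folklore] -/
theorem rho_crowd_sep {M n m : ℕ} (hM : 0 < M) (hnm : n ≠ m) :
    2 / (5 * (M : ℝ)) ≤ |rho M (n + 2) - rho M (m + 2)| := by
  have hMr : (0 : ℝ) < M := by exact_mod_cast hM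
  simp only [rho]
  have hdiff : (1 : ℝ) ≤ |(n : ℝ) - (m : ℝ)| := by
    rcases Nat.lt_or_gt_of_ne hnm with h | h
    · have : (n : ℝ) + 1 ≤ m := by exact_mod_cast h
      rw [abs_sub_comm, abs_of_nonneg (by linarith)]; linarith
    · have : (m : ℝ) + 1 ≤ n := by exact_mod_cast h
      rw [abs_of_nonneg (by linarith)]; linarith
  have key : (4 + 2 / 5 * (n : ℝ) / M) - (4 + 2 / 5 * (m : ℝ) / M) = (2 / (5 * M)) * ((n : ℝ) - m) := by
    field_simp; ring
  rw [key, abs_mul, abs_of_pos (by positivity : (0 : ℝ) < 2 / (5 * M))]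
  have h25 : (0 : ℝ) < 2 / (5 * M) := by positivity
  nlinarith

/-- **The witness is `2/(5M)`-separated** (`M ≥ 1`). [folklore] -/
theorem cfg_separated {M : ℕ} (hM : 0 < M) :
    ∀ a b : Fin (18 + (M + 2)), a ≠ b → 2 / (5 * (M : ℝ)) ≤ dist (cfg M a) (cfg M b) := by
  have hMr : (1 : ℝ) ≤ M := by exact_mod_cast hM
  have hδ1 : 2 / (5 * (M : ℝ)) ≤ 1 := by
    rw [div_le_iff₀ (by positivity)]; linarith
  intro a b hab
  induction a using Fin.addCases with
  | left k =>
    induction b using Fin.addCases with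
    | left l =>
      simp only [cfg, Fin.append_left]
      have hkl : k ≠ l := fun h => hab (by rw [h])
      exact hδ1.trans (one_le_dist_of_mem_fccTwoShellPattern (patPt_mem k) (patPt_mem l)
        (fun h => hkl (patPt_injective h)))
    | right l =>
      simp only [cfg, Fin.append_left, Fin.append_right]
      exact hδ1.trans (dist_patPt_linePt_ge M k l hM)
  | right k =>
    induction b using Fin.addCases with
    | left l =>
      simp only [cfg, Fin.append_left, Fin.append_right]
      rw [dist_comm]
      exact hδ1.trans (dist_patPt_linePt_ge M l k hM)
    | right l =>
      simp only [cfg, Fin.append_right]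
      rw [dist_linePt]
      have hkl : k.val ≠ l.val := fun h => hab (by rw [Fin.ext h])
      rcases k with ⟨_ | _ | n, hk⟩ <;> rcases l with ⟨_ | _ | m, hl⟩ <;>
        simp only at hkl ⊢
      · exact absurd rfl hkl
      · simp only [rho]; rw [abs_of_nonpos (by norm_num)]; linarith
      · have := (rho_crowd_mem (M := M) (n := m) (by omega)).1
        simp only [rho] at this ⊢; rw [abs_of_nonpos (by linarith)]; linarith
      · simp only [rho]; rw [abs_of_nonneg (by norm_num)]; linarith
      · exact absurd rfl hkl
      · have := (rho_crowd_mem (M := M) (n := m) (by omega)).1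
        simp only [rho] at this ⊢; rw [abs_of_nonpos (by linarith)]; linarith
      · have := (rho_crowd_mem (M := M) (n := n) (by omega)).1
        simp only [rho] at this ⊢; rw [abs_of_nonneg (by linarith)]; linarith
      · have := (rho_crowd_mem (M := M) (n := n) (by omega)).1
        simp only [rho] at this ⊢; rw [abs_of_nonneg (by linarith)]; linarith
      · exact rho_crowd_sep hM (by omega)

/-! ### Named indices -/

/-- Index of the good centre (the origin). [folklore] -/
def iO (M : ℕ) : Fin (18 + (M + 2)) := Fin.natAdd 18 ⟨0, by omega⟩
/-- Index of the crowded particle at `3`. [folklore] -/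
def iQ (M : ℕ) : Fin (18 + (M + 2)) := Fin.natAdd 18 ⟨1, by omega⟩
/-- Index of the `n`-th crowd particle. [folklore] -/
def iC (M : ℕ) (n : Fin M) : Fin (18 + (M + 2)) := Fin.natAdd 18 ⟨n.val + 2, by omega⟩

/-- The right block of the witness is the axis. [folklore] -/
theorem cfg_natAdd (M : ℕ) (l : Fin (M + 2)) : cfg M (Fin.natAdd 18 l) = linePt M l := by
  rw [cfg, Fin.append_right]

/-- The left block of the witness is the pattern. [folklore] -/
theorem cfg_castAdd (M : ℕ) (k : Fin 18) : cfg M (Fin.castAdd (M + 2) k) = patPt k := by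
  rw [cfg, Fin.append_left]

/-- Position of the good centre. [folklore] -/
theorem cfg_iO (M : ℕ) : cfg M (iO M) = linePt M ⟨0, by omega⟩ := cfg_natAdd M _
/-- Position of the crowded particle. [folklore] -/
theorem cfg_iQ (M : ℕ) : cfg M (iQ M) = linePt M ⟨1, by omega⟩ := cfg_natAdd M _
/-- Position of a crowd particle. [folklore] -/
theorem cfg_iC (M : ℕ) (n : Fin M) : cfg M (iC M n) = linePt M ⟨n.val + 2, by omega⟩ :=
  cfg_natAdd M _

/-- The first axis point is the origin. [folklore] -/
theorem linePt_zero (M : ℕ) : linePt M ⟨0, by omega⟩ = 0 := by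
  simp [linePt, rho]

/-- Crowd indices are distinct. [folklore] -/
theorem iC_injective (M : ℕ) : Function.Injective (iC M) := fun n m h => by
  have := congrArg Fin.val h
  simp [iC] at this
  exact Fin.ext this

/-- A crowd index is not the crowded particle. [folklore] -/
theorem iC_ne_iQ (M : ℕ) (n : Fin M) : iC M n ≠ iQ M := fun h => by
  have := congrArg Fin.val h
  simp [iC, iQ] at this
  omega

/-- A pattern index is not the centre. [folklore] -/
theorem castAdd_ne_iO (M : ℕ) (k : Fin 18) : Fin.castAdd (M + 2) k ≠ iO M := fun h => by
  have := congrArg Fin.val h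
  simp [iO] at this
  omega

/-- Distance from the crowded particle to a crowd particle is in `[1, 7/5]`. [folklore] -/
theorem dist_iQ_iC {M : ℕ} (n : Fin M) :
    1 ≤ dist (cfg M (iQ M)) (cfg M (iC M n)) ∧ dist (cfg M (iQ M)) (cfg M (iC M n)) ≤ 7 / 5 := by
  have hb := rho_crowd_mem (M := M) n.2
  rw [cfg_iQ, cfg_iC, dist_linePt]
  simp only [rho]
  simp only [rho] at hb
  rw [abs_of_nonpos (by linarith)]
  constructor <;> linarith

/-- The crowded particle is at distance `3` from the good centre. [folklore] -/
theorem dist_iO_iQ (M : ℕ) : dist (cfg M (iO M)) (cfg M (iQ M)) = 3 := by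
  rw [cfg_iO, cfg_iQ, dist_linePt]
  simp only [rho]
  norm_num

/-- Every other particle is at distance `≥ 1` from the crowded particle. [folklore] -/
theorem one_le_dist_iQ {M : ℕ} (hM : 0 < M) (j : Fin (18 + (M + 2))) (hj : j ≠ iQ M) :
    1 ≤ dist (cfg M (iQ M)) (cfg M j) := by
  induction j using Fin.addCases with
  | left k =>
    rw [dist_comm, cfg_castAdd, cfg_iQ]
    exact dist_patPt_linePt_ge M k ⟨1, by omega⟩ hM
  | right l =>
    rw [cfg_iQ, cfg_natAdd, dist_linePt]
    rcases l with ⟨_ | _ | n, hl⟩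
    · simp only [rho]; norm_num
    · exact absurd rfl hj
    · have := (rho_crowd_mem (M := M) (n := n) (by omega)).1
      simp only [rho] at this ⊢
      rw [abs_of_nonpos (by linarith)]; linarith

/-! ### Goodness of the centre, badness of the crowded particle -/

/-- The assignment of pattern vectors to particles witnessing the goodness of the centre. [folklore] -/
def assign (M : ℕ) (v : EuclideanSpace ℝ (Fin 3)) : Fin (18 + (M + 2)) :=
  if h : v ∈ fccTwoShellPattern then Fin.castAdd (M + 2) (eP ⟨v, h⟩) else iO M

/-- The assignment on pattern vectors. [folklore] -/
theorem assign_of_mem (M : ℕ) {v : EuclideanSpace ℝ (Fin 3)} (hv : v ∈ fccTwoShellPattern) :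
    assign M v = Fin.castAdd (M + 2) (eP ⟨v, hv⟩) := by
  rw [assign, dif_pos hv]

/-- `patPt ∘ eP = id` on the pattern. [folklore] -/
theorem patPt_eP {v : EuclideanSpace ℝ (Fin 3)} (hv : v ∈ fccTwoShellPattern) :
    patPt (eP ⟨v, hv⟩) = v := by
  simp [patPt]

/-- `eP ∘ patPt = id`. [folklore] -/
theorem eP_patPt (k : Fin 18) : eP ⟨patPt k, patPt_mem k⟩ = k := by
  have : (⟨patPt k, patPt_mem k⟩ : {v // v ∈ fccTwoShellPattern}) = eP.symm k := Subtype.ext rfl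
  rw [this, Equiv.apply_symm_apply]

/-- **The origin is `1/20`-good** (indeed exactly good: its `3/2`-neighbourhood is the fcc two-shell pattern). [folklore] -/
theorem good_iO (M : ℕ) : IsTwoShellGood (1 / 20) (47 / 50) 1 (cfg M) (iO M) := by
  refine ⟨1, by norm_num, le_rfl, LinearIsometry.id, fccTwoShellPattern, assign M,
    Or.inl rfl, fun v hv => ⟨?_, ?_⟩, ?_, fun j hj hd => ?_⟩
  · rw [assign_of_mem M hv]
    exact castAdd_ne_iO M _
  · rw [assign_of_mem M hv, cfg_castAdd, cfg_iO, linePt_zero, patPt_eP hv]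
    simp
  · intro v hv w hw hvw
    have hv' : v ∈ fccTwoShellPattern := hv
    have hw' : w ∈ fccTwoShellPattern := hw
    rw [assign_of_mem M hv', assign_of_mem M hw'] at hvw
    have h1 : (eP ⟨v, hv'⟩).val = (eP ⟨w, hw'⟩).val := by
      have := congrArg Fin.val hvw
      simpa using this
    have h2 : eP ⟨v, hv'⟩ = eP ⟨w, hw'⟩ := Fin.ext h1
    have h3 := eP.injective h2
    exact congrArg Subtype.val h3
  · induction j using Fin.addCases with
    | left k =>
      refine ⟨patPt k, patPt_mem k, ?_⟩
      rw [assign_of_mem M (patPt_mem k), eP_patPt]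
    | right l =>
      exfalso
      rw [cfg_natAdd, cfg_iO, dist_linePt] at hd
      rcases l with ⟨_ | _ | n, hl⟩
      · exact hj rfl
      · simp only [rho] at hd; norm_num at hd
      · have := (rho_crowd_mem (M := M) (n := n) (by omega)).1
        simp only [rho] at hd this
        rw [sub_zero, abs_of_nonneg (by linarith)] at hd
        linarith

/-- `1/20 ≤ 3/2 − √2`. [folklore] -/
theorem one_div_twenty_le : (1 / 20 : ℝ) ≤ 3 / 2 - Real.sqrt 2 := by
  linarith [sqrt_two_lt]

/-- **The crowded particle is bad** as soon as `M ≥ 19`: it has more than `18` particles within `3a/2`. [folklore] -/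
theorem not_good_iQ {M : ℕ} (hM : 19 ≤ M) : ¬ IsTwoShellGood (1 / 20) (47 / 50) 1 (cfg M) (iQ M) := by
  classical
  intro h
  obtain ⟨a, ha₁, ha₂, hcard⟩ := h.card_filter_eq_eighteen (by norm_num) one_div_twenty_le
  set S := (Finset.univ : Finset (Fin M)).image (iC M) with hS
  have hScard : S.card = M := by
    rw [hS, Finset.card_image_of_injective _ (iC_injective M), Finset.card_univ, Fintype.card_fin]
  have hsub : S ⊆ Finset.univ.filter
      (fun j : Fin (18 + (M + 2)) => j ≠ iQ M ∧ dist (cfg M j) (cfg M (iQ M)) ≤ 3 / 2 * a) := by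
    intro j hj
    obtain ⟨n, -, rfl⟩ := Finset.mem_image.1 hj
    refine Finset.mem_filter.2 ⟨Finset.mem_univ _, iC_ne_iQ M n, ?_⟩
    rw [dist_comm]
    linarith [(dist_iQ_iC (M := M) n).2]
  have := Finset.card_le_card hsub
  rw [hScard, hcard] at this
  omega

/-! ### The site energy of the crowded particle -/

/-- **The crowd pushes the site energy of the crowded particle below `−M/100`.** [folklore] -/
theorem halfSite_iQ_le {M : ℕ} (hM : 0 < M) :
    (1 / 2 : ℝ) * ∑ j ∈ Finset.univ.erase (iQ M), lennardJones (dist (cfg M (iQ M)) (cfg M j)) ≤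
      -(M : ℝ) / 100 := by
  classical
  set S := (Finset.univ : Finset (Fin M)).image (iC M) with hS
  have hScard : S.card = M := by
    rw [hS, Finset.card_image_of_injective _ (iC_injective M), Finset.card_univ, Fintype.card_fin]
  have hSsub : S ⊆ Finset.univ.erase (iQ M) := by
    intro j hj
    obtain ⟨n, -, rfl⟩ := Finset.mem_image.1 hj
    exact Finset.mem_erase.2 ⟨iC_ne_iQ M n, Finset.mem_univ _⟩
  have hpt : ∀ j ∈ Finset.univ.erase (iQ M),
      lennardJones (dist (cfg M (iQ M)) (cfg M j)) ≤ if j ∈ S then -1 / 50 else 0 := by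
    intro j hj
    have hjq : j ≠ iQ M := (Finset.mem_erase.1 hj).1
    split_ifs with hjS
    · obtain ⟨n, -, rfl⟩ := Finset.mem_image.1 hjS
      exact lennardJones_le_of_mem (dist_iQ_iC n).1 (dist_iQ_iC n).2
    · exact lennardJones_nonpos (one_le_dist_iQ hM j hjq)
  have hsum := Finset.sum_le_sum hpt
  rw [Finset.sum_ite_mem, Finset.inter_eq_right.2 hSsub, Finset.sum_const, hScard,
    nsmul_eq_mul] at hsum
  linarith

/-! ### The refutation -/

/-- **The pointwise contact gap is FALSE.**  No `g > 0` makes "a bad particle within `3` of a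
good particle has site energy `≥ e* + g`" true on `δ`-separated configurations, whatever `δ > 0`
is allowed to be: the witness `cfg M` (`M = max 19 (⌈−100 e*⌉ + 1)`, `δ = 2/(5M)`) has a good
centre, a bad particle at distance `3` from it, and that particle's site energy is `< e*`.
[folklore] -/
theorem not_pointwiseContactGap :
    ¬ (∀ δ : ℝ, 0 < δ → ∃ g : ℝ, 0 < g ∧ ∀ (N : ℕ) (x : Fin N → EuclideanSpace ℝ (Fin 3)),
        (∀ i j : Fin N, i ≠ j → δ ≤ dist (x i) (x j)) → ∀ j : Fin N,
          ¬ IsTwoShellGood (1 / 20) (47 / 50) 1 x j →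
          (∃ i : Fin N, IsTwoShellGood (1 / 20) (47 / 50) 1 x i ∧ dist (x i) (x j) ≤ 3) →
            (⨅ Q : PeriodicConfiguration 3, Q.energyPerParticle lennardJones) + g ≤
              (1 / 2 : ℝ) * ∑ k ∈ Finset.univ.erase j, lennardJones (dist (x j) (x k))) := by
  intro h
  set e : ℝ := ⨅ Q : PeriodicConfiguration 3, Q.energyPerParticle lennardJones with he
  obtain ⟨M, hMdef⟩ : ∃ M : ℕ, M = max 19 (⌈-100 * e⌉₊ + 1) := ⟨_, rfl⟩
  have hM19 : 19 ≤ M := by rw [hMdef]; exact le_max_left _ _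
  have hM0 : 0 < M := by omega
  have hMe : -(M : ℝ) / 100 < e := by
    have h1 : (⌈-100 * e⌉₊ : ℝ) + 1 ≤ M := by
      have : ⌈-100 * e⌉₊ + 1 ≤ M := by rw [hMdef]; exact le_max_right _ _
      exact_mod_cast this
    have h2 := Nat.le_ceil (-100 * e)
    rw [div_lt_iff₀ (by norm_num : (0:ℝ) < 100)]
    linarith
  have hMr : (0 : ℝ) < M := by exact_mod_cast hM0
  obtain ⟨g, hg, H⟩ := h (2 / (5 * (M : ℝ))) (by positivity)
  have := H (18 + (M + 2)) (cfg M) (cfg_separated hM0) (iQ M) (not_good_iQ hM19)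
    ⟨iO M, good_iO M, by rw [dist_iO_iQ]⟩
  have hsite := halfSite_iQ_le hM0
  linarith


end Pointwise


/-! ## §9 The residual at first-neighbour contact: sharp covers, descent from `21/20`, glue at radius `r ≥ 21/20` (finding F10) -/
/-! ## The glue at a general contact radius `r ≥ 21/20` -/

/-- **Descent from distance `r`**: from a good particle, towards any bad particle farther than `r`,
some first-shell neighbour (within `21/20`) is strictly closer. [folklore] -/
def DescentFrom (r : ℝ) : Prop :=
  ∀ (N : ℕ) (x : Fin N → EuclideanSpace ℝ (Fin 3)) (i j : Fin N),
    IsTwoShellGood (1 / 20) (47 / 50) 1 x i → ¬ IsTwoShellGood (1 / 20) (47 / 50) 1 x j →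
      r < dist (x j) (x i) →
        ∃ k : Fin N, k ≠ i ∧ dist (x k) (x i) ≤ 21 / 20 ∧ dist (x j) (x k) < dist (x j) (x i)

/-- **The near-free glue at contact radius `r ≥ 21/20`**: `DescentFrom r → ContactGapAt r →
FarFieldGapR → CoerciveTwoShellGap` (same proof as at radius `3`). [folklore] -/
theorem coerciveTwoShellGap_of_far_contact_at {r : ℝ} (hr : 21 / 20 ≤ r) (hdesc : DescentFrom r)
    (hcontact : ContactGapAt r) (hfar : FarFieldGapR) : CoerciveTwoShellGap := by
  intro δ hδ
  obtain ⟨g, hg, C', R, hAt⟩ := hfar δ hδ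
  obtain ⟨g₂, hg₂, hCG⟩ := hcontact δ hδ
  -- constants (all chosen from `δ, g, C', R, g₂` only)
  obtain ⟨A, hA⟩ : ∃ A : ℝ, A = (125 / 6 : ℝ) * δ⁻¹ ^ 6 := ⟨_, rfl⟩
  obtain ⟨n₀, hn₀⟩ : ∃ n₀ : ℕ, n₀ = ⌈(125 / 3 : ℝ) * δ⁻¹ ^ 6 / g⌉₊ + 1 := ⟨_, rfl⟩
  obtain ⟨R', hR'⟩ : ∃ R' : ℝ, R' = max (max R r) ((n₀ : ℝ) * δ) := ⟨_, rfl⟩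
  obtain ⟨C'', hC''⟩ : ∃ C'' : ℝ, C'' = max C' 0 := ⟨_, rfl⟩
  obtain ⟨K', hK'⟩ : ∃ K' : ℝ, K' = (2 * R' / δ + 1) ^ 3 + 1 := ⟨_, rfl⟩
  obtain ⟨M, hM⟩ : ∃ M : ℝ, M = (C'' + A) * K' := ⟨_, rfl⟩
  have hA0 : 0 ≤ A := by rw [hA]; positivity
  have hn₀1 : 1 ≤ n₀ := by rw [hn₀]; exact Nat.le_add_left 1 _
  have hn₀pos : (0 : ℝ) < n₀ := by exact_mod_cast hn₀1
  have hn₀ge : (125 / 3 : ℝ) * δ⁻¹ ^ 6 / g ≤ n₀ := by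
    have h1 := Nat.le_ceil ((125 / 3 : ℝ) * δ⁻¹ ^ 6 / g)
    have h2 : (⌈(125 / 3 : ℝ) * δ⁻¹ ^ 6 / g⌉₊ : ℝ) ≤ n₀ := by
      rw [hn₀]; push_cast; linarith
    exact h1.trans h2
  have htailg : (125 / 3 : ℝ) * δ⁻¹ ^ 6 / n₀ ≤ g := by
    rw [div_le_iff₀ hn₀pos]
    have := (div_le_iff₀ hg).1 hn₀ge
    linarith
  have hR'R : R ≤ R' := by rw [hR']; exact (le_max_left _ _).trans (le_max_left _ _)
  have hR'3 : r ≤ R' := by rw [hR']; exact (le_max_right _ _).trans (le_max_left _ _)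
  have hR'n : (n₀ : ℝ) * δ ≤ R' := by rw [hR']; exact le_max_right _ _
  have hR'0 : (0 : ℝ) ≤ R' := by linarith
  have hC''0 : 0 ≤ C'' := by rw [hC'']; exact le_max_right _ _
  have hC''C : C' ≤ C'' := by rw [hC'']; exact le_max_left _ _
  have hK'pos : 0 ≤ (2 * R' / δ + 1) ^ 3 := by positivity
  have hK'1 : 1 ≤ K' := by rw [hK']; linarith
  have hM0 : 0 ≤ M := by rw [hM]; exact mul_nonneg (by linarith) (by linarith)
  refine ⟨g₂ * (g / 2) / (g₂ + M), by positivity, fun N x hsep => ?_⟩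
  classical
  -- the cast of characters (opaque names with defining equations)
  obtain ⟨B, hB⟩ : ∃ B : Finset (Fin N),
      B = Finset.univ.filter (fun i : Fin N => ¬ IsTwoShellGood (1 / 20) (47 / 50) 1 x i) := ⟨_, rfl⟩
  obtain ⟨G, hG⟩ : ∃ G : Finset (Fin N),
      G = Finset.univ.filter (fun i : Fin N => IsTwoShellGood (1 / 20) (47 / 50) 1 x i) := ⟨_, rfl⟩
  obtain ⟨Bc, hBc⟩ : ∃ Bc : Finset (Fin N),
      Bc = Finset.univ.filter (fun j : Fin N => ¬ IsTwoShellGood (1 / 20) (47 / 50) 1 x j ∧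
        ∃ i : Fin N, IsTwoShellGood (1 / 20) (47 / 50) 1 x i ∧ dist (x i) (x j) ≤ r) := ⟨_, rfl⟩
  obtain ⟨bd, hbd⟩ : ∃ bd : Finset (Fin N),
      bd = B.filter (fun i => ∃ j : Fin N, j ∉ B ∧ dist (x j) (x i) ≤ R') := ⟨_, rfl⟩
  have hmemB : ∀ i, i ∈ B ↔ ¬ IsTwoShellGood (1 / 20) (47 / 50) 1 x i := fun i => by
    rw [hB]; simp
  have hmemG : ∀ i, i ∈ G ↔ IsTwoShellGood (1 / 20) (47 / 50) 1 x i := fun i => by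
    rw [hG]; simp
  have hmemBc : ∀ j, j ∈ Bc ↔ (¬ IsTwoShellGood (1 / 20) (47 / 50) 1 x j ∧
      ∃ i : Fin N, IsTwoShellGood (1 / 20) (47 / 50) 1 x i ∧ dist (x i) (x j) ≤ r) := fun j => by
    rw [hBc]; simp
  have hmembd : ∀ i, i ∈ bd ↔ (i ∈ B ∧ ∃ j : Fin N, j ∉ B ∧ dist (x j) (x i) ≤ R') := fun i => by
    rw [hbd, Finset.mem_filter]
  have hGc : Gᶜ = B := by
    ext i; rw [Finset.mem_compl, hmemB, hmemG]
  -- (0) `E − N e* = Σ_B (…) + Σ_G (…)`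
  have hsplit : ∑ i ∈ B, (((1 / 2 : ℝ) * ∑ j ∈ Finset.univ.erase i, lennardJones (dist (x i) (x j))) -
        (⨅ Q : PeriodicConfiguration 3, Q.energyPerParticle lennardJones)) +
      ∑ i ∈ G, (((1 / 2 : ℝ) * ∑ j ∈ Finset.univ.erase i, lennardJones (dist (x i) (x j))) -
        (⨅ Q : PeriodicConfiguration 3, Q.energyPerParticle lennardJones)) =
      interactionEnergy lennardJones x -
        (N : ℝ) * (⨅ Q : PeriodicConfiguration 3, Q.energyPerParticle lennardJones) := by
    have h := sum_halfSite_sub_eStar x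
    rw [← Finset.sum_filter_add_sum_filter_not Finset.univ
      (fun i : Fin N => ¬ IsTwoShellGood (1 / 20) (47 / 50) 1 x i)] at h
    have hGeq : Finset.univ.filter (fun i : Fin N => ¬¬ IsTwoShellGood (1 / 20) (47 / 50) 1 x i) = G := by
      rw [hG]; ext i; simp
    rw [hGeq, ← hB] at h
    exact h
  -- (1) far field on `B`, moved to the radius `R'` and the constant `C'' = max C' 0 ≥ 0`
  have hfarB := hAt N x hsep B (fun i hi => (hmemB i).1 hi)
  have hbdR : (Nat.card {i : Fin N // i ∈ B ∧ ∃ j : Fin N, j ∉ B ∧ dist (x j) (x i) ≤ R} : ℝ) ≤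
      (Nat.card {i : Fin N // i ∈ B ∧ ∃ j : Fin N, j ∉ B ∧ dist (x j) (x i) ≤ R'} : ℝ) := by
    have h := Nat.card_le_card_of_injective
      (fun a : {i : Fin N // i ∈ B ∧ ∃ j : Fin N, j ∉ B ∧ dist (x j) (x i) ≤ R} =>
        (⟨a.1, a.2.1, by obtain ⟨j, hj, hd⟩ := a.2.2; exact ⟨j, hj, hd.trans hR'R⟩⟩ :
          {i : Fin N // i ∈ B ∧ ∃ j : Fin N, j ∉ B ∧ dist (x j) (x i) ≤ R'}))
      (fun a b hab => Subtype.ext (by simpa using congrArg Subtype.val hab))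
    exact_mod_cast h
  have hcardbd : (Nat.card {i : Fin N // i ∈ B ∧ ∃ j : Fin N, j ∉ B ∧ dist (x j) (x i) ≤ R'} : ℝ) =
      bd.card := by
    have e : {i : Fin N // i ∈ B ∧ ∃ j : Fin N, j ∉ B ∧ dist (x j) (x i) ≤ R'} ≃ {i : Fin N // i ∈ bd} :=
      Equiv.subtypeEquivRight fun i => (hmembd i).symm
    rw [Nat.card_congr e, Nat.card_eq_fintype_card, Fintype.card_coe]
  have hnn : (0 : ℝ) ≤ (Nat.card {i : Fin N // i ∈ B ∧ ∃ j : Fin N, j ∉ B ∧ dist (x j) (x i) ≤ R} : ℝ) :=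
    by positivity
  have hfarB' : g * (B.card : ℝ) - C'' * (bd.card : ℝ) ≤
      ∑ i ∈ B, (((1 / 2 : ℝ) * ∑ j ∈ Finset.univ.erase i, lennardJones (dist (x i) (x j))) -
        (⨅ Q : PeriodicConfiguration 3, Q.energyPerParticle lennardJones)) := by
    rw [← hcardbd]
    have h1 : C' * (Nat.card {i : Fin N // i ∈ B ∧ ∃ j : Fin N, j ∉ B ∧ dist (x j) (x i) ≤ R} : ℝ) ≤
        C'' * (Nat.card {i : Fin N // i ∈ B ∧ ∃ j : Fin N, j ∉ B ∧ dist (x j) (x i) ≤ R'} : ℝ) :=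
      (mul_le_mul_of_nonneg_right hC''C hnn).trans (mul_le_mul_of_nonneg_left hbdR hC''0)
    linarith only [hfarB, h1]
  -- (2) the good side: restriction + periodisation + cross attraction charged to `B`
  obtain ⟨fG, hfG⟩ : ∃ fG : Fin G.card ↪ Fin N, fG = (G.orderEmbOfFin rfl).toEmbedding := ⟨_, rfl⟩
  have hmapG : Finset.univ.map fG = G := by rw [hfG]; exact Finset.map_orderEmbOfFin_univ G rfl
  have hGsum := sum_halfSite_eq_restrict x G fG hmapG
  obtain ⟨EG, hEG⟩ : ∃ EG : ℝ, EG = interactionEnergy lennardJones (x ∘ fG) := ⟨_, rfl⟩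
  rw [← hEG] at hGsum
  have hyinj : Function.Injective (x ∘ fG) := fun k l hkl => by
    by_contra hne
    have := hsep (fG k) (fG l) (fun h => hne (fG.injective h))
    have h0 : dist (x (fG k)) (x (fG l)) = 0 := dist_eq_zero.2 hkl
    rw [h0] at this
    exact absurd this (not_le.2 hδ)
  have hper : ((G.card : ℕ) : ℝ) * (⨅ Q : PeriodicConfiguration 3, Q.energyPerParticle lennardJones) ≤
      EG := by
    have := Summit.AtomisticToContinuum.Crystallization.Theorems.ChargedEnergyGapNegative.card_mul_eStar_le
      hyinj
    rw [hEG]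
    exact this
  have hV : ∀ i j : Fin N, i ≠ j →
      -((1 / 6 : ℝ) * (dist (x i) (x j))⁻¹ ^ 6) ≤ lennardJones (dist (x i) (x j)) := fun i j hij =>
    neg_le_lennardJones_of_le (lt_of_lt_of_le hδ (hsep i j hij)) le_rfl
  have hcrossj : ∀ j ∈ B, -((1 / 6 : ℝ) * ∑ i ∈ G, (dist (x j) (x i))⁻¹ ^ 6) ≤
      ∑ i ∈ G, lennardJones (dist (x j) (x i)) := fun j hj => by
    rw [Finset.mul_sum, ← Finset.sum_neg_distrib]
    refine Finset.sum_le_sum fun i hi => hV j i ?_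
    rintro rfl
    exact (hmemB j).1 hj ((hmemG j).1 hi)
  have hbd_j : ∀ j ∈ B, -(2 * A) ≤ ∑ i ∈ G, lennardJones (dist (x j) (x i)) := fun j hj => by
    have hsub : G ⊆ Finset.univ.erase j := fun i hi =>
      Finset.mem_erase.2 ⟨fun h => (hmemB j).1 hj ((hmemG j).1 (h ▸ hi)), Finset.mem_univ _⟩
    have hle : ∑ i ∈ G, (dist (x j) (x i))⁻¹ ^ 6 ≤
        ∑ i ∈ Finset.univ.erase j, (dist (x j) (x i))⁻¹ ^ 6 :=
      Finset.sum_le_sum_of_subset_of_nonneg hsub fun i _ _ => by positivity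
    have hshell := sum_inv_pow_six_le x hδ hsep j
    have hc := hcrossj j hj
    rw [hA]
    linarith only [hc, hle, hshell]
  have hit_j : ∀ j ∈ B, j ∉ bd → -g ≤ ∑ i ∈ G, lennardJones (dist (x j) (x i)) := fun j hj hjbd => by
    have hnot : ∀ i : Fin N, i ∉ B → R' < dist (x i) (x j) := by
      intro i hi
      by_contra hle
      exact hjbd ((hmembd j).2 ⟨hj, i, hi, not_lt.1 hle⟩)
    have hS : ∀ i ∈ G, δ * n₀ ≤ dist (x j) (x i) := fun i hi => by
      have hiB : i ∉ B := fun h => (hmemB i).1 h ((hmemG i).1 hi)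
      have := hnot i hiB
      rw [dist_comm] at this
      have hc : δ * (n₀ : ℝ) = (n₀ : ℝ) * δ := mul_comm _ _
      linarith only [this, hR'n, hc]
    have htail := sum_inv_pow_six_tail_le x hδ hsep j G hn₀1 hS
    have hc := hcrossj j hj
    have h3 : (1 / 6 : ℝ) * (250 * δ⁻¹ ^ 6 / n₀) = (125 / 3 : ℝ) * δ⁻¹ ^ 6 / n₀ := by ring
    have h4 : (1 / 6 : ℝ) * ∑ i ∈ G, (dist (x j) (x i))⁻¹ ^ 6 ≤ (1 / 6 : ℝ) * (250 * δ⁻¹ ^ 6 / n₀) :=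
      mul_le_mul_of_nonneg_left htail (by norm_num)
    linarith only [hc, h3, h4, htailg]
  have hcross : -(2 * A) * (bd.card : ℝ) - g * (B.card : ℝ) ≤
      ∑ i ∈ G, ∑ j ∈ Gᶜ, lennardJones (dist (x i) (x j)) := by
    rw [hGc, Finset.sum_comm]
    have hsym : ∀ j ∈ B, ∑ i ∈ G, lennardJones (dist (x i) (x j)) =
        ∑ i ∈ G, lennardJones (dist (x j) (x i)) := fun j _ =>
      Finset.sum_congr rfl fun i _ => by rw [dist_comm]
    rw [Finset.sum_congr rfl hsym]
    have hpt : ∀ j ∈ B, (if j ∈ bd then -(2 * A) else -g) ≤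
        ∑ i ∈ G, lennardJones (dist (x j) (x i)) := fun j hj => by
      split_ifs with h
      · exact hbd_j j hj
      · exact hit_j j hj h
    have hsum := Finset.sum_le_sum hpt
    have hite : ∑ j ∈ B, (if j ∈ bd then -(2 * A) else -g) =
        -(2 * A) * ((B.filter fun j => j ∈ bd).card : ℝ) +
          -g * ((B.filter fun j => ¬ j ∈ bd).card : ℝ) := by
      rw [Finset.sum_ite, Finset.sum_const, Finset.sum_const, nsmul_eq_mul, nsmul_eq_mul]
      ring
    have hf1 : ((B.filter fun j => j ∈ bd).card : ℝ) = bd.card := by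
      congr 1
      congr 1
      ext j
      rw [Finset.mem_filter, hmembd]
      tauto
    have hf2 : ((B.filter fun j => ¬ j ∈ bd).card : ℝ) ≤ B.card := by
      exact_mod_cast Finset.card_filter_le _ _
    rw [hite, hf1] at hsum
    exact cross_arith hsum hf2 hg.le
  have hGside : -A * (bd.card : ℝ) - g / 2 * (B.card : ℝ) ≤
      ∑ i ∈ G, (((1 / 2 : ℝ) * ∑ j ∈ Finset.univ.erase i, lennardJones (dist (x i) (x j))) -
        (⨅ Q : PeriodicConfiguration 3, Q.energyPerParticle lennardJones)) := by
    rw [Finset.sum_sub_distrib, hGsum, Finset.sum_const, nsmul_eq_mul]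
    linarith only [hper, hcross]
  -- (3) boundary count: `#bd ≤ K' · #Bc` (nearest good particle, one descent step, fibre)
  have hbd_le : (bd.card : ℝ) ≤ K' * (Bc.card : ℝ) := by
    have hfib : ((bd \ Bc).card : ℝ) ≤ (2 * R' / δ + 1) ^ 3 * (Bc.card : ℝ) := by
      refine fibre_count hδ hR'0 x hsep (bd \ Bc) Bc fun j hj => ?_
      obtain ⟨hjbd, hjBc⟩ := Finset.mem_sdiff.1 hj
      obtain ⟨hjB, i', hi'B, hi'd⟩ := (hmembd j).1 hjbd
      have hjbad : ¬ IsTwoShellGood (1 / 20) (47 / 50) 1 x j := (hmemB j).1 hjB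
      have hi'good : IsTwoShellGood (1 / 20) (47 / 50) 1 x i' := by
        by_contra h; exact hi'B ((hmemB i').2 h)
      have hGne : G.Nonempty := ⟨i', (hmemG i').2 hi'good⟩
      obtain ⟨i₀, hi₀G, hmin⟩ := G.exists_min_image (fun i => dist (x j) (x i)) hGne
      have hi₀good : IsTwoShellGood (1 / 20) (47 / 50) 1 x i₀ := (hmemG i₀).1 hi₀G
      have hD_le : dist (x j) (x i₀) ≤ R' := by
        have := hmin i' ((hmemG i').2 hi'good)
        rw [dist_comm] at hi'd
        exact this.trans hi'd
      have hD_gt : r < dist (x j) (x i₀) := by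
        by_contra hle
        push Not at hle
        exact hjBc ((hmemBc j).2 ⟨hjbad, i₀, hi₀good, by rw [dist_comm]; exact hle⟩)
      obtain ⟨k, -, hkd, hkj⟩ := hdesc N x i₀ j hi₀good hjbad hD_gt
      have hkbad : ¬ IsTwoShellGood (1 / 20) (47 / 50) 1 x k := fun hk => by
        have := hmin k ((hmemG k).2 hk)
        linarith
      refine ⟨k, (hmemBc k).2 ⟨hkbad, i₀, hi₀good, ?_⟩, ?_⟩
      · rw [dist_comm]; linarith
      · linarith
    have hsd : (bd.card : ℝ) ≤ ((bd \ Bc).card : ℝ) + (Bc.card : ℝ) := by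
      exact_mod_cast Finset.card_le_card_sdiff_add_card (s := bd) (t := Bc)
    have hexp : K' * (Bc.card : ℝ) = (2 * R' / δ + 1) ^ 3 * (Bc.card : ℝ) + (Bc.card : ℝ) := by
      rw [hK']; ring
    linarith only [hfib, hsd, hexp]
  -- (4) contact gap, with the counts as finset cardinalities
  have hCGx := hCG N x hsep
  have hcardBc : (Nat.card {j : Fin N // ¬ IsTwoShellGood (1 / 20) (47 / 50) 1 x j ∧
      ∃ i : Fin N, IsTwoShellGood (1 / 20) (47 / 50) 1 x i ∧ dist (x i) (x j) ≤ r} : ℝ) = Bc.card := by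
    have e : {j : Fin N // ¬ IsTwoShellGood (1 / 20) (47 / 50) 1 x j ∧
        ∃ i : Fin N, IsTwoShellGood (1 / 20) (47 / 50) 1 x i ∧ dist (x i) (x j) ≤ r} ≃
        {j : Fin N // j ∈ Bc} :=
      Equiv.subtypeEquivRight fun j => (hmemBc j).symm
    rw [Nat.card_congr e, Nat.card_eq_fintype_card, Fintype.card_coe]
  rw [hcardBc] at hCGx
  have hcardB : (Nat.card {i : Fin N // ¬ IsTwoShellGood (1 / 20) (47 / 50) 1 x i} : ℝ) = B.card := by
    have e : {i : Fin N // ¬ IsTwoShellGood (1 / 20) (47 / 50) 1 x i} ≃ {i : Fin N // i ∈ B} :=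
      Equiv.subtypeEquivRight fun i => (hmemB i).symm
    rw [Nat.card_congr e, Nat.card_eq_fintype_card, Fintype.card_coe]
  rw [hcardB]
  -- (5) assemble: X ≥ (g/2) b − M c and X ≥ g₂ c ⇒ X ≥ g₂ (g/2) b / (g₂ + M)
  have h1 : C'' * (bd.card : ℝ) + A * (bd.card : ℝ) ≤ M * (Bc.card : ℝ) :=
    calc C'' * (bd.card : ℝ) + A * (bd.card : ℝ) = (C'' + A) * (bd.card : ℝ) := by ring
      _ ≤ (C'' + A) * (K' * (Bc.card : ℝ)) := mul_le_mul_of_nonneg_left hbd_le (by linarith)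
      _ = M * (Bc.card : ℝ) := by rw [hM]; ring
  have hii : g₂ * (Bc.card : ℝ) ≤ interactionEnergy lennardJones x -
      (N : ℝ) * (⨅ Q : PeriodicConfiguration 3, Q.energyPerParticle lennardJones) := by
    linarith only [hCGx]
  have hden : 0 < g₂ + M := by positivity
  have hfin := glue_arith hsplit hfarB' hGside h1 hii hg₂.le hM0 hden
  linarith only [hfin]





theorem inner_intVec₂ (u : Fin 3 → ℤ) (w : E3) :
    ⟪intVec u, w⟫_ℝ = (u 0 : ℝ) * w 0 + (u 1 : ℝ) * w 1 + (u 2 : ℝ) * w 2 := by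
  simp [intVec, PiLp.inner_apply, Fin.sum_univ_three, mul_comm]

theorem sum_sq_eq_one₂ {w : E3} (hw : ‖w‖ = 1) : w 0 ^ 2 + w 1 ^ 2 + w 2 ^ 2 = 1 := by
  have h := EuclideanSpace.norm_eq w
  rw [hw] at h
  have h2 : ∑ i, ‖w i‖ ^ 2 = 1 := Real.sqrt_eq_one.1 h.symm
  simpa [Fin.sum_univ_three, Real.norm_eq_abs, sq_abs] using h2

/-- A scaled integer vector of the fcc first shell, with its correlation in coordinates. [folklore] -/
theorem fcc_candidate (w : E3) (a b c : ℤ) (hu : ![a, b, c] ∈ fccInt) :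
    ∃ v ∈ fccTwoShellPattern, ‖v‖ = 1 ∧
      ⟪v, w⟫_ℝ = (Real.sqrt 2)⁻¹ * ((a : ℝ) * w 0 + (b : ℝ) * w 1 + (c : ℝ) * w 2) := by
  have hK : (Real.sqrt ((2 : ℕ) : ℝ))⁻¹ • intVec ![a, b, c] ∈ fccKissingPattern :=
    Finset.mem_image_of_mem _ hu
  refine ⟨_, fccKissingPattern_subset hK, norm_eq_one_of_mem_fccKissingPattern hK, ?_⟩
  rw [real_inner_smul_left, inner_intVec₂]
  have hcast : Real.sqrt ((2 : ℕ) : ℝ) = Real.sqrt 2 := by norm_num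
  rw [hcast]
  have e0 : (![a, b, c] : Fin 3 → ℤ) 0 = a := rfl
  have e1 : (![a, b, c] : Fin 3 → ℤ) 1 = b := rfl
  have e2 : (![a, b, c] : Fin 3 → ℤ) 2 = c := rfl
  rw [e0, e1, e2]

/-- A scaled integer vector of the hcp first shell, with its correlation in coordinates. [folklore] -/
theorem hcp_candidate (w : E3) (a b c : ℤ) (hu : ![a, b, c] ∈ hcpInt) :
    ∃ v ∈ hcpTwoShellPattern, ‖v‖ = 1 ∧
      ⟪v, w⟫_ℝ = (Real.sqrt 18)⁻¹ * ((a : ℝ) * w 0 + (b : ℝ) * w 1 + (c : ℝ) * w 2) := by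
  have hK : (Real.sqrt ((18 : ℕ) : ℝ))⁻¹ • intVec ![a, b, c] ∈ hcpKissingPattern :=
    Finset.mem_image_of_mem _ hu
  refine ⟨_, hcpKissingPattern_subset hK, norm_eq_one_of_mem_hcpKissingPattern hK, ?_⟩
  rw [real_inner_smul_left, inner_intVec₂]
  have hcast : Real.sqrt ((18 : ℕ) : ℝ) = Real.sqrt 18 := by norm_num
  rw [hcast]
  have e0 : (![a, b, c] : Fin 3 → ℤ) 0 = a := rfl
  have e1 : (![a, b, c] : Fin 3 → ℤ) 1 = b := rfl
  have e2 : (![a, b, c] : Fin 3 → ℤ) 2 = c := rfl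
  rw [e0, e1, e2]

/-- `(√2)⁻¹ * T ≥ 3/5` as soon as `T ≥ 0.85` (`0.85/√2 = 0.601`). [folklore] -/
theorem inv_sqrt_two_mul_ge {T : ℝ} (hT : 0.85 ≤ T) : (3 / 5 : ℝ) ≤ (Real.sqrt 2)⁻¹ * T := by
  have hs2 : Real.sqrt 2 ^ 2 = 2 := Real.sq_sqrt (by norm_num)
  have hs0 : 0 < Real.sqrt 2 := by positivity
  have hs : Real.sqrt 2 < 1.4143 := by nlinarith
  rw [le_inv_mul_iff₀ hs0]
  nlinarith

/-- `(√18)⁻¹ * T ≥ 3/5` as soon as `T ≥ 2.55` (`2.55/√18 = 0.601`). [folklore] -/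
theorem inv_sqrt_eighteen_mul_ge {T : ℝ} (hT : 2.55 ≤ T) : (3 / 5 : ℝ) ≤ (Real.sqrt 18)⁻¹ * T := by
  have hs2 : Real.sqrt 18 ^ 2 = 18 := Real.sq_sqrt (by norm_num)
  have hs0 : 0 < Real.sqrt 18 := by positivity
  have hs : Real.sqrt 18 < 4.2427 := by nlinarith
  rw [le_inv_mul_iff₀ hs0]
  nlinarith

/-- Two largest coordinates: if `|w_c|` is the smallest then `|w_a| + |w_b| ≥ 1` — in the signed
form used below: `s_a w_a + s_b w_b ≥ 0.85` whenever `s_a w_a = |w_a|`, `s_b w_b = |w_b|`. [folklore] -/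
theorem two_largest {x y z : ℝ} (h : x ^ 2 + y ^ 2 + z ^ 2 = 1) (hx : 0 ≤ x) (hy : 0 ≤ y)
    (hzx : |z| ≤ x) (hzy : |z| ≤ y) : 0.85 ≤ x + y := by
  have hz2 : z ^ 2 ≤ x * y := by
    have : z ^ 2 = |z| * |z| := by rw [← sq_abs, sq]
    rw [this]; exact mul_le_mul hzx hzy (abs_nonneg _) hx
  nlinarith [sq_nonneg (x + y)]

/-- The largest coordinate of a unit vector is `≥ 0.577`. [folklore] -/
theorem largest_ge {x y z : ℝ} (h : x ^ 2 + y ^ 2 + z ^ 2 = 1) (hx : 0 ≤ x) (hy : |y| ≤ x)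
    (hz : |z| ≤ x) : 0.577 ≤ x := by
  have hy2 : y ^ 2 ≤ x ^ 2 := by
    have := mul_self_le_mul_self (abs_nonneg y) hy
    rw [← sq_abs y]; nlinarith
  have hz2 : z ^ 2 ≤ x ^ 2 := by
    have := mul_self_le_mul_self (abs_nonneg z) hz
    rw [← sq_abs z]; nlinarith
  nlinarith

/-- Arithmetic of the all-negative hcp case (`−4` on the largest coordinate). [folklore] -/
theorem hcp_arith₁ {x y z : ℝ} (h : x ^ 2 + y ^ 2 + z ^ 2 = 1) (hx : 0 ≤ x) (hy : 0 ≤ y) (hz : 0 ≤ z)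
    (hyx : y ≤ x) (hzx : z ≤ x) (hzy : z ≤ y) : 2.55 ≤ 4 * x + y + z := by
  have hX := largest_ge h hx (by rw [abs_of_nonneg hy]; exact hyx) (by rw [abs_of_nonneg hz]; exact hzx)
  have hS := two_largest h hx hy (by rw [abs_of_nonneg hz]; exact hzx) (by rw [abs_of_nonneg hz]; exact hzy)
  linarith

/-- Arithmetic of the `(−,−,+)` hcp case, in-plane fallback. [folklore] -/
theorem hcp_arith₂ {x y z : ℝ} (h : x ^ 2 + y ^ 2 + z ^ 2 = 1) (hx : 0 ≤ x) (hy : 0 ≤ y) (hz : 0 ≤ z)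
    (hyx : y ≤ x) (hzx : z ≤ x) (hzy : z ≤ y) (hL : ¬ (2.55 ≤ 4 * x + y - z)) : 2.55 ≤ 3 * x + 3 * z := by
  push Not at hL
  have hX := largest_ge h hx (by rw [abs_of_nonneg hy]; exact hyx) (by rw [abs_of_nonneg hz]; exact hzx)
  have hx64 : x < 0.6375 := by linarith
  have hx2 : x ^ 2 < 0.4065 := by nlinarith
  have hy2 : y ^ 2 ≤ x ^ 2 := by nlinarith
  have hz2 : 0.187 < z ^ 2 := by nlinarith
  have hz43 : 0.43 < z := by nlinarith
  linarith


/-! ### Memberships (one `decide` each) -/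

theorem memF_m1_m1_p0 : ![(-1 : ℤ), -1, 0] ∈ fccInt := by decide
theorem memF_m1_p0_m1 : ![(-1 : ℤ), 0, -1] ∈ fccInt := by decide
theorem memF_m1_p0_p1 : ![(-1 : ℤ), 0, 1] ∈ fccInt := by decide
theorem memF_m1_p1_p0 : ![(-1 : ℤ), 1, 0] ∈ fccInt := by decide
theorem memF_p0_m1_m1 : ![(0 : ℤ), -1, -1] ∈ fccInt := by decide
theorem memF_p0_m1_p1 : ![(0 : ℤ), -1, 1] ∈ fccInt := by decide
theorem memF_p0_p1_m1 : ![(0 : ℤ), 1, -1] ∈ fccInt := by decide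
theorem memF_p0_p1_p1 : ![(0 : ℤ), 1, 1] ∈ fccInt := by decide
theorem memF_p1_m1_p0 : ![(1 : ℤ), -1, 0] ∈ fccInt := by decide
theorem memF_p1_p0_m1 : ![(1 : ℤ), 0, -1] ∈ fccInt := by decide
theorem memF_p1_p0_p1 : ![(1 : ℤ), 0, 1] ∈ fccInt := by decide
theorem memF_p1_p1_p0 : ![(1 : ℤ), 1, 0] ∈ fccInt := by decide
theorem memH_m4_m1_m1 : ![(-4 : ℤ), -1, -1] ∈ hcpInt := by decide
theorem memH_m3_p0_p3 : ![(-3 : ℤ), 0, 3] ∈ hcpInt := by decide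
theorem memH_m3_p3_p0 : ![(-3 : ℤ), 3, 0] ∈ hcpInt := by decide
theorem memH_m1_m4_m1 : ![(-1 : ℤ), -4, -1] ∈ hcpInt := by decide
theorem memH_m1_m1_m4 : ![(-1 : ℤ), -1, -4] ∈ hcpInt := by decide
theorem memH_p0_m3_p3 : ![(0 : ℤ), -3, 3] ∈ hcpInt := by decide
theorem memH_p0_p3_m3 : ![(0 : ℤ), 3, -3] ∈ hcpInt := by decide
theorem memH_p0_p3_p3 : ![(0 : ℤ), 3, 3] ∈ hcpInt := by decide
theorem memH_p3_m3_p0 : ![(3 : ℤ), -3, 0] ∈ hcpInt := by decide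
theorem memH_p3_p0_m3 : ![(3 : ℤ), 0, -3] ∈ hcpInt := by decide
theorem memH_p3_p0_p3 : ![(3 : ℤ), 0, 3] ∈ hcpInt := by decide
theorem memH_p3_p3_p0 : ![(3 : ℤ), 3, 0] ∈ hcpInt := by decide

/-- Which of three reals is the smallest. [folklore] -/
theorem min3_cases (p q r : ℝ) : (r ≤ p ∧ r ≤ q) ∨ (q ≤ p ∧ q ≤ r) ∨ (p ≤ q ∧ p ≤ r) := by
  rcases le_total r p with h1 | h1 <;> rcases le_total r q with h2 | h2 <;>
    rcases le_total p q with h3 | h3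
  · exact Or.inl ⟨h1, h2⟩
  · exact Or.inl ⟨h1, h2⟩
  · exact Or.inr (Or.inl ⟨by linarith, h2⟩)
  · exact Or.inr (Or.inl ⟨h3, h2⟩)
  · exact Or.inr (Or.inr ⟨h3, h1⟩)
  · exact Or.inr (Or.inr ⟨by linarith, h1⟩)
  · exact Or.inr (Or.inr ⟨h3, h1⟩)
  · exact Or.inr (Or.inl ⟨h3, by linarith⟩)

/-- Packaging: an fcc candidate with rescaled correlation `≥ 0.85` has correlation `≥ 3/5`. [folklore] -/
theorem fcc_of_bound (w : E3) (a b c : ℤ) (hu : ![a, b, c] ∈ fccInt)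
    (hT : 0.85 ≤ (a : ℝ) * w 0 + (b : ℝ) * w 1 + (c : ℝ) * w 2) :
    ∃ v ∈ fccTwoShellPattern, ‖v‖ = 1 ∧ (3 / 5 : ℝ) ≤ ⟪v, w⟫_ℝ := by
  obtain ⟨v, hv, hv1, hinner⟩ := fcc_candidate w a b c hu
  exact ⟨v, hv, hv1, by rw [hinner]; exact inv_sqrt_two_mul_ge hT⟩

/-- Packaging: an hcp candidate with rescaled correlation `≥ 2.55` has correlation `≥ 3/5`. [folklore] -/
theorem hcp_of_bound (w : E3) (a b c : ℤ) (hu : ![a, b, c] ∈ hcpInt)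
    (hT : 2.55 ≤ (a : ℝ) * w 0 + (b : ℝ) * w 1 + (c : ℝ) * w 2) :
    ∃ v ∈ hcpTwoShellPattern, ‖v‖ = 1 ∧ (3 / 5 : ℝ) ≤ ⟪v, w⟫_ℝ := by
  obtain ⟨v, hv, hv1, hinner⟩ := hcp_candidate w a b c hu
  exact ⟨v, hv, hv1, by rw [hinner]; exact inv_sqrt_eighteen_mul_ge hT⟩

set_option maxHeartbeats 800000 in
/-- **Sharper fcc cover** (constant `3/5`; true value `√2/2`): the two largest coordinates of `w`,
signed, give a first-shell vector `(s_a e_a + s_b e_b)/√2` with correlation `(|w_a|+|w_b|)/√2 ≥ 1/√2`. [folklore] -/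
theorem sharp_coverFcc :
    ∀ w : E3, ‖w‖ = 1 → ∃ v ∈ fccTwoShellPattern, ‖v‖ = 1 ∧ (3 / 5 : ℝ) ≤ ⟪v, w⟫_ℝ := by
  intro w hw
  have hw2 := sum_sq_eq_one₂ hw
  rcases min3_cases |w 0| |w 1| |w 2| with ⟨h20, h21⟩ | ⟨h10, h12⟩ | ⟨h01, h02⟩
  · rcases le_total 0 (w 0) with ha | ha <;> rcases le_total 0 (w 1) with hb | hb
    · refine fcc_of_bound w 1 1 0 memF_p1_p1_p0 ?_
      push_cast
      have hS := two_largest (x := w 0) (y := w 1) (z := w 2) (by linear_combination hw2)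
        (by linarith) (by linarith) (by rw [abs_of_nonneg ha] at h20; linarith) (by rw [abs_of_nonneg hb] at h21; linarith)
      linarith
    · refine fcc_of_bound w 1 (-1) 0 memF_p1_m1_p0 ?_
      push_cast
      have hS := two_largest (x := w 0) (y := -w 1) (z := w 2) (by linear_combination hw2)
        (by linarith) (by linarith) (by rw [abs_of_nonneg ha] at h20; linarith) (by rw [abs_of_nonpos hb] at h21; linarith)
      linarith
    · refine fcc_of_bound w (-1) 1 0 memF_m1_p1_p0 ?_
      push_cast
      have hS := two_largest (x := -w 0) (y := w 1) (z := w 2) (by linear_combination hw2)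
        (by linarith) (by linarith) (by rw [abs_of_nonpos ha] at h20; linarith) (by rw [abs_of_nonneg hb] at h21; linarith)
      linarith
    · refine fcc_of_bound w (-1) (-1) 0 memF_m1_m1_p0 ?_
      push_cast
      have hS := two_largest (x := -w 0) (y := -w 1) (z := w 2) (by linear_combination hw2)
        (by linarith) (by linarith) (by rw [abs_of_nonpos ha] at h20; linarith) (by rw [abs_of_nonpos hb] at h21; linarith)
      linarith
  · rcases le_total 0 (w 0) with ha | ha <;> rcases le_total 0 (w 2) with hb | hb
    · refine fcc_of_bound w 1 0 1 memF_p1_p0_p1 ?_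
      push_cast
      have hS := two_largest (x := w 0) (y := w 2) (z := w 1) (by linear_combination hw2)
        (by linarith) (by linarith) (by rw [abs_of_nonneg ha] at h10; linarith) (by rw [abs_of_nonneg hb] at h12; linarith)
      linarith
    · refine fcc_of_bound w 1 0 (-1) memF_p1_p0_m1 ?_
      push_cast
      have hS := two_largest (x := w 0) (y := -w 2) (z := w 1) (by linear_combination hw2)
        (by linarith) (by linarith) (by rw [abs_of_nonneg ha] at h10; linarith) (by rw [abs_of_nonpos hb] at h12; linarith)
      linarith
    · refine fcc_of_bound w (-1) 0 1 memF_m1_p0_p1 ?_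
      push_cast
      have hS := two_largest (x := -w 0) (y := w 2) (z := w 1) (by linear_combination hw2)
        (by linarith) (by linarith) (by rw [abs_of_nonpos ha] at h10; linarith) (by rw [abs_of_nonneg hb] at h12; linarith)
      linarith
    · refine fcc_of_bound w (-1) 0 (-1) memF_m1_p0_m1 ?_
      push_cast
      have hS := two_largest (x := -w 0) (y := -w 2) (z := w 1) (by linear_combination hw2)
        (by linarith) (by linarith) (by rw [abs_of_nonpos ha] at h10; linarith) (by rw [abs_of_nonpos hb] at h12; linarith)
      linarith
  · rcases le_total 0 (w 1) with ha | ha <;> rcases le_total 0 (w 2) with hb | hb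
    · refine fcc_of_bound w 0 1 1 memF_p0_p1_p1 ?_
      push_cast
      have hS := two_largest (x := w 1) (y := w 2) (z := w 0) (by linear_combination hw2)
        (by linarith) (by linarith) (by rw [abs_of_nonneg ha] at h01; linarith) (by rw [abs_of_nonneg hb] at h02; linarith)
      linarith
    · refine fcc_of_bound w 0 1 (-1) memF_p0_p1_m1 ?_
      push_cast
      have hS := two_largest (x := w 1) (y := -w 2) (z := w 0) (by linear_combination hw2)
        (by linarith) (by linarith) (by rw [abs_of_nonneg ha] at h01; linarith) (by rw [abs_of_nonpos hb] at h02; linarith)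
      linarith
    · refine fcc_of_bound w 0 (-1) 1 memF_p0_m1_p1 ?_
      push_cast
      have hS := two_largest (x := -w 1) (y := w 2) (z := w 0) (by linear_combination hw2)
        (by linarith) (by linarith) (by rw [abs_of_nonpos ha] at h01; linarith) (by rw [abs_of_nonneg hb] at h02; linarith)
      linarith
    · refine fcc_of_bound w 0 (-1) (-1) memF_p0_m1_m1 ?_
      push_cast
      have hS := two_largest (x := -w 1) (y := -w 2) (z := w 0) (by linear_combination hw2)
        (by linarith) (by linarith) (by rw [abs_of_nonpos ha] at h01; linarith) (by rw [abs_of_nonpos hb] at h02; linarith)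
      linarith

set_option maxHeartbeats 800000 in
/-- **Sharper hcp cover** (constant `3/5`; true value `√2/2`): as for fcc when the two largest
coordinates are not both negative (those nine vectors are shared); otherwise the lower vectors
`(−4,−1,−1)/√18` (with `−4` on the larger coordinate) or the in-plane vectors `(−3,0,3)/√18`. [folklore] -/
theorem sharp_coverHcp :
    ∀ w : E3, ‖w‖ = 1 → ∃ v ∈ hcpTwoShellPattern, ‖v‖ = 1 ∧ (3 / 5 : ℝ) ≤ ⟪v, w⟫_ℝ := by
  intro w hw
  have hw2 := sum_sq_eq_one₂ hw
  rcases min3_cases |w 0| |w 1| |w 2| with ⟨h20, h21⟩ | ⟨h10, h12⟩ | ⟨h01, h02⟩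
  · rcases le_total 0 (w 0) with ha | ha <;> rcases le_total 0 (w 1) with hb | hb
    · refine hcp_of_bound w 3 3 0 memH_p3_p3_p0 ?_
      push_cast
      have hS := two_largest (x := w 0) (y := w 1) (z := w 2) (by linear_combination hw2)
        (by linarith) (by linarith) (by rw [abs_of_nonneg ha] at h20; linarith) (by rw [abs_of_nonneg hb] at h21; linarith)
      linarith
    · refine hcp_of_bound w 3 (-3) 0 memH_p3_m3_p0 ?_
      push_cast
      have hS := two_largest (x := w 0) (y := -w 1) (z := w 2) (by linear_combination hw2)
        (by linarith) (by linarith) (by rw [abs_of_nonneg ha] at h20; linarith) (by rw [abs_of_nonpos hb] at h21; linarith)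
      linarith
    · refine hcp_of_bound w (-3) 3 0 memH_m3_p3_p0 ?_
      push_cast
      have hS := two_largest (x := -w 0) (y := w 1) (z := w 2) (by linear_combination hw2)
        (by linarith) (by linarith) (by rw [abs_of_nonpos ha] at h20; linarith) (by rw [abs_of_nonneg hb] at h21; linarith)
      linarith
    · rcases le_total 0 (w 2) with hc | hc
      · -- smallest coordinate non-negative
        rcases le_total (w 0) (w 1) with hab | hab
        · by_cases hL : (2.55 : ℝ) ≤ 4 * (-w 0) + (-w 1) - w 2
          · refine hcp_of_bound w (-4) (-1) (-1) memH_m4_m1_m1 ?_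
            push_cast; linarith
          · refine hcp_of_bound w (-3) 0 3 memH_m3_p0_p3 ?_
            push_cast
            have hS := hcp_arith₂ (x := -w 0) (y := -w 1) (z := w 2) (by linear_combination hw2)
              (by linarith) (by linarith) hc (by linarith)
              (by rw [abs_of_nonneg hc, abs_of_nonpos ha] at h20; linarith)
              (by rw [abs_of_nonneg hc, abs_of_nonpos hb] at h21; linarith) hL
            linarith
        · by_cases hL : (2.55 : ℝ) ≤ 4 * (-w 1) + (-w 0) - w 2
          · refine hcp_of_bound w (-1) (-4) (-1) memH_m1_m4_m1 ?_
            push_cast; linarith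
          · refine hcp_of_bound w 0 (-3) 3 memH_p0_m3_p3 ?_
            push_cast
            have hS := hcp_arith₂ (x := -w 1) (y := -w 0) (z := w 2) (by linear_combination hw2)
              (by linarith) (by linarith) hc (by linarith)
              (by rw [abs_of_nonneg hc, abs_of_nonpos hb] at h21; linarith)
              (by rw [abs_of_nonneg hc, abs_of_nonpos ha] at h20; linarith) hL
            linarith
      · -- all three coordinates non-positive
        rcases le_total (w 0) (w 1) with hab | hab
        · refine hcp_of_bound w (-4) (-1) (-1) memH_m4_m1_m1 ?_
          push_cast
          have hS := hcp_arith₁ (x := -w 0) (y := -w 1) (z := -w 2) (by linear_combination hw2)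
            (by linarith) (by linarith) (by linarith) (by linarith)
            (by rw [abs_of_nonpos hc, abs_of_nonpos ha] at h20; linarith)
            (by rw [abs_of_nonpos hc, abs_of_nonpos hb] at h21; linarith)
          linarith
        · refine hcp_of_bound w (-1) (-4) (-1) memH_m1_m4_m1 ?_
          push_cast
          have hS := hcp_arith₁ (x := -w 1) (y := -w 0) (z := -w 2) (by linear_combination hw2)
            (by linarith) (by linarith) (by linarith) (by linarith)
            (by rw [abs_of_nonpos hc, abs_of_nonpos hb] at h21; linarith)
            (by rw [abs_of_nonpos hc, abs_of_nonpos ha] at h20; linarith)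
          linarith
  · rcases le_total 0 (w 0) with ha | ha <;> rcases le_total 0 (w 2) with hb | hb
    · refine hcp_of_bound w 3 0 3 memH_p3_p0_p3 ?_
      push_cast
      have hS := two_largest (x := w 0) (y := w 2) (z := w 1) (by linear_combination hw2)
        (by linarith) (by linarith) (by rw [abs_of_nonneg ha] at h10; linarith) (by rw [abs_of_nonneg hb] at h12; linarith)
      linarith
    · refine hcp_of_bound w 3 0 (-3) memH_p3_p0_m3 ?_
      push_cast
      have hS := two_largest (x := w 0) (y := -w 2) (z := w 1) (by linear_combination hw2)
        (by linarith) (by linarith) (by rw [abs_of_nonneg ha] at h10; linarith) (by rw [abs_of_nonpos hb] at h12; linarith)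
      linarith
    · refine hcp_of_bound w (-3) 0 3 memH_m3_p0_p3 ?_
      push_cast
      have hS := two_largest (x := -w 0) (y := w 2) (z := w 1) (by linear_combination hw2)
        (by linarith) (by linarith) (by rw [abs_of_nonpos ha] at h10; linarith) (by rw [abs_of_nonneg hb] at h12; linarith)
      linarith
    · rcases le_total 0 (w 1) with hc | hc
      · -- smallest coordinate non-negative
        rcases le_total (w 0) (w 2) with hab | hab
        · by_cases hL : (2.55 : ℝ) ≤ 4 * (-w 0) + (-w 2) - w 1
          · refine hcp_of_bound w (-4) (-1) (-1) memH_m4_m1_m1 ?_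
            push_cast; linarith
          · refine hcp_of_bound w (-3) 3 0 memH_m3_p3_p0 ?_
            push_cast
            have hS := hcp_arith₂ (x := -w 0) (y := -w 2) (z := w 1) (by linear_combination hw2)
              (by linarith) (by linarith) hc (by linarith)
              (by rw [abs_of_nonneg hc, abs_of_nonpos ha] at h10; linarith)
              (by rw [abs_of_nonneg hc, abs_of_nonpos hb] at h12; linarith) hL
            linarith
        · by_cases hL : (2.55 : ℝ) ≤ 4 * (-w 2) + (-w 0) - w 1
          · refine hcp_of_bound w (-1) (-1) (-4) memH_m1_m1_m4 ?_
            push_cast; linarith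
          · refine hcp_of_bound w 0 3 (-3) memH_p0_p3_m3 ?_
            push_cast
            have hS := hcp_arith₂ (x := -w 2) (y := -w 0) (z := w 1) (by linear_combination hw2)
              (by linarith) (by linarith) hc (by linarith)
              (by rw [abs_of_nonneg hc, abs_of_nonpos hb] at h12; linarith)
              (by rw [abs_of_nonneg hc, abs_of_nonpos ha] at h10; linarith) hL
            linarith
      · -- all three coordinates non-positive
        rcases le_total (w 0) (w 2) with hab | hab
        · refine hcp_of_bound w (-4) (-1) (-1) memH_m4_m1_m1 ?_
          push_cast
          have hS := hcp_arith₁ (x := -w 0) (y := -w 2) (z := -w 1) (by linear_combination hw2)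
            (by linarith) (by linarith) (by linarith) (by linarith)
            (by rw [abs_of_nonpos hc, abs_of_nonpos ha] at h10; linarith)
            (by rw [abs_of_nonpos hc, abs_of_nonpos hb] at h12; linarith)
          linarith
        · refine hcp_of_bound w (-1) (-1) (-4) memH_m1_m1_m4 ?_
          push_cast
          have hS := hcp_arith₁ (x := -w 2) (y := -w 0) (z := -w 1) (by linear_combination hw2)
            (by linarith) (by linarith) (by linarith) (by linarith)
            (by rw [abs_of_nonpos hc, abs_of_nonpos hb] at h12; linarith)
            (by rw [abs_of_nonpos hc, abs_of_nonpos ha] at h10; linarith)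
          linarith
  · rcases le_total 0 (w 1) with ha | ha <;> rcases le_total 0 (w 2) with hb | hb
    · refine hcp_of_bound w 0 3 3 memH_p0_p3_p3 ?_
      push_cast
      have hS := two_largest (x := w 1) (y := w 2) (z := w 0) (by linear_combination hw2)
        (by linarith) (by linarith) (by rw [abs_of_nonneg ha] at h01; linarith) (by rw [abs_of_nonneg hb] at h02; linarith)
      linarith
    · refine hcp_of_bound w 0 3 (-3) memH_p0_p3_m3 ?_
      push_cast
      have hS := two_largest (x := w 1) (y := -w 2) (z := w 0) (by linear_combination hw2)
        (by linarith) (by linarith) (by rw [abs_of_nonneg ha] at h01; linarith) (by rw [abs_of_nonpos hb] at h02; linarith)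
      linarith
    · refine hcp_of_bound w 0 (-3) 3 memH_p0_m3_p3 ?_
      push_cast
      have hS := two_largest (x := -w 1) (y := w 2) (z := w 0) (by linear_combination hw2)
        (by linarith) (by linarith) (by rw [abs_of_nonpos ha] at h01; linarith) (by rw [abs_of_nonneg hb] at h02; linarith)
      linarith
    · rcases le_total 0 (w 0) with hc | hc
      · -- smallest coordinate non-negative
        rcases le_total (w 1) (w 2) with hab | hab
        · by_cases hL : (2.55 : ℝ) ≤ 4 * (-w 1) + (-w 2) - w 0
          · refine hcp_of_bound w (-1) (-4) (-1) memH_m1_m4_m1 ?_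
            push_cast; linarith
          · refine hcp_of_bound w 3 (-3) 0 memH_p3_m3_p0 ?_
            push_cast
            have hS := hcp_arith₂ (x := -w 1) (y := -w 2) (z := w 0) (by linear_combination hw2)
              (by linarith) (by linarith) hc (by linarith)
              (by rw [abs_of_nonneg hc, abs_of_nonpos ha] at h01; linarith)
              (by rw [abs_of_nonneg hc, abs_of_nonpos hb] at h02; linarith) hL
            linarith
        · by_cases hL : (2.55 : ℝ) ≤ 4 * (-w 2) + (-w 1) - w 0
          · refine hcp_of_bound w (-1) (-1) (-4) memH_m1_m1_m4 ?_
            push_cast; linarith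
          · refine hcp_of_bound w 3 0 (-3) memH_p3_p0_m3 ?_
            push_cast
            have hS := hcp_arith₂ (x := -w 2) (y := -w 1) (z := w 0) (by linear_combination hw2)
              (by linarith) (by linarith) hc (by linarith)
              (by rw [abs_of_nonneg hc, abs_of_nonpos hb] at h02; linarith)
              (by rw [abs_of_nonneg hc, abs_of_nonpos ha] at h01; linarith) hL
            linarith
      · -- all three coordinates non-positive
        rcases le_total (w 1) (w 2) with hab | hab
        · refine hcp_of_bound w (-1) (-4) (-1) memH_m1_m4_m1 ?_
          push_cast
          have hS := hcp_arith₁ (x := -w 1) (y := -w 2) (z := -w 0) (by linear_combination hw2)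
            (by linarith) (by linarith) (by linarith) (by linarith)
            (by rw [abs_of_nonpos hc, abs_of_nonpos ha] at h01; linarith)
            (by rw [abs_of_nonpos hc, abs_of_nonpos hb] at h02; linarith)
          linarith
        · refine hcp_of_bound w (-1) (-1) (-4) memH_m1_m1_m4 ?_
          push_cast
          have hS := hcp_arith₁ (x := -w 2) (y := -w 1) (z := -w 0) (by linear_combination hw2)
            (by linarith) (by linarith) (by linarith) (by linarith)
            (by rw [abs_of_nonpos hc, abs_of_nonpos hb] at h02; linarith)
            (by rw [abs_of_nonpos hc, abs_of_nonpos ha] at h01; linarith)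
          linarith

/-- **Descent from `21/20`** (covers with constant `3/5`): from a good particle `i`, towards any
particle farther than `21/20`, some matched first-shell neighbour is strictly closer
(`|x_j − x_k|² ≤ D² − (11/10)·D·a + (21a/20)² < D²` as `D > 21/20 ≥ 1.05a > 1.0023a`). [folklore] -/
theorem descent_sharp :
    ∀ (N : ℕ) (x : Fin N → E3) (i j : Fin N),
      IsTwoShellGood (1 / 20) (47 / 50) 1 x i → ¬ IsTwoShellGood (1 / 20) (47 / 50) 1 x j →
        21 / 20 < dist (x j) (x i) →
          ∃ k : Fin N, k ≠ i ∧ dist (x k) (x i) ≤ 21 / 20 ∧ dist (x j) (x k) < dist (x j) (x i) := by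
  intro N x i j hgood _ hD
  obtain ⟨a, ha₁, ha₂, A, P, f, hP, hf, hinj, hsurj⟩ := hgood
  have ha0 : 0 < a := by linarith
  set D : ℝ := dist (x j) (x i) with hDdef
  have hD0 : 0 < D := by linarith
  -- the unit direction towards `j`, pulled back through the isometry `A`
  set w : E3 := D⁻¹ • (x j - x i) with hw
  have hw1 : ‖w‖ = 1 := by
    rw [hw, norm_smul, norm_inv, Real.norm_of_nonneg hD0.le, ← dist_eq_norm, ← hDdef,
      inv_mul_cancel₀ hD0.ne']
  set Ae : E3 ≃ₗᵢ[ℝ] E3 := A.toLinearIsometryEquiv rfl with hAe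
  have hAe_apply : ∀ v, Ae v = A v := fun v => by
    rw [hAe, LinearIsometry.toLinearIsometryEquiv_apply]
  set w' : E3 := Ae.symm w with hw'
  have hw'1 : ‖w'‖ = 1 := by rw [hw', LinearIsometryEquiv.norm_map, hw1]
  -- a first-shell pattern vector positively correlated with `w`
  obtain ⟨v, hvP, hv1, hvw⟩ : ∃ v ∈ P, ‖v‖ = 1 ∧ (3 / 5 : ℝ) ≤ ⟪v, w'⟫_ℝ := by
    rcases hP with rfl | rfl
    · exact sharp_coverFcc w' hw'1
    · exact sharp_coverHcp w' hw'1
  have hAvw : (3 / 5 : ℝ) ≤ ⟪A v, w⟫_ℝ := by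
    have : ⟪A v, w⟫_ℝ = ⟪v, w'⟫_ℝ := by
      rw [← hAe_apply, hw', ← Ae.inner_map_map v (Ae.symm w), LinearIsometryEquiv.apply_symm_apply]
    rw [this]; exact hvw
  have hAv1 : ‖A v‖ = 1 := by rw [A.norm_map, hv1]
  -- the neighbour `k = f v`
  obtain ⟨hki, hkd⟩ := hf v hvP
  refine ⟨f v, hki, ?_, ?_⟩
  · -- `‖x_k − x_i‖ ≤ a + a/20 ≤ 21/20`
    have h1 : dist (x (f v)) (x i) ≤ dist (x (f v)) (x i + a • A v) + dist (x i + a • A v) (x i) :=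
      dist_triangle _ _ _
    have h2 : dist (x i + a • A v) (x i) = a := by
      rw [dist_eq_norm, add_sub_cancel_left, norm_smul, Real.norm_of_nonneg ha0.le, hAv1, mul_one]
    nlinarith [h1, h2, hkd, ha₂]
  · -- `|x_j − x_k|² < D²`
    set u : E3 := x (f v) - x i with hu
    set e : E3 := u - a • A v with he
    have he_norm : ‖e‖ ≤ 1 / 20 * a := by
      rw [he, hu, ← dist_eq_norm]
      have : dist (x (f v) - x i) (a • A v) = dist (x (f v)) (x i + a • A v) := by
        rw [dist_eq_norm, dist_eq_norm]; congr 1; abel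
      rw [this]; exact hkd
    have hu_norm : ‖u‖ ≤ 21 / 20 * a := by
      have : u = a • A v + e := by rw [he]; abel
      rw [this]
      calc ‖a • A v + e‖ ≤ ‖a • A v‖ + ‖e‖ := norm_add_le _ _
        _ = a + ‖e‖ := by rw [norm_smul, Real.norm_of_nonneg ha0.le, hAv1, mul_one]
        _ ≤ 21 / 20 * a := by linarith
    -- `⟪x_j − x_i, u⟫ ≥ D a / 5`
    have hxw : x j - x i = D • w := by
      rw [hw, smul_smul, mul_inv_cancel₀ hD0.ne', one_smul]
    have hinner : D * (11 * a / 20) ≤ ⟪x j - x i, u⟫_ℝ := by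
      rw [hxw, real_inner_smul_left]
      have hwu : 11 * a / 20 ≤ ⟪w, u⟫_ℝ := by
        have hsplit : ⟪w, u⟫_ℝ = a * ⟪A v, w⟫_ℝ + ⟪w, e⟫_ℝ := by
          have : u = a • A v + e := by rw [he]; abel
          rw [this, inner_add_right, real_inner_smul_right, real_inner_comm]
        have hwe : |⟪w, e⟫_ℝ| ≤ 1 / 20 * a := by
          calc |⟪w, e⟫_ℝ| ≤ ‖w‖ * ‖e‖ := abs_real_inner_le_norm _ _
            _ ≤ 1 * (1 / 20 * a) := by rw [hw1]; exact mul_le_mul_of_nonneg_left he_norm zero_le_one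
            _ = 1 / 20 * a := one_mul _
        have := neg_abs_le (⟪w, e⟫_ℝ)
        rw [hsplit]
        nlinarith [hAvw, hwe, this, ha0]
      exact mul_le_mul_of_nonneg_left hwu hD0.le
    -- expand the square
    have hsq : dist (x j) (x (f v)) ^ 2 = D ^ 2 - 2 * ⟪x j - x i, u⟫_ℝ + ‖u‖ ^ 2 := by
      have : x j - x (f v) = (x j - x i) - u := by rw [hu]; abel
      rw [dist_eq_norm, this, norm_sub_sq_real, ← dist_eq_norm, ← hDdef]
    have hu2 : ‖u‖ ^ 2 ≤ (21 / 20 * a) ^ 2 := pow_le_pow_left₀ (norm_nonneg _) hu_norm 2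
    have hlt : dist (x j) (x (f v)) ^ 2 < D ^ 2 := by
      rw [hsq]
      nlinarith [hinner, hu2, ha0, ha₂, hD, hD0]
    exact lt_of_pow_lt_pow_left₀ 2 hD0.le hlt


/-! ### The residual at first-neighbour contact (radius `21/20`), unconditional -/

/-- The target implies the contact gap at every radius. [folklore] -/
theorem contactGapAt_of_target (r : ℝ) (hT : CoerciveTwoShellGap) : ContactGapAt r := by
  intro δ hδ
  obtain ⟨g, hg, hall⟩ := hT δ hδ
  refine ⟨g, hg, fun N x hsep => ?_⟩
  have hE := hall N x hsep
  have hle : (Nat.card {j : Fin N // ¬ IsTwoShellGood (1 / 20) (47 / 50) 1 x j ∧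
        ∃ i : Fin N, IsTwoShellGood (1 / 20) (47 / 50) 1 x i ∧ dist (x i) (x j) ≤ r} : ℝ) ≤
      (Nat.card {i : Fin N // ¬ IsTwoShellGood (1 / 20) (47 / 50) 1 x i} : ℝ) := by
    have h := Nat.card_le_card_of_injective
      (fun a : {j : Fin N // ¬ IsTwoShellGood (1 / 20) (47 / 50) 1 x j ∧
          ∃ i : Fin N, IsTwoShellGood (1 / 20) (47 / 50) 1 x i ∧ dist (x i) (x j) ≤ r} =>
        (⟨a.1, a.2.1⟩ : {i : Fin N // ¬ IsTwoShellGood (1 / 20) (47 / 50) 1 x i}))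
      (fun a b hab => Subtype.ext (by simpa using congrArg Subtype.val hab))
    exact_mod_cast h
  have := mul_le_mul_of_nonneg_left hle hg.le
  linarith

/-- Descent from every `r ≥ 21/20`. [folklore] -/
theorem descentFrom_of_le {r : ℝ} (hr : 21 / 20 ≤ r) : DescentFrom r :=
  fun N x i j hi hj hD => descent_sharp N x i j hi hj (lt_of_le_of_lt hr hD)

/-- **F10. The crux from the FIRST-CONTACT residual**: `ContactGapAt r → NearFarGlueR` for every
`r ≥ 21/20` — only bad particles at first-neighbour distance from a good particle need charging. [folklore] -/
theorem nearFarGlueR_of_contactGapAt {r : ℝ} (hr : 21 / 20 ≤ r) (hc : ContactGapAt r) : NearFarGlueR :=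
  fun hf _ => coerciveTwoShellGap_of_far_contact_at hr (descentFrom_of_le hr) hc hf

/-- **Structure theorem at every contact radius `r ≥ 21/20`**, unconditional:
`CoerciveTwoShellGap ↔ FarFieldGapR ∧ ContactGapAt r`. [folklore] -/
theorem coerciveTwoShellGap_iff_at {r : ℝ} (hr : 21 / 20 ≤ r) :
    CoerciveTwoShellGap ↔ FarFieldGapR ∧ ContactGapAt r :=
  ⟨fun hT => ⟨farFieldGapR_of_coerciveTwoShellGap hT, contactGapAt_of_target r hT⟩,
    fun h => coerciveTwoShellGap_of_far_contact_at hr (descentFrom_of_le hr) h.2 h.1⟩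

end Summit.AtomisticToContinuum.Crystallization.Cruxes.NearFarGlueR.Disproof
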